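import Mathlib.Analysis.InnerProductSpace.StandardSubspace
import Mathlib.Analysis.InnerProductSpace.LinearPMap
import Mathlib.Analysis.InnerProductSpace.StarOrder
import Mathlib.Analysis.Complex.PhragmenLindelof
import Mathlib.Analysis.Complex.OpenMapping
import Mathlib.Analysis.Complex.LocallyUniformLimit
import Mathlib.Analysis.CStarAlgebra.ContinuousLinearMap
import Mathlib.Analysis.CStarAlgebra.ContinuousFunctionalCalculus.Basic
import Mathlib.Analysis.SpecialFunctions.ContinuousFunctionalCalculus.ExpLog.Basic
import Mathlib.Analysis.SpecialFunctions.Exponential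
import Mathlib.Analysis.SpecialFunctions.Pow.Real
import Mathlib.Analysis.SpecialFunctions.Log.Basic
import Mathlib.Topology.ContinuousMap.Weierstrass
import Literature.Analysis.UnboundedOperators.UnitaryRep
import HarnessLib

/-!
# Standard subspaces: the Tomita operator, modular data, and the one-particle
# Borchers and Wiesbrock theorems

Topic `Literature/MathematicalPhysics/AQFT` (definition item `defn-StandardSubspace`, wanted by route
`QuantumFields/YangMills/MirrorModularBoosts`, item `CurvatureBoostCovariance` → layer-2 child
`ModularBoostCovariance`; shared interest with `CriticalPhenomena/ModularBoosts`).

Mathlib already has the NOTION: `StandardSubspace H` (Tanimoto 2026,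
`Mathlib/Analysis/InnerProductSpace/StandardSubspace.lean`) is a closed real subspace `V` of a
complex inner product space with `V ⊓ iV = ⊥` (`IsSeparating`) and `V ⊔ iV = ⊤` in the lattice of
closed real subspaces, i.e. `V + iV` dense (`IsCyclic`), together with `StandardSubspace.symplComp`
(the symplectic complement `V' = {x | Im ⟪y, x⟫ = 0 ∀ y ∈ V}`, `ClosedSubmodule.mem_symplComp_iff`)
and `V'' = V`; its TODO list is "Define the Tomita conjugation, prove Tomita's theorem, prove the
KMS condition". We do NOT redefine the notion; this file adds, on top of Mathlib's structure and of
the tree's strongly continuous one-parameter unitary groups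
(`Literature.Analysis.UnboundedOperators.OneParameterUnitaryGroup`, Stone generator
`UnitaryRep.hamiltonian` with `U(t) = e^{itP}`, `UnitaryRep.HasPositiveEnergy`), following
R. Longo's lecture notes, Ch. 2 (the reference of the Mathlib file):

* membership forms of separation and cyclicity (`eq_zero_of_mem_of_I_smul_mem`,
  `dense_tomitaDomain`), uniqueness of the decomposition `x = v + i w` (`decomp_unique`);
* CONSTRUCTED: the **Tomita operator** `S_V : v + i w ↦ v − i w` as a conjugate-linear partially
  defined operator `tomitaOperator V : H →ₛₗ.[starRingEnd ℂ] H` with domain the complex subspace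
  `tomitaDomain V = V + iV` (Longo, §2.1, p. 22: "Define the anti-linear operator `S ≡ S_H`,
  `D(S) ≡ H + iH`, `S : ξ + iη ↦ ξ − iη` … well-defined and densely defined … `S² = 1|_{D(S)}` …
  `S_H` is a closed operator"): `tomitaOperator_apply_eq`, `dense_tomitaDomain`,
  `tomitaOperator_tomitaOperator` (`S² = 1`), `tomitaOperator_eq_self_iff` (`ker(1 − S) = V`,
  Lemma 2.1.1 / Prop. 2.1.2), `isClosed_tomitaGraph` (closedness, via
  `v = (x + Sx)/2`, `w = (x − Sx)/2i`, cf. (2.1.2) and BGL Prop. 2.3);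
* AXIOMATISED (Mathlib has no polar decomposition / Borel functional calculus for unbounded closed
  operators, so `S_V = J_V Δ_V^{1/2}` cannot be constructed today): the **modular data**
  `ModularData V` = the modular unitary group `U(t) = Δ_V^{it}` (a `OneParameterUnitaryGroup`, so
  `U.hamiltonian = log Δ_V` is available as a genuine unbounded operator) and the modular conjugation
  `J_V : H ≃ₗᵢ⋆[ℂ] H` (an antiunitary), subject to the printed theorems: `J² = 1` and `J` commutes
  with `Δ^{it}` (Prop. 2.1.3 (a),(b)); `Δ^{it} V = V`, `J V = V'` (Thm. 2.1.4, "the real Hilbert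
  subspace version of the fundamental Tomita–Takesaki theorem"); `(Jξ, ξ) ≥ 0` on `V` (Prop. 2.1.9);
  the polar decomposition `S_V = J_V Δ_V^{1/2}` itself, in the bounded form "for `x ∈ D(S_V)` the
  orbit `t ↦ Δ^{-it} x` continues analytically and boundedly to the strip `0 ≤ Im z ≤ 1/2` with
  value `Δ^{1/2} x = J_V S_V x` at `z = i/2`"; and the one-particle **KMS condition** at inverse
  temperature `1` for `t ↦ Δ^{-it}` (Prop. 2.1.7). By Prop. 2.1.7 (converse half: a unitary group
  leaving `V` invariant and satisfying KMS IS `Δ^{-it}`) and Prop. 2.1.9 (`J_V` is the unique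
  antiunitary involution with `JV ⊇ V'` and `(Jξ,ξ) ≥ 0`), the axioms determine `(U, J)` UNIQUELY,
  so a statement quantified over `D : ModularData V` is a statement about the genuine modular
  objects; existence and uniqueness are the named facts `exists_modularData`,
  `subsingleton_modularData`; the latter is DISCHARGED (`subsingleton_modularData_holds`) by the
  bounded argument of Rieffel–van Daele 1977, Thm. 3.8 (a bounded holomorphic function on the
  strip `0 ≤ Im z ≤ 1/2`, real on both edges, is constant), the two `polar` continuations playing
  the role of their entire vectors; the complex analysis (`eq_zero_of_eq_zero_on_real`,
  `eq_apply_zero_of_im_eq_zero_on_edges`) comes from Mathlib's Phragmén–Lindelöf principle;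
* DISCHARGED (appended 2026-08-15, `exists_modularData_holds`, final section of this file): the
  EXISTENCE of the modular data is now a theorem, by the BOUNDED approach of Rieffel–van Daele
  1977 (Def. 2.1, Prop. 2.2, Prop. 2.3, Prop. 3.1, Def. 3.2, Prop. 3.3, Lemma 3.6, Prop. 3.7,
  Appendix): `P, Q` the real-orthogonal projections onto `V, iV`; `R = P + Q` (complex-linear,
  self-adjoint, spectrum in `[0, 2]`, `Ker R = Ker (2 - R) = 0`); `B = P - Q` (conjugate-linear,
  `B² = A = R(2 - R)`, `B R = (2 - R) B`, `B P = (1 - Q) B`); `T = A^{1/2}` with `‖T y‖ = ‖B y‖`, so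
  `J T = B` defines the antiunitary involution `J` (`J P = (1 - Q) J`, `J R = (2 - R) J`);
  `Δ^{it} = (2 - R)^{it} R^{-it}`. Mathlib has only the CONTINUOUS functional calculus, so every
  function of `R` is evaluated on the core `⋃ₙ Range Eₙ`, `Eₙ = bumpₙ(A) → 1` strongly, where the
  cut-offs make `log R - log (2 - R)` bounded and continuous (as in the proof of R–vD Lemma 3.6),
  and `J`, `Δ^{-is}` are the STRONG LIMITS of `B Sₙ` (`T Sₙ = Eₙ`) and of the core unitaries
  `Wₙ(is) = e^{is Lₙ} Eₙ`; the analytic continuation `Δ^{-iz} x` (`x ∈ D(S)`) is the uniform limit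
  on `0 ≤ Im z ≤ 1/2` of the entire functions `z ↦ Wₙ(iz) x` (bound
  `‖Wₙ(iz) x‖² ≤ ‖Eₙ x‖² + ‖Eₙ S x‖²`, endpoint `Wₙ(-1/2) x = J S Eₙ x` from `(2 - R) S = J T`,
  R–vD Appendix), and the KMS function is `F(z) = ⟪Δ^{i z̄/2} η, Δ^{-iz/2} ξ⟫`;
* NAMED FACTS (`def … : Prop`, usable as hypotheses `(h : …)`): `Borchers_oneParticle` — Longo
  Thm. 2.2.1 = Longo–Witten Thm. 2.2, the standard-subspace ("one-particle") version of
  Borchers' 1992 theorem (quoted as Thms. 1–2 in Wiesbrock 1993): `U(s)V ⊆ V (s ≥ 0)` and `±P ≥ 0` give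
  `Δ^{it} U(s) Δ^{-it} = U(e^{∓2πt} s)`, `J U(s) J = U(−s)`; `IsHalfSidedModularInclusion` (§2.4) and
  `Wiesbrock_oneParticle` — Longo Thm. 2.4.1, the standard-subspace version of Wiesbrock 1993
  Thm. 3 / Cor. 6–7 (complete proof: Araki–Zsidó 2005 Thm. 2.1).

Conventions. Mathlib's `⟪x, y⟫_ℂ` is conjugate-linear in `x`; Longo's `(ξ, η)` is linear in `ξ`,
so `(ξ, η)_Longo = ⟪η, ξ⟫_ℂ`: KMS reads `F(t) = ⟪η, Δ^{-it} ξ⟫`, `F(t + i) = ⟪Δ^{-it} ξ, η⟫`, and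
positivity reads `0 ≤ re ⟪ξ, J ξ⟫`. `D.U.appReal t = Δ_V^{it}`; strips are the horizontal ones
`closedStrip a = {0 ≤ Im z ≤ a}`. The real structure on `H` is Mathlib's scoped instance
(`open ClosedSubmodule`), as the Mathlib file prescribes. "`±P > 0`" in Longo Thm. 2.2.1 means
`±P` positive (= non-negative): the proof begins "Replacing `H` with `H'` we may assume `P ≥ 0`",
and Longo–Witten call a standard pair non-degenerate "if the kernel of `P` is `{0}`"; we state
`P ≥ 0` as `T.HasPositiveEnergy` and `−P ≥ 0` as `(-T.hamiltonian).IsPositive`.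

Sources (all read; page numbers of the materialised texts): R. Longo, *Lectures on Conformal Nets,
Part I* (draft 2008), Ch. 2 "Standard subspaces of a Hilbert space", pp. 21–42 (= §2 of Longo,
*Real Hilbert subspaces, modular theory, SL(2,ℝ) and CFT*, Theta 2008) [Longo2008LecturesConformalNets];
R. Longo, E. Witten, CMP 303 (2011) §2, Lemma 2.1, Thm. 2.2 [LongoWitten2010]; R. Brunetti, D. Guido,
R. Longo, RMP 14 (2002) §2, Prop. 2.3, Thm. 3.2 [BrunettiGuidoLongo2002]; originals for von Neumann
algebras: [Borchers1992], [Wiesbrock1993], [ArakiZsido2005]; bounded approach: M. A. Rieffel,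
A. van Daele, Pacific J. Math. 69 (1977), §3, Def. 3.4, Prop. 3.5, Thm. 3.8 (pp. 194–199)
[RieffelVandaele1977].

Deliberately NOT here: the converse of Borchers' theorem (Longo Thm. 2.2.4 = BGL Thm. 3.2, needs the
commutation relation as hypothesis and von Neumann uniqueness of the CCR); `S_V^* = S_{V'}`
(Prop. 2.1.2, needs adjoints of conjugate-linear `LinearPMap`s); the von Neumann algebra versions
(see `Literature.MathematicalPhysics.AQFT.ModularData` for `(M, Ω)`); Bisognano–Wichmann / BGL nets.
A scratch non-vacuity check (not shipped) inhabits `ModularData V` for `V = ℝ ⊂ ℂ`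
(`Δ = 1`, `J = conj`).
-/

noncomputable section

open Complex ComplexConjugate ClosedSubmodule
open scoped InnerProductSpace

namespace Literature.MathematicalPhysics.AQFT

variable {H : Type*} [NormedAddCommGroup H] [InnerProductSpace ℂ H]

namespace StandardSubspace

/-! ### Membership forms of `iV`, separation and cyclicity -/

/-- `x ∈ iS ↔ i x ∈ S` for a closed real subspace `S` (Mathlib's `mulI` is the image under
multiplication by `i`). [folklore] -/
theorem mem_mulI_iff (S : ClosedSubmodule ℝ H) {x : H} : x ∈ S.mulI ↔ I • x ∈ S := by
  rw [mem_mapEquiv_iff, scalarSMulCLE_symm_apply, Units.smul_def, Units.val_inv_eq_inv_val,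
    val_UnitI, inv_I, neg_smul]
  constructor
  · intro h
    simpa using SMulMemClass.smul_mem (-1 : ℝ) h
  · intro h
    simpa using SMulMemClass.smul_mem (-1 : ℝ) h

/-- `i x ∈ iS ↔ x ∈ S`. [folklore] -/
theorem I_smul_mem_mulI_iff (S : ClosedSubmodule ℝ H) {x : H} : I • x ∈ S.mulI ↔ x ∈ S := by
  rw [mem_mulI_iff, smul_smul, I_mul_I, neg_one_smul]
  constructor
  · intro h
    simpa using SMulMemClass.smul_mem (-1 : ℝ) h
  · intro h
    simpa using SMulMemClass.smul_mem (-1 : ℝ) h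

variable (V : StandardSubspace H)

/-- **Separation** in membership form: `x ∈ V` and `i x ∈ V` force `x = 0` (Longo §2.1, p. 21:
"separating if `H ∩ iH = {0}`"; Mathlib field `IsSeparating : V ⊓ V.mulI = ⊥`).
[cite: Longo2008LecturesConformalNets, §2.1 p. 21 (separating)] -/
theorem eq_zero_of_mem_of_I_smul_mem {x : H} (hx : x ∈ V.toClosedSubmodule)
    (hix : I • x ∈ V.toClosedSubmodule) : x = 0 := by
  have h : x ∈ V.toClosedSubmodule ⊓ V.toClosedSubmodule.mulI :=
    ClosedSubmodule.mem_inf.2 ⟨hx, (mem_mulI_iff _).2 hix⟩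
  rw [V.IsSeparating] at h
  exact ClosedSubmodule.mem_bot.1 h

/-- Uniqueness of the decomposition `x = v + i w` with `v, w ∈ V` (Longo §2.1, p. 22: "As `H` is
standard, `S` is well-defined"). [cite: Longo2008LecturesConformalNets, §2.1 p. 22] -/
theorem decomp_unique {v w v' w' : H} (hv : v ∈ V.toClosedSubmodule) (hw : w ∈ V.toClosedSubmodule)
    (hv' : v' ∈ V.toClosedSubmodule) (hw' : w' ∈ V.toClosedSubmodule)
    (h : v + I • w = v' + I • w') : v = v' ∧ w = w' := by
  have h1 : v - v' = I • (w' - w) := by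
    rw [smul_sub]
    exact sub_eq_sub_iff_add_eq_add.mpr (by rw [h, add_comm])
  have hmem : v - v' ∈ V.toClosedSubmodule := by
    simpa [sub_eq_add_neg] using add_mem hv (SMulMemClass.smul_mem (-1 : ℝ) hv')
  have hmem' : w' - w ∈ V.toClosedSubmodule := by
    simpa [sub_eq_add_neg] using add_mem hw' (SMulMemClass.smul_mem (-1 : ℝ) hw)
  have hI : I • (v - v') ∈ V.toClosedSubmodule := by
    rw [h1, smul_smul, I_mul_I, neg_one_smul]
    simpa using SMulMemClass.smul_mem (-1 : ℝ) hmem'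
  have hzero := eq_zero_of_mem_of_I_smul_mem V hmem hI
  have hvv : v = v' := sub_eq_zero.1 hzero
  refine ⟨hvv, ?_⟩
  rw [hvv, add_right_inj] at h
  exact (smul_right_injective H I_ne_zero) h

/-! ### The Tomita operator `S_V` -/

/-- The domain `D(S_V) = V + iV` of the Tomita operator, a COMPLEX subspace of `H`
(Longo §2.1, p. 22: "`D(S) ≡ H + iH`"). [cite: Longo2008LecturesConformalNets, §2.1 p. 22] -/
def tomitaDomain : Submodule ℂ H where
  carrier := {x | ∃ v ∈ V.toClosedSubmodule, ∃ w ∈ V.toClosedSubmodule, v + I • w = x}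
  zero_mem' := ⟨0, zero_mem _, 0, zero_mem _, by simp⟩
  add_mem' := by
    rintro _ _ ⟨v, hv, w, hw, rfl⟩ ⟨v', hv', w', hw', rfl⟩
    exact ⟨v + v', add_mem hv hv', w + w', add_mem hw hw', by rw [smul_add]; abel⟩
  smul_mem' := by
    rintro c _ ⟨v, hv, w, hw, rfl⟩
    refine ⟨c.re • v + (-c.im) • w, add_mem (SMulMemClass.smul_mem _ hv) (SMulMemClass.smul_mem _ hw),
      c.im • v + c.re • w, add_mem (SMulMemClass.smul_mem _ hv) (SMulMemClass.smul_mem _ hw), ?_⟩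
    have hI : ∀ x : H, I • I • x = -x := fun x => by rw [smul_smul, I_mul_I, neg_one_smul]
    conv_rhs => rw [← re_add_im c]
    simp only [← Complex.coe_smul, smul_add, add_smul, mul_smul, hI, smul_neg]
    rw [smul_comm I (c.im : ℂ) v, smul_comm I (c.re : ℂ) w]
    simp only [Complex.ofReal_neg, neg_smul]
    abel

/-- Membership in `D(S_V)`: `x = v + i w` with `v, w ∈ V`. [cite: Longo2008LecturesConformalNets, §2.1 p. 22] -/
theorem mem_tomitaDomain_iff {x : H} : x ∈ tomitaDomain V ↔
    ∃ v ∈ V.toClosedSubmodule, ∃ w ∈ V.toClosedSubmodule, v + I • w = x := Iff.rfl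

/-- `v + i w ∈ D(S_V)` for `v, w ∈ V`. [folklore] -/
theorem add_I_smul_mem_tomitaDomain {v w : H} (hv : v ∈ V.toClosedSubmodule)
    (hw : w ∈ V.toClosedSubmodule) : v + I • w ∈ tomitaDomain V := ⟨v, hv, w, hw, rfl⟩

/-- `V ⊆ D(S_V)`. [folklore] -/
theorem mem_tomitaDomain_of_mem {v : H} (hv : v ∈ V.toClosedSubmodule) : v ∈ tomitaDomain V :=
  ⟨v, hv, 0, zero_mem _, by simp⟩

/-- Scalar bookkeeping: `c • (v + i w) = (re c • v − im c • w) + i (im c • v + re c • w)`. [folklore] -/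
theorem smul_add_I_smul (c : ℂ) (v w : H) :
    c • (v + I • w) = (c.re • v + (-c.im) • w) + I • (c.im • v + c.re • w) := by
  have hI : ∀ x : H, I • I • x = -x := fun x => by rw [smul_smul, I_mul_I, neg_one_smul]
  conv_lhs => rw [← re_add_im c]
  simp only [← Complex.coe_smul, smul_add, add_smul, mul_smul, hI, smul_neg]
  rw [smul_comm I (c.im : ℂ) v, smul_comm I (c.re : ℂ) w]
  simp only [Complex.ofReal_neg, neg_smul]
  abel

/-- Scalar bookkeeping: `conj c • (v − i w) = (re c • v − im c • w) − i (im c • v + re c • w)`. [folklore] -/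
theorem conj_smul_sub_I_smul (c : ℂ) (v w : H) :
    conj c • (v - I • w) = (c.re • v + (-c.im) • w) - I • (c.im • v + c.re • w) := by
  have hI : ∀ x : H, I • I • x = -x := fun x => by rw [smul_smul, I_mul_I, neg_one_smul]
  conv_lhs => rw [← re_add_im (conj c), conj_re, conj_im]
  simp only [← Complex.coe_smul, smul_sub, add_smul, mul_smul, hI, smul_neg, smul_add]
  rw [smul_comm I (c.im : ℂ) v, smul_comm I (c.re : ℂ) w]
  simp only [Complex.ofReal_neg, neg_smul]
  abel

variable {V}

/-- Every `x ∈ D(S_V)` decomposes as `v + i w`, `v, w ∈ V`. [folklore] -/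
theorem exists_decomp (x : tomitaDomain V) :
    ∃ v ∈ V.toClosedSubmodule, ∃ w ∈ V.toClosedSubmodule, v + I • w = (x : H) := x.2

/-- The `V`-component `v` of `x = v + i w ∈ D(S_V)` ("`ξ₁ = ½(ξ + Sξ)`", Longo (2.1.2)).
[cite: Longo2008LecturesConformalNets, §2.1 eq. (2.1.2)] -/
def rePart (x : tomitaDomain V) : H := (exists_decomp x).choose

/-- `rePart x ∈ V`. [folklore] -/
theorem rePart_mem (x : tomitaDomain V) : rePart x ∈ V.toClosedSubmodule :=
  (exists_decomp x).choose_spec.1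

/-- The component `w ∈ V` of `x = v + i w ∈ D(S_V)` ("`ξ₂ = (1/2i)(ξ − Sξ)`", Longo (2.1.2)).
[cite: Longo2008LecturesConformalNets, §2.1 eq. (2.1.2)] -/
def imPart (x : tomitaDomain V) : H := (exists_decomp x).choose_spec.2.choose

/-- `imPart x ∈ V`. [folklore] -/
theorem imPart_mem (x : tomitaDomain V) : imPart x ∈ V.toClosedSubmodule :=
  (exists_decomp x).choose_spec.2.choose_spec.1

/-- `x = rePart x + i • imPart x`. [folklore] -/
theorem rePart_add_I_smul_imPart (x : tomitaDomain V) : rePart x + I • imPart x = x :=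
  (exists_decomp x).choose_spec.2.choose_spec.2

/-- The components are determined by any decomposition (uniqueness). [folklore] -/
theorem rePart_eq_and_imPart_eq (x : tomitaDomain V) {v w : H} (hv : v ∈ V.toClosedSubmodule)
    (hw : w ∈ V.toClosedSubmodule) (h : v + I • w = x) : rePart x = v ∧ imPart x = w :=
  decomp_unique V (rePart_mem x) (imPart_mem x) hv hw (by rw [rePart_add_I_smul_imPart, h])

variable (V)

/-- The **Tomita operator** `S_V` of a standard subspace: the conjugate-linear, densely defined
operator with domain `D(S_V) = V + iV`, `S_V (v + i w) = v − i w` (Longo §2.1, p. 22; BGL 2002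
Prop. 2.3: "`S_W` is the Tomita operator of `𝒦_W`, namely `D(S_W) = 𝒦_W + i𝒦_W` and
`S_W(h + ik) = h − ik`"). Constructed, not axiomatised.
[cite: Longo2008LecturesConformalNets, §2.1 p. 22 (definition of S_H)] -/
def tomitaOperator : H →ₛₗ.[starRingEnd ℂ] H where
  domain := tomitaDomain V
  toFun :=
  { toFun := fun x => rePart x - I • imPart x
    map_add' := by
      intro x y
      have hx := rePart_add_I_smul_imPart x
      have hy := rePart_add_I_smul_imPart y
      obtain ⟨h1, h2⟩ := rePart_eq_and_imPart_eq (x + y) (add_mem (rePart_mem x) (rePart_mem y))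
        (add_mem (imPart_mem x) (imPart_mem y))
        (by rw [Submodule.coe_add, ← hx, ← hy, smul_add]; abel)
      rw [h1, h2, smul_add]
      abel
    map_smul' := by
      intro c x
      have hx := rePart_add_I_smul_imPart x
      obtain ⟨h1, h2⟩ := rePart_eq_and_imPart_eq (c • x)
        (add_mem (SMulMemClass.smul_mem c.re (rePart_mem x))
          (SMulMemClass.smul_mem (-c.im) (imPart_mem x)))
        (add_mem (SMulMemClass.smul_mem c.im (rePart_mem x))
          (SMulMemClass.smul_mem c.re (imPart_mem x)))
        (by rw [Submodule.coe_smul, ← hx, smul_add_I_smul])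
      rw [h1, h2]
      exact (conj_smul_sub_I_smul c (rePart x) (imPart x)).symm }

/-- `D(S_V) = V + iV`. [cite: Longo2008LecturesConformalNets, §2.1 p. 22] -/
@[simp]
theorem tomitaOperator_domain : (tomitaOperator V).domain = tomitaDomain V := rfl

variable {V}

/-- **`S_V (v + i w) = v − i w`** for any decomposition with `v, w ∈ V`.
[cite: Longo2008LecturesConformalNets, §2.1 p. 22] -/
theorem tomitaOperator_apply_eq (x : tomitaDomain V) {v w : H} (hv : v ∈ V.toClosedSubmodule)
    (hw : w ∈ V.toClosedSubmodule) (h : v + I • w = x) : tomitaOperator V x = v - I • w := by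
  obtain ⟨h1, h2⟩ := rePart_eq_and_imPart_eq x hv hw h
  change rePart x - I • imPart x = v - I • w
  rw [h1, h2]

/-- `S_V ⟨v + i w⟩ = v − i w`. [cite: Longo2008LecturesConformalNets, §2.1 p. 22] -/
theorem tomitaOperator_apply_mk {v w : H} (hv : v ∈ V.toClosedSubmodule)
    (hw : w ∈ V.toClosedSubmodule) :
    tomitaOperator V ⟨v + I • w, add_I_smul_mem_tomitaDomain V hv hw⟩ = v - I • w :=
  tomitaOperator_apply_eq _ hv hw rfl

/-- `S_V v = v` for `v ∈ V`. [cite: Longo2008LecturesConformalNets, §2.1 p. 22] -/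
theorem tomitaOperator_apply_of_mem {v : H} (hv : v ∈ V.toClosedSubmodule) :
    tomitaOperator V ⟨v, mem_tomitaDomain_of_mem V hv⟩ = v := by
  rw [tomitaOperator_apply_eq _ hv (zero_mem _) (by simp)]
  simp

/-- `S_V` maps its domain into itself (`R(S) = D(S)`, BGL Prop. 2.2). [cite: BrunettiGuidoLongo2002, Prop. 2.2] -/
theorem tomitaOperator_mem_domain (x : tomitaDomain V) : tomitaOperator V x ∈ tomitaDomain V := by
  refine ⟨rePart x, rePart_mem x, (-1 : ℝ) • imPart x, SMulMemClass.smul_mem _ (imPart_mem x), ?_⟩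
  change _ = rePart x - I • imPart x
  rw [neg_one_smul, smul_neg, sub_eq_add_neg]

/-- **`S_V² = 1` on `D(S_V)`** (Longo §2.1, p. 22: "Clearly `S² = 1|_{D(S)}`").
[cite: Longo2008LecturesConformalNets, §2.1 p. 22] -/
theorem tomitaOperator_tomitaOperator (x : tomitaDomain V) :
    tomitaOperator V ⟨tomitaOperator V x, tomitaOperator_mem_domain x⟩ = x := by
  rw [tomitaOperator_apply_eq _ (rePart_mem x) (SMulMemClass.smul_mem (-1 : ℝ) (imPart_mem x))]
  · conv_rhs => rw [← rePart_add_I_smul_imPart x]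
    rw [neg_one_smul, smul_neg, sub_neg_eq_add]
  · change _ = rePart x - I • imPart x
    rw [neg_one_smul, smul_neg, sub_eq_add_neg]

/-- **`ker (1 − S_V) = V`**: a vector of `D(S_V)` is fixed by `S_V` iff it lies in `V`
(Longo Lemma 2.1.1 / Prop. 2.1.2: "the inverse of the map is `S ↦ ker(1 − S)`").
[cite: Longo2008LecturesConformalNets, Prop. 2.1.2] -/
theorem tomitaOperator_eq_self_iff (x : tomitaDomain V) :
    tomitaOperator V x = x ↔ (x : H) ∈ V.toClosedSubmodule := by
  constructor
  · intro h
    have hx := rePart_add_I_smul_imPart x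
    change rePart x - I • imPart x = x at h
    have h2 : ((2 : ℂ) * I) • imPart x = 0 := by
      have e : rePart x + I • imPart x - (rePart x - I • imPart x) = 0 :=
        sub_eq_zero.2 (hx.trans h.symm)
      rw [show rePart x + I • imPart x - (rePart x - I • imPart x) = I • imPart x + I • imPart x by
        abel] at e
      rw [mul_smul, two_smul]
      exact e
    have h3 : imPart x = 0 :=
      (smul_eq_zero.1 h2).resolve_left (mul_ne_zero two_ne_zero I_ne_zero)
    rw [← hx, h3, smul_zero, add_zero]
    exact rePart_mem x
  · intro h
    rw [tomitaOperator_apply_eq x h (zero_mem _) (by simp)]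
    simp

variable (V)

/-- **`D(S_V)` is dense** (cyclicity of `V`: Mathlib field `IsCyclic : V ⊔ V.mulI = ⊤` in the
lattice of closed real subspaces; Longo §2.1, p. 22: "`S` is … densely defined").
[cite: Longo2008LecturesConformalNets, §2.1 p. 22] -/
theorem dense_tomitaDomain : Dense (tomitaDomain V : Set H) := by
  have hc := V.IsCyclic
  have h1 : ((V.toClosedSubmodule ⊔ V.toClosedSubmodule.mulI : ClosedSubmodule ℝ H) : Set H) =
      Set.univ := by
    rw [hc]; rfl
  rw [ClosedSubmodule.coe_sup] at h1
  have hd : Dense ((V.toClosedSubmodule.toSubmodule ⊔ V.toClosedSubmodule.mulI.toSubmodule :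
      Submodule ℝ H) : Set H) := by
    rw [dense_iff_closure_eq]
    exact h1
  refine hd.mono ?_
  intro x hx
  obtain ⟨v, hv, u, hu, rfl⟩ := Submodule.mem_sup.1 hx
  have hu' : I • u ∈ V.toClosedSubmodule := (mem_mulI_iff _).1 hu
  refine ⟨v, hv, (-I) • u, ?_, ?_⟩
  · simpa [neg_smul] using SMulMemClass.smul_mem (-1 : ℝ) hu'
  · simp [smul_smul]

/-- The graph of `S_V` in `H × H` (Mathlib's `LinearPMap.graph` is for linear, not conjugate-linear,
partial maps). [folklore] -/
def tomitaGraph : Set (H × H) :=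
  {p | ∃ hx : p.1 ∈ tomitaDomain V, tomitaOperator V ⟨p.1, hx⟩ = p.2}

variable {V}

/-- The graph of `S_V` is cut out by `½(x + y) ∈ V` and `(1/2i)(x − y) ∈ V` (Longo (2.1.2):
`ξ = ½(ξ + Sξ) + i · (1/2i)(ξ − Sξ)`). [cite: Longo2008LecturesConformalNets, §2.1 eq. (2.1.2)] -/
theorem mem_tomitaGraph_iff (p : H × H) : p ∈ tomitaGraph V ↔
    (2⁻¹ : ℂ) • (p.1 + p.2) ∈ V.toClosedSubmodule ∧
      (2⁻¹ : ℂ) • ((-I) • (p.1 - p.2)) ∈ V.toClosedSubmodule := by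
  constructor
  · rintro ⟨hx, hS⟩
    have hd := rePart_add_I_smul_imPart (⟨p.1, hx⟩ : tomitaDomain V)
    dsimp only at hd
    change rePart (⟨p.1, hx⟩ : tomitaDomain V) - I • imPart (⟨p.1, hx⟩ : tomitaDomain V) = p.2 at hS
    have e₁ : rePart ⟨p.1, hx⟩ + I • imPart ⟨p.1, hx⟩ + (rePart ⟨p.1, hx⟩ - I • imPart ⟨p.1, hx⟩) =
        p.1 + p.2 := by
      rw [hd, hS]
    have e₂ : rePart ⟨p.1, hx⟩ + I • imPart ⟨p.1, hx⟩ - (rePart ⟨p.1, hx⟩ - I • imPart ⟨p.1, hx⟩) =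
        p.1 - p.2 := by
      rw [hd, hS]
    constructor
    · have : p.1 + p.2 = (2 : ℂ) • rePart ⟨p.1, hx⟩ := by
        rw [← e₁, two_smul]
        abel
      rw [this, smul_smul, inv_mul_cancel₀ two_ne_zero, one_smul]
      exact rePart_mem _
    · have : p.1 - p.2 = (2 : ℂ) • I • imPart ⟨p.1, hx⟩ := by
        rw [← e₂, two_smul]
        abel
      have hc : (2⁻¹ : ℂ) * -I * 2 * I = 1 := by
        rw [show (2⁻¹ : ℂ) * -I * 2 * I = -(I * I) by ring, I_mul_I, neg_neg]
      rw [this, smul_smul, smul_smul, smul_smul, hc, one_smul]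
      exact imPart_mem _
  · rintro ⟨h1, h2⟩
    have hc : I * 2⁻¹ * -I = (2⁻¹ : ℂ) := by
      rw [show I * 2⁻¹ * -I = -(I * I) * 2⁻¹ by ring, I_mul_I]
      ring
    have hvw : (2⁻¹ : ℂ) • (p.1 + p.2) + I • ((2⁻¹ : ℂ) • ((-I) • (p.1 - p.2))) = p.1 := by
      rw [smul_smul, smul_smul, hc, ← smul_add]
      rw [show p.1 + p.2 + (p.1 - p.2) = (2 : ℂ) • p.1 by rw [two_smul]; abel]
      rw [smul_smul, inv_mul_cancel₀ two_ne_zero, one_smul]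
    refine ⟨hvw ▸ add_I_smul_mem_tomitaDomain V h1 h2, ?_⟩
    rw [tomitaOperator_apply_eq _ h1 h2 hvw]
    rw [smul_smul, smul_smul, hc, ← smul_sub]
    rw [show p.1 + p.2 - (p.1 - p.2) = (2 : ℂ) • p.2 by rw [two_smul]; abel]
    rw [smul_smul, inv_mul_cancel₀ two_ne_zero, one_smul]

variable (V)

/-- **`S_V` is a closed operator** (Longo Prop. 2.1.2: "in particular, `S_H` is a closed operator";
BGL Prop. 2.3 via the graph norm). Here: the graph is the preimage of the closed set `V × V` under
the continuous map `(x, y) ↦ (½(x + y), (1/2i)(x − y))`.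
[cite: Longo2008LecturesConformalNets, Prop. 2.1.2] -/
theorem isClosed_tomitaGraph : IsClosed (tomitaGraph V) := by
  have h : tomitaGraph V =
      (fun p : H × H => (2⁻¹ : ℂ) • (p.1 + p.2)) ⁻¹' (V.toClosedSubmodule : Set H) ∩
        (fun p : H × H => (2⁻¹ : ℂ) • ((-I) • (p.1 - p.2))) ⁻¹' (V.toClosedSubmodule : Set H) := by
    ext p
    exact mem_tomitaGraph_iff p
  rw [h]
  exact (V.toClosedSubmodule.isClosed.preimage (by fun_prop)).inter
    (V.toClosedSubmodule.isClosed.preimage (by fun_prop))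

/-- Membership in the symplectic complement `V'` (Mathlib `ClosedSubmodule.mem_symplComp_iff`,
restated for `StandardSubspace.symplComp`): `x ∈ V' ↔ Im ⟪y, x⟫ = 0` for all `y ∈ V`
(Longo §2.1, p. 21: `H' ≡ {ξ : Im(ξ, η) = 0 ∀ η ∈ H}`). [cite: Longo2008LecturesConformalNets, §2.1 p. 21] -/
theorem mem_symplComp_iff' [CompleteSpace H] {x : H} :
    x ∈ V.symplComp.toClosedSubmodule ↔ ∀ y ∈ V.toClosedSubmodule, (⟪y, x⟫_ℂ).im = 0 :=
  ClosedSubmodule.mem_symplComp_iff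

/-- `Im ⟪x, y⟫ = 0` for `x ∈ V`, `y ∈ V'`. [cite: Longo2008LecturesConformalNets, §2.1 p. 21] -/
theorem im_inner_eq_zero_of_mem_of_mem_symplComp [CompleteSpace H] {x y : H}
    (hx : x ∈ V.toClosedSubmodule) (hy : y ∈ V.symplComp.toClosedSubmodule) :
    (⟪x, y⟫_ℂ).im = 0 :=
  (mem_symplComp_iff' V).1 hy x hx

/-- `Im ⟪x, y⟫ = 0` for `x ∈ V'`, `y ∈ V`. [cite: Longo2008LecturesConformalNets, §2.1 p. 21] -/
theorem im_inner_eq_zero_of_mem_symplComp_of_mem [CompleteSpace H] {x y : H}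
    (hx : x ∈ V.symplComp.toClosedSubmodule) (hy : y ∈ V.toClosedSubmodule) :
    (⟪x, y⟫_ℂ).im = 0 := by
  rw [← inner_conj_symm, conj_im, (mem_symplComp_iff' V).1 hx y hy, neg_zero]

/-! ### Antiunitary operators and strips -/

/-- An antiunitary `J` (conjugate-linear isometric bijection, Mathlib `H ≃ₗᵢ⋆[ℂ] H`) reverses inner
products: `⟪J x, J y⟫ = ⟪y, x⟫` (polarization). [folklore] -/
theorem inner_antiunitary (J : H ≃ₗᵢ⋆[ℂ] H) (x y : H) : ⟪J x, J y⟫_ℂ = ⟪y, x⟫_ℂ := by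
  rw [inner_eq_sum_norm_sq_div_four (J x) (J y), inner_eq_sum_norm_sq_div_four y x]
  simp only [RCLike.I_to_complex]
  have hJ : ∀ z : H, J (I • z) = -(I • J z) := fun z => by
    rw [map_smulₛₗ J I z, starRingEnd_apply, star_def, conj_I, neg_smul]
  have h1 : ‖J x + J y‖ = ‖y + x‖ := by rw [← map_add, J.norm_map, add_comm]
  have h2 : ‖J x - J y‖ = ‖y - x‖ := by rw [← map_sub, J.norm_map, norm_sub_rev]
  have h3 : ‖J x - I • J y‖ = ‖y - I • x‖ := by
    have e1 : J x - I • J y = J (x + I • y) := by rw [map_add, hJ, sub_eq_add_neg]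
    have e2 : y - I • x = (-I) • (x + I • y) := by
      rw [smul_add, smul_smul, neg_mul, I_mul_I, neg_neg, one_smul, neg_smul, add_comm,
        sub_eq_add_neg]
    rw [e1, J.norm_map, e2, norm_smul, norm_neg, norm_I, one_mul]
  have h4 : ‖J x + I • J y‖ = ‖y + I • x‖ := by
    have e1 : J x + I • J y = J (x - I • y) := by rw [map_sub, hJ, sub_neg_eq_add]
    have e2 : y + I • x = I • (x - I • y) := by
      rw [smul_sub, smul_smul, I_mul_I, neg_one_smul, sub_neg_eq_add, add_comm]
    rw [e1, J.norm_map, e2, norm_smul, norm_I, one_mul]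
  rw [h1, h2, h3, h4]

/-- The closed horizontal strip `{0 ≤ Im z ≤ a}` (Longo: `𝕊_a`, closure). [folklore] -/
def closedStrip (a : ℝ) : Set ℂ := {z | 0 ≤ z.im ∧ z.im ≤ a}

/-- The open horizontal strip `{0 < Im z < a}` (Longo: `𝕊_a`). [folklore] -/
def openStrip (a : ℝ) : Set ℂ := {z | 0 < z.im ∧ z.im < a}

/-- Unfolding `closedStrip`. [folklore] -/
theorem mem_closedStrip_iff {a : ℝ} {z : ℂ} : z ∈ closedStrip a ↔ 0 ≤ z.im ∧ z.im ≤ a := Iff.rfl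

/-- Unfolding `openStrip`. [folklore] -/
theorem mem_openStrip_iff {a : ℝ} {z : ℂ} : z ∈ openStrip a ↔ 0 < z.im ∧ z.im < a := Iff.rfl

section StripPhragmenLindelof

open Set Filter Topology Asymptotics

/-- The open strip is the preimage of `(0, a)` under `im`. [folklore] -/
theorem openStrip_eq_preimage (a : ℝ) : openStrip a = im ⁻¹' Ioo 0 a := rfl

/-- The closed strip is the preimage of `[0, a]` under `im`. [folklore] -/
theorem closedStrip_eq_preimage (a : ℝ) : closedStrip a = im ⁻¹' Icc 0 a := rfl

/-- The open strip is open. [folklore] -/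
theorem isOpen_openStrip (a : ℝ) : IsOpen (openStrip a) := by
  rw [openStrip_eq_preimage]; exact isOpen_Ioo.preimage continuous_im

/-- The open strip is contained in the closed one. [folklore] -/
theorem openStrip_subset_closedStrip (a : ℝ) : openStrip a ⊆ closedStrip a :=
  fun _ hz => ⟨hz.1.le, hz.2.le⟩

/-- The closure of the open strip `{0 < Im z < a}` (`a > 0`) is the closed strip. [folklore] -/
theorem closure_openStrip {a : ℝ} (ha : 0 < a) : closure (openStrip a) = closedStrip a := by
  rw [openStrip_eq_preimage, closedStrip_eq_preimage, closure_preimage_im, closure_Ioo ha.ne]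

/-- The open strip is connected (it is convex and non-empty). [folklore] -/
theorem isConnected_openStrip {a : ℝ} (ha : 0 < a) : IsConnected (openStrip a) := by
  refine ⟨⟨((a / 2 : ℝ) : ℂ) * I, ?_⟩, ?_⟩
  · rw [mem_openStrip_iff]
    simp only [mul_im, ofReal_re, I_im, mul_one, ofReal_im, I_re, mul_zero, add_zero]
    constructor <;> linarith
  · have h : openStrip a = {z : ℂ | 0 < z.im} ∩ {z : ℂ | z.im < a} := by
      ext z; simp [mem_openStrip_iff]
    rw [h]
    exact ((convex_halfSpace_im_gt 0).inter (convex_halfSpace_im_lt a)).isPreconnected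

/-- **Phragmén–Lindelöf on the strip `0 ≤ Im z ≤ a`** (Mathlib's
`PhragmenLindelof.horizontal_strip`, specialised to functions bounded on the closed strip): a
function continuous on the closed strip, holomorphic inside, bounded, and bounded by `C` on both
edges is bounded by `C` on the closed strip. [folklore] -/
theorem norm_le_of_forall_mem_edges_strip {E : Type*} [NormedAddCommGroup E] [NormedSpace ℂ E]
    {a : ℝ} (ha : 0 < a) {f : ℂ → E} {C M : ℝ}
    (hd : DifferentiableOn ℂ f (openStrip a)) (hc : ContinuousOn f (closedStrip a))
    (hM : ∀ z ∈ closedStrip a, ‖f z‖ ≤ M)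
    (h₀ : ∀ z : ℂ, z.im = 0 → ‖f z‖ ≤ C) (h₁ : ∀ z : ℂ, z.im = a → ‖f z‖ ≤ C)
    {z : ℂ} (hz : z ∈ closedStrip a) : ‖f z‖ ≤ C := by
  have hdc : DiffContOnCl ℂ f (im ⁻¹' Ioo 0 a) := by
    refine ⟨by rwa [← openStrip_eq_preimage], ?_⟩
    rw [closure_preimage_im, closure_Ioo ha.ne, ← closedStrip_eq_preimage]
    exact hc
  have hB : ∃ c < Real.pi / (a - 0), ∃ B,
      f =O[comap (_root_.abs ∘ re) atTop ⊓ 𝓟 (im ⁻¹' Ioo 0 a)]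
        fun z ↦ Real.exp (B * Real.exp (c * |z.re|)) := by
    refine ⟨0, by rw [sub_zero]; exact div_pos Real.pi_pos ha, 0, ?_⟩
    refine IsBigO.of_bound M (eventually_inf_principal.2 (Eventually.of_forall ?_))
    intro w hw
    have hw' : w ∈ closedStrip a := by
      rw [closedStrip_eq_preimage]; exact Ioo_subset_Icc_self hw
    simpa using hM w hw'
  exact PhragmenLindelof.horizontal_strip hdc hB h₀ h₁ hz.1 hz.2

/-- **Uniqueness of bounded analytic continuation to a strip.** A function continuous and bounded
on the closed strip `0 ≤ Im z ≤ a`, holomorphic inside and vanishing on the real line vanishes on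
the whole closed strip (Phragmén–Lindelöf applied to `e^{iλz} f(z)`, `λ → ∞`; Rieffel–van Daele
1977, remark after Def. 3.4, via Schwarz reflection). [cite: RieffelVandaele1977, §3 remark after Def. 3.4] -/
theorem eq_zero_of_eq_zero_on_real {E : Type*} [NormedAddCommGroup E] [NormedSpace ℂ E]
    {a : ℝ} (ha : 0 < a) {f : ℂ → E} {M : ℝ}
    (hd : DifferentiableOn ℂ f (openStrip a)) (hc : ContinuousOn f (closedStrip a))
    (hM : ∀ z ∈ closedStrip a, ‖f z‖ ≤ M) (h₀ : ∀ t : ℝ, f t = 0) :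
    ∀ z ∈ closedStrip a, f z = 0 := by
  -- Step A: below the top edge.
  have hA : ∀ z ∈ closedStrip a, z.im < a → f z = 0 := by
    intro z hz hza
    have hM₀ : 0 ≤ M := (norm_nonneg _).trans (hM z hz)
    have hd' : 0 < a - z.im := sub_pos.2 hza
    have hnorm : ∀ (n : ℕ) (w : ℂ), ‖exp (I * n * w)‖ = Real.exp (-(n * w.im)) := by
      intro n w
      rw [norm_exp]
      congr 1
      simp [mul_re, mul_im]
    have key : ∀ n : ℕ, ‖f z‖ ≤ M * Real.exp (-((n : ℝ) * (a - z.im))) := by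
      intro n
      set F : ℂ → E := fun w => exp (I * n * w) • f w with hF
      have hFd : DifferentiableOn ℂ F (openStrip a) :=
        (differentiableOn_id.const_mul (I * n)).cexp.smul hd
      have hFc : ContinuousOn F (closedStrip a) :=
        (continuous_const.mul continuous_id).continuousOn.cexp.smul hc
      have hFM : ∀ w ∈ closedStrip a, ‖F w‖ ≤ M := by
        intro w hw
        rw [hF, norm_smul, hnorm]
        calc Real.exp (-(n * w.im)) * ‖f w‖ ≤ 1 * ‖f w‖ := by
              gcongr
              rw [Real.exp_le_one_iff, neg_nonpos]
              exact mul_nonneg n.cast_nonneg hw.1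
          _ ≤ M := by rw [one_mul]; exact hM w hw
      have hF₀ : ∀ w : ℂ, w.im = 0 → ‖F w‖ ≤ Real.exp (-(n * a)) * M := by
        intro w hw
        obtain ⟨t, rfl⟩ : ∃ t : ℝ, (t : ℂ) = w := ⟨w.re, Complex.ext (by simp) (by simp [hw])⟩
        rw [hF]
        dsimp only
        rw [h₀ t, smul_zero, norm_zero]
        positivity
      have hF₁ : ∀ w : ℂ, w.im = a → ‖F w‖ ≤ Real.exp (-(n * a)) * M := by
        intro w hw
        rw [hF, norm_smul, hnorm, hw]
        gcongr
        exact hM w (by rw [mem_closedStrip_iff, hw]; exact ⟨ha.le, le_rfl⟩)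
      have hPL := norm_le_of_forall_mem_edges_strip ha hFd hFc hFM hF₀ hF₁ hz
      rw [hF, norm_smul, hnorm] at hPL
      have hpos : 0 < Real.exp (-(n * z.im)) := Real.exp_pos _
      calc ‖f z‖ = (Real.exp (-(n * z.im)))⁻¹ * (Real.exp (-(n * z.im)) * ‖f z‖) := by
            field_simp
        _ ≤ (Real.exp (-(n * z.im)))⁻¹ * (Real.exp (-(n * a)) * M) := by gcongr
        _ = M * Real.exp (-((n : ℝ) * (a - z.im))) := by
            rw [← Real.exp_neg, ← mul_assoc, ← Real.exp_add, mul_comm]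
            congr 1
            ring_nf
    have ht : Tendsto (fun n : ℕ => M * Real.exp (-((n : ℝ) * (a - z.im)))) atTop (𝓝 (M * 0)) :=
      (Real.tendsto_exp_neg_atTop_nhds_zero.comp
        (tendsto_natCast_atTop_atTop.atTop_mul_const hd')).const_mul M
    rw [mul_zero] at ht
    exact norm_le_zero_iff.1 (ge_of_tendsto' ht key)
  -- Step B: the top edge, by continuity.
  have hEq : EqOn f 0 (closedStrip a) :=
    (show EqOn f 0 (openStrip a) from fun w hw => hA w (openStrip_subset_closedStrip a hw) hw.2)
      |>.of_subset_closure hc continuousOn_const (openStrip_subset_closedStrip a)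
      (by rw [closure_openStrip ha])
  exact fun z hz => hEq hz

/-- **A bounded holomorphic function on a strip which is real on both edges is constant**
(Rieffel–van Daele 1977, end of the proof of Thm. 3.8: "such a function must be constant, because
repeated applications of the Schwarz reflection principle will yield an extension to a bounded
entire function"). Here: Phragmén–Lindelöf applied to `e^{± i g}` shows `Im g = 0`, and a
holomorphic function with constant imaginary part is constant (open mapping theorem).
[cite: RieffelVandaele1977, Thm. 3.8 (proof)] -/
theorem eq_apply_zero_of_im_eq_zero_on_edges {a : ℝ} (ha : 0 < a) {g : ℂ → ℂ} {M : ℝ}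
    (hd : DifferentiableOn ℂ g (openStrip a)) (hc : ContinuousOn g (closedStrip a))
    (hM : ∀ z ∈ closedStrip a, ‖g z‖ ≤ M)
    (h₀ : ∀ z : ℂ, z.im = 0 → (g z).im = 0) (h₁ : ∀ z : ℂ, z.im = a → (g z).im = 0) :
    ∀ z ∈ closedStrip a, g z = g 0 := by
  -- Step 1: `Im g = 0` on the closed strip.
  have him : ∀ z ∈ closedStrip a, (g z).im = 0 := by
    intro z hz
    have hbound : ∀ w ∈ closedStrip a, |(g w).im| ≤ M := fun w hw =>
      (abs_im_le_norm _).trans (hM w hw)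
    -- `exp (I * g)` has norm `exp (-Im g)`
    have hn₁ : ∀ w : ℂ, ‖exp (I * g w)‖ = Real.exp (-(g w).im) := by
      intro w; rw [norm_exp, I_mul_re]
    have hn₂ : ∀ w : ℂ, ‖exp (-(I * g w))‖ = Real.exp ((g w).im) := by
      intro w; rw [norm_exp, neg_re, I_mul_re, neg_neg]
    have hle₁ : ‖exp (I * g z)‖ ≤ 1 := by
      refine norm_le_of_forall_mem_edges_strip ha (f := fun w => exp (I * g w)) (M := Real.exp M)
        (hd.const_mul I).cexp (continuousOn_const.mul hc).cexp ?_ ?_ ?_ hz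
      · intro w hw
        rw [hn₁, Real.exp_le_exp]
        exact (neg_le_abs _).trans (hbound w hw)
      · intro w hw; rw [hn₁, h₀ w hw, neg_zero, Real.exp_zero]
      · intro w hw; rw [hn₁, h₁ w hw, neg_zero, Real.exp_zero]
    have hle₂ : ‖exp (-(I * g z))‖ ≤ 1 := by
      refine norm_le_of_forall_mem_edges_strip ha (f := fun w => exp (-(I * g w)))
        (M := Real.exp M) (hd.const_mul I).neg.cexp (continuousOn_const.mul hc).neg.cexp ?_ ?_ ?_ hz
      · intro w hw
        rw [hn₂, Real.exp_le_exp]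
        exact (le_abs_self _).trans (hbound w hw)
      · intro w hw; rw [hn₂, h₀ w hw, Real.exp_zero]
      · intro w hw; rw [hn₂, h₁ w hw, Real.exp_zero]
    rw [hn₁, Real.exp_le_one_iff, neg_nonpos] at hle₁
    rw [hn₂, Real.exp_le_one_iff] at hle₂
    exact le_antisymm hle₂ hle₁
  -- Step 2: constant on the open strip (open mapping theorem).
  have han : AnalyticOnNhd ℂ g (openStrip a) :=
    (analyticOnNhd_iff_differentiableOn (isOpen_openStrip a)).2 hd
  obtain ⟨c, hgc⟩ := han.eq_const_of_im_eq_const (c₀ := 0)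
    (fun x hx => him x (openStrip_subset_closedStrip a hx)) (isOpen_openStrip a)
    (isConnected_openStrip ha)
  -- Step 3: constant on the closed strip, by continuity.
  have hEq : EqOn g (fun _ => c) (closedStrip a) :=
    (show EqOn g (fun _ => c) (openStrip a) from hgc).of_subset_closure hc continuousOn_const
      (openStrip_subset_closedStrip a) (by rw [closure_openStrip ha])
  intro z hz
  rw [hEq hz, hEq (show (0 : ℂ) ∈ closedStrip a from ⟨le_rfl, by simpa using ha.le⟩)]

end StripPhragmenLindelof

/-- `Im ((1/2) i) = 1/2`: the point `i/2` lies on the top edge of `closedStrip 2⁻¹`. [folklore] -/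
theorem half_I_im : ((2⁻¹ : ℂ) * I).im = 2⁻¹ := by
  rw [show (2⁻¹ : ℂ) = ((2⁻¹ : ℝ) : ℂ) by push_cast; ring]
  simp [mul_im]

/-- `i/2 ∈ closedStrip (1/2)`. [folklore] -/
theorem half_I_mem_closedStrip : (2⁻¹ : ℂ) * I ∈ closedStrip 2⁻¹ := by
  rw [mem_closedStrip_iff, half_I_im]; norm_num

/-! ### Modular data of a standard subspace (axiomatised polar decomposition) -/

open Literature.Analysis.UnboundedOperators

variable [CompleteSpace H]

/-- **Modular data `(Δ_V^{it}, J_V)` of a standard subspace `V`**, axiomatised through the printed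
theorems that characterise the polar decomposition `S_V = J_V Δ_V^{1/2}` uniquely (module
docstring): `U` = the modular unitary group `t ↦ Δ_V^{it}` (so `U.hamiltonian = log Δ_V`), `J` =
the modular conjugation, an antiunitary; `J² = 1`, `J Δ^{it} = Δ^{it} J` (Longo Prop. 2.1.3 (a),(b));
`Δ^{it} V = V`, `J V = V'` (Thm. 2.1.4); `(Jξ, ξ) ≥ 0` on `V` (Prop. 2.1.9); the polar
decomposition in analytic-continuation form; the KMS condition at inverse temperature `1` for
`t ↦ Δ^{-it}` (Prop. 2.1.7). Existence: `exists_modularData`; uniqueness: `subsingleton_modularData`.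
[cite: Longo2008LecturesConformalNets, Prop. 2.1.3, Thm. 2.1.4, Prop. 2.1.7, Prop. 2.1.9] -/
structure ModularData (V : StandardSubspace H) where
  /-- The modular unitary group `t ↦ Δ_V^{it}` (`U.appReal t = Δ_V^{it}`). -/
  U : OneParameterUnitaryGroup H
  /-- The modular conjugation `J_V`, an antiunitary operator (Prop. 2.1.3 (a)). -/
  J : H ≃ₗᵢ⋆[ℂ] H
  /-- `J_V² = 1` (Prop. 2.1.3 (a): `J = J* = J⁻¹`). -/
  J_J : ∀ x : H, J (J x) = x
  /-- `J_V` commutes with `Δ_V^{it}` (Prop. 2.1.3 (b)). -/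
  J_U : ∀ (t : ℝ) (x : H), J (U.appReal t x) = U.appReal t (J x)
  /-- `Δ_V^{it} V ⊆ V` for all `t`, hence `= V` (Thm. 2.1.4). -/
  U_mem : ∀ (t : ℝ), ∀ x ∈ V.toClosedSubmodule, U.appReal t x ∈ V.toClosedSubmodule
  /-- `J_V V ⊆ V'` (Thm. 2.1.4). -/
  J_mem : ∀ x ∈ V.toClosedSubmodule, J x ∈ V.symplComp.toClosedSubmodule
  /-- `J_V V' ⊆ V` (Thm. 2.1.4 with `J² = 1`: together `J_V V = V'`). -/
  J_mem_of_mem_symplComp : ∀ x ∈ V.symplComp.toClosedSubmodule, J x ∈ V.toClosedSubmodule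
  /-- Positivity `(J ξ, ξ) = ⟪ξ, J ξ⟫ ≥ 0` for `ξ ∈ V` (Prop. 2.1.9; it is real by `J V = V'`). -/
  re_inner_J_nonneg : ∀ x ∈ V.toClosedSubmodule, 0 ≤ (⟪x, J x⟫_ℂ).re
  /-- **Polar decomposition `S_V = J_V Δ_V^{1/2}`** (Prop. 2.1.3), in bounded form: for `x ∈ D(S_V)`
  (`= D(Δ^{1/2})`) the orbit `t ↦ Δ^{-it} x` has a bounded continuous extension `G` to the closed
  strip `0 ≤ Im z ≤ 1/2`, holomorphic inside (`G(z) = Δ^{-iz} x`), with `G(i/2) = Δ^{1/2} x = J S x`. -/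
  polar : ∀ x : tomitaDomain V, ∃ G : ℂ → H, ContinuousOn G (closedStrip 2⁻¹) ∧
    DifferentiableOn ℂ G (openStrip 2⁻¹) ∧ (∃ C : ℝ, ∀ z ∈ closedStrip 2⁻¹, ‖G z‖ ≤ C) ∧
    (∀ t : ℝ, G t = U.appReal (-t) x) ∧ G ((2⁻¹ : ℂ) * I) = J (tomitaOperator V x)
  /-- The **one-particle KMS condition at inverse temperature `1`** for `t ↦ Δ^{-it}` on `V`
  (Prop. 2.1.7, p. 26): for `ξ, η ∈ V` a function `F`, bounded and continuous on `0 ≤ Im z ≤ 1`,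
  holomorphic inside, with `F(t) = (Δ^{-it}ξ, η) = ⟪η, Δ^{-it} ξ⟫` and
  `F(t + i) = (η, Δ^{-it}ξ) = ⟪Δ^{-it} ξ, η⟫`. -/
  kms : ∀ ξ ∈ V.toClosedSubmodule, ∀ η ∈ V.toClosedSubmodule, ∃ F : ℂ → ℂ,
    ContinuousOn F (closedStrip 1) ∧ DifferentiableOn ℂ F (openStrip 1) ∧
    (∃ C : ℝ, ∀ z ∈ closedStrip 1, ‖F z‖ ≤ C) ∧
    (∀ t : ℝ, F t = ⟪η, U.appReal (-t) ξ⟫_ℂ) ∧ (∀ t : ℝ, F (t + I) = ⟪U.appReal (-t) ξ, η⟫_ℂ)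

namespace ModularData

variable {V : StandardSubspace H} (D : ModularData V)

/-- `J_V` is antiunitary: `⟪J x, J y⟫ = ⟪y, x⟫` (Prop. 2.1.3 (a)). [cite: Longo2008LecturesConformalNets, Prop. 2.1.3 (a)] -/
theorem inner_J_J (x y : H) : ⟪D.J x, D.J y⟫_ℂ = ⟪y, x⟫_ℂ := inner_antiunitary D.J x y

/-- **`Δ_V^{it} V = V`**: membership form (Thm. 2.1.4). [cite: Longo2008LecturesConformalNets, Thm. 2.1.4] -/
theorem U_mem_iff (t : ℝ) {x : H} :
    D.U.appReal t x ∈ V.toClosedSubmodule ↔ x ∈ V.toClosedSubmodule := by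
  refine ⟨fun h => ?_, D.U_mem t x⟩
  have := D.U_mem (-t) _ h
  rwa [show D.U.appReal (-t) (D.U.appReal t x) = x from
    OneParameterGroup.app_neg_apply_app D.U.toStrongContRepresentation t x] at this

/-- **`J_V V = V'`**, first membership form: `J x ∈ V' ↔ x ∈ V` (Thm. 2.1.4). [cite: Longo2008LecturesConformalNets, Thm. 2.1.4] -/
theorem J_mem_symplComp_iff {x : H} :
    D.J x ∈ V.symplComp.toClosedSubmodule ↔ x ∈ V.toClosedSubmodule := by
  refine ⟨fun h => ?_, D.J_mem x⟩
  simpa [D.J_J] using D.J_mem_of_mem_symplComp _ h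

/-- **`J_V V' = V`**, second membership form: `J x ∈ V ↔ x ∈ V'` (Thm. 2.1.4 and Prop. 2.1.3 (c)
`J_{H'} = J_H`). [cite: Longo2008LecturesConformalNets, Thm. 2.1.4] -/
theorem J_mem_iff {x : H} :
    D.J x ∈ V.toClosedSubmodule ↔ x ∈ V.symplComp.toClosedSubmodule := by
  refine ⟨fun h => ?_, D.J_mem_of_mem_symplComp x⟩
  simpa [D.J_J] using D.J_mem _ h

/-- `(J ξ, ξ)` is real for `ξ ∈ V` (proof of Thm. 2.1.4: "`(Jξ, ξ) = (Δ^{1/2}ξ, ξ) ∈ ℝ`").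
[cite: Longo2008LecturesConformalNets, Thm. 2.1.4 (proof)] -/
theorem im_inner_J_eq_zero {x : H} (hx : x ∈ V.toClosedSubmodule) : (⟪x, D.J x⟫_ℂ).im = 0 :=
  (mem_symplComp_iff' V).1 (D.J_mem x hx) x hx

/-- `⟪y, U(t) x⟫ = ⟪U(-t) y, x⟫` for a one-parameter unitary group (`U(t)* = U(-t)`,
`UnitaryRep.adjoint_apply`). [folklore] -/
theorem inner_appReal_right_eq (U : OneParameterUnitaryGroup H) (t : ℝ) (x y : H) :
    ⟪y, U.appReal t x⟫_ℂ = ⟪U.appReal (-t) y, x⟫_ℂ := by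
  rw [← ContinuousLinearMap.adjoint_inner_left, UnitaryRep.appReal, UnitaryRep.adjoint_apply]
  rfl

/-- **`Δ_V^{it} V' ⊆ V'`** (Prop. 2.1.3 (c) `Δ_{H'} = Δ_H⁻¹` with Thm. 2.1.4 for `H'`; here directly
from unitarity and `Δ^{it} V = V`). [cite: Longo2008LecturesConformalNets, Prop. 2.1.3 (c) and Thm. 2.1.4] -/
theorem U_mem_symplComp (t : ℝ) {x : H} (hx : x ∈ V.symplComp.toClosedSubmodule) :
    D.U.appReal t x ∈ V.symplComp.toClosedSubmodule := by
  rw [mem_symplComp_iff'] at hx ⊢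
  intro y hy
  rw [inner_appReal_right_eq]
  exact hx _ (D.U_mem (-t) y hy)

/-- `Δ^{it}` preserves `D(S_V) = V + iV`. [cite: Longo2008LecturesConformalNets, Thm. 2.1.4 (proof)] -/
theorem U_apply_mem_tomitaDomain (t : ℝ) {x : H} (hx : x ∈ tomitaDomain V) :
    D.U.appReal t x ∈ tomitaDomain V := by
  obtain ⟨v, hv, w, hw, rfl⟩ := hx
  refine ⟨_, D.U_mem t v hv, _, D.U_mem t w hw, ?_⟩
  rw [map_add, map_smul]

/-- `Δ^{it}` commutes with `S_V` (proof of Thm. 2.1.4: "`Δ^{it}` commutes with `Δ^{1/2}` and `J`,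
thus with `S`"). [cite: Longo2008LecturesConformalNets, Thm. 2.1.4 (proof)] -/
theorem tomitaOperator_U_apply (t : ℝ) (x : tomitaDomain V) :
    tomitaOperator V ⟨D.U.appReal t x, D.U_apply_mem_tomitaDomain t x.2⟩ =
      D.U.appReal t (tomitaOperator V x) := by
  obtain ⟨v, hv, w, hw, hx⟩ := x.2
  rw [tomitaOperator_apply_eq x hv hw hx,
    tomitaOperator_apply_eq _ (D.U_mem t v hv) (D.U_mem t w hw)]
  · rw [map_sub, map_smul]
  · simp only [← hx, map_add, map_smul]

end ModularData

/-! ### Named facts -/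

/-- **Existence of the modular data** (Longo Prop. 2.1.3, Thm. 2.1.4, Prop. 2.1.7, Prop. 2.1.9;
Rieffel–van Daele 1977 for the bounded approach): every standard subspace of a complex Hilbert
space carries modular data in the sense of `ModularData`. Named fact: Mathlib has no polar
decomposition / Borel functional calculus for unbounded closed (conjugate-)linear operators.
[cite: Longo2008LecturesConformalNets, Prop. 2.1.3, Thm. 2.1.4, Prop. 2.1.7, Prop. 2.1.9] -/
def exists_modularData : Prop :=
  ∀ (H : Type) [NormedAddCommGroup H] [InnerProductSpace ℂ H] [CompleteSpace H]
    (V : StandardSubspace H), Nonempty (ModularData V)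

/-- **Uniqueness of the modular data** (Longo Prop. 2.1.7, converse half: a one-parameter unitary
group with `U(t)V = V` satisfying the KMS condition at inverse temperature `1` equals `Δ_V^{-it}`;
Prop. 2.1.9: `J_V` is the unique antiunitary involution with `JV ⊇ V'` and `(Jξ, ξ) ≥ 0` on `V`):
any two `ModularData V` coincide. [cite: Longo2008LecturesConformalNets, Prop. 2.1.7 and Prop. 2.1.9] -/
def subsingleton_modularData : Prop :=
  ∀ (H : Type) [NormedAddCommGroup H] [InnerProductSpace ℂ H] [CompleteSpace H]
    (V : StandardSubspace H), Subsingleton (ModularData V)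

/-- **Borchers' theorem, one-particle (standard subspace) version** (Longo Thm. 2.2.1, proof adapted
from Florig's; Longo–Witten Thm. 2.2; the standard-subspace analogue of Borchers 1992 /
Wiesbrock). Let `V` be a standard subspace with modular data `(Δ^{it}, J)` and `U(s) = e^{isP}` a
strongly continuous one-parameter unitary group with `U(s) V ⊆ V` for `s ≥ 0`. If `P ≥ 0` then
`Δ^{it} U(s) Δ^{-it} = U(e^{-2πt} s)`; if `−P ≥ 0` then `Δ^{it} U(s) Δ^{-it} = U(e^{2πt} s)`; in either
case `J U(s) J = U(−s)` (`t, s ∈ ℝ`). Positivity of the generator is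
`UnitaryRep.HasPositiveEnergy` (`0 ≤ ⟪x, P x⟫` on `D(P)`).
[cite: Longo2008LecturesConformalNets, Thm. 2.2.1] [cite: LongoWitten2010, Thm. 2.2] -/
def Borchers_oneParticle : Prop :=
  ∀ (H : Type) [NormedAddCommGroup H] [InnerProductSpace ℂ H] [CompleteSpace H]
    (V : StandardSubspace H) (D : ModularData V) (T : OneParameterUnitaryGroup H),
    (∀ s : ℝ, 0 ≤ s → ∀ x ∈ V.toClosedSubmodule, T.appReal s x ∈ V.toClosedSubmodule) →
    (T.HasPositiveEnergy → ∀ t s : ℝ,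
        D.U.appReal t * T.appReal s * D.U.appReal (-t) =
          T.appReal (Real.exp (-(2 * Real.pi * t)) * s)) ∧
    ((-T.hamiltonian).IsPositive → ∀ t s : ℝ,
        D.U.appReal t * T.appReal s * D.U.appReal (-t) =
          T.appReal (Real.exp (2 * Real.pi * t) * s)) ∧
    (T.HasPositiveEnergy ∨ (-T.hamiltonian).IsPositive →
        ∀ (s : ℝ) (x : H), D.J (T.appReal s x) = T.appReal (-s) (D.J x))

/-- **Half-sided modular inclusion** of standard subspaces `K ⊆ V` (Longo §2.4, p. 38: "If
`Δ_H^{-it} K ⊂ K` for `±t ≥ 0` the inclusion `K ⊂ H` is called a `±`half-sided modular inclusion …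
if the sign is not specified we assume `+`"): here the `+` case, relative to modular data `D` of the
larger space `V`. [cite: Longo2008LecturesConformalNets, §2.4 p. 38 (definition)] -/
def IsHalfSidedModularInclusion (K V : StandardSubspace H) (D : ModularData V) : Prop :=
  K.toClosedSubmodule ≤ V.toClosedSubmodule ∧
    ∀ t : ℝ, 0 ≤ t → ∀ x ∈ K.toClosedSubmodule, D.U.appReal (-t) x ∈ K.toClosedSubmodule

/-- **Wiesbrock's theorem, one-particle (standard subspace) version** (Longo Thm. 2.4.1; the
standard-subspace version of Wiesbrock 1993, complete proofs by Araki–Zsidó 2005 and Borchers).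
Let `K ⊆ V` be a half-sided modular inclusion of standard subspaces. Then there is a strongly
continuous one-parameter unitary group `U(s) = e^{isP}` with POSITIVE generator, determined by
`U(e^{2πt} − 1) = Δ_V^{-it} Δ_K^{it}`, such that `Δ_V^{-it} U(s) Δ_V^{it} = U(e^{2πt} s)` (eq. (2.4.6):
with the dilations `Δ_V^{-is/2π}` it is a positive-energy representation of the translation–dilation
group), `U(s) V ⊆ V` for `s ≥ 0`, and `K = U(1) V`.
Sign convention as in Longo (`Δ_V^{-it} K ⊆ K` for `t ≥ 0`; Araki–Zsidó write `Δ_M^{it} N Δ_M^{-it} ⊆ N`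
for `t ≤ 0`). [cite: Longo2008LecturesConformalNets, Thm. 2.4.1]
[cite: Wiesbrock1993, Thm. 3, Def. 5, Cor. 6–7 (von Neumann algebra version)]
[cite: ArakiZsido2005, Thm. 2.1 (general half-sided modular inclusion theorem, complete proof)] -/
def Wiesbrock_oneParticle : Prop :=
  ∀ (H : Type) [NormedAddCommGroup H] [InnerProductSpace ℂ H] [CompleteSpace H]
    (K V : StandardSubspace H) (DK : ModularData K) (DV : ModularData V),
    IsHalfSidedModularInclusion K V DV →
    ∃ T : OneParameterUnitaryGroup H, T.HasPositiveEnergy ∧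
      (∀ t : ℝ, T.appReal (Real.exp (2 * Real.pi * t) - 1) = DV.U.appReal (-t) * DK.U.appReal t) ∧
      (∀ t s : ℝ, DV.U.appReal (-t) * T.appReal s * DV.U.appReal t =
        T.appReal (Real.exp (2 * Real.pi * t) * s)) ∧
      (∀ s : ℝ, 0 ≤ s → ∀ x ∈ V.toClosedSubmodule, T.appReal s x ∈ V.toClosedSubmodule) ∧
      (∀ x : H, x ∈ K.toClosedSubmodule ↔ ∃ y ∈ V.toClosedSubmodule, T.appReal 1 y = x)

/-! ### Uniqueness of the modular data: discharge of `subsingleton_modularData`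

Longo proves the uniqueness of `Δ^{it}` (Prop. 2.1.7, converse half) and of `J` (Prop. 2.1.9)
through the unbounded generator (`V(t) = A^{-it}`, entire vectors, "`A` commutes with `Δ`") and
the uniqueness of the polar decomposition `S = JΔ^{1/2}` -- unbounded spectral calculus that
Mathlib does not have. We follow instead the BOUNDED proof of Rieffel--van Daele 1977, Thm. 3.8
("The group `Δ^{it}` is the unique strongly continuous one-parameter group of unitaries which
carries `K` onto `K` and satisfies the K.M.S. condition with respect to `K`"): for `ξ, η ∈ V` the
function `g(z) = ⟪J₁ Δ₁^{-i z̄} ξ, Δ₂^{-iz} η⟫` is bounded and holomorphic on `0 ≤ Im z ≤ 1/2`,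
real on both edges (`V` against `V' = J₁V`, using `Δ^{-i(t + i/2)} ξ = Δ^{-it} J ξ`), hence
constant; this gives `Δ₁^{it} Δ₂^{-it} = 1` on `V`, so everywhere. Rieffel--van Daele build the
continuation `z ↦ Δ₂^{-iz} η` from KMS and Gaussian entire vectors; here the `polar` axiom of the
second datum supplies it directly. Then `J₁ S = Δ₁^{1/2} = Δ₂^{1/2} = J₂ S` on `D(S)`. The complex
analysis (uniqueness of bounded continuations to a strip; a bounded holomorphic function real on
both edges of a strip is constant) is `eq_zero_of_eq_zero_on_real`,
`eq_apply_zero_of_im_eq_zero_on_edges` above, from Mathlib's Phragmen--Lindelof principle. -/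

namespace ModularData

variable {V : StandardSubspace H} (D : ModularData V)

/-- `‖Δ^{it} x‖ = ‖x‖`. [folklore] -/
theorem norm_U_apply (t : ℝ) (x : H) : ‖D.U.appReal t x‖ = ‖x‖ := D.U.norm_map _ x

/-- `Δ^{-it} Δ^{it} x = x`. [folklore] -/
theorem U_neg_apply_U_apply (t : ℝ) (x : H) : D.U.appReal (-t) (D.U.appReal t x) = x := by
  simpa using OneParameterGroup.app_neg_apply_app D.U.toStrongContRepresentation t x

/-- `Δ^{it} Δ^{-it} x = x`. [folklore] -/
theorem U_apply_U_neg_apply (t : ℝ) (x : H) : D.U.appReal t (D.U.appReal (-t) x) = x := by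
  simpa using OneParameterGroup.app_neg_apply_app D.U.toStrongContRepresentation (-t) x

/-- **Covariance of the analytic continuation** `G(z) = Δ^{-iz} x` of the orbit `t ↦ Δ^{-it} x`:
`G(z + s) = Δ^{-is} G(z)` on the closed strip (both sides continue the same orbit
`t ↦ Δ^{-i(t+s)} x`; uniqueness `eq_zero_of_eq_zero_on_real`). In particular
`G(s + i/2) = Δ^{-is} Δ^{1/2} x` (Rieffel–van Daele 1977, proof of Thm. 3.8:
"`h(t + is) = U_t h(is)`"). [cite: RieffelVandaele1977, Thm. 3.8 (proof)] -/
theorem polar_covariance {x : H} {G : ℂ → H}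
    (hGc : ContinuousOn G (closedStrip 2⁻¹)) (hGd : DifferentiableOn ℂ G (openStrip 2⁻¹))
    (hGb : ∃ C : ℝ, ∀ z ∈ closedStrip 2⁻¹, ‖G z‖ ≤ C) (hGt : ∀ t : ℝ, G t = D.U.appReal (-t) x)
    (s : ℝ) {z : ℂ} (hz : z ∈ closedStrip 2⁻¹) : G (z + s) = D.U.appReal (-s) (G z) := by
  obtain ⟨C, hC⟩ := hGb
  set f : ℂ → H := fun w => G (w + s) - D.U.appReal (-s) (G w) with hf
  have hmaps₁ : Set.MapsTo (fun w : ℂ => w + s) (openStrip 2⁻¹) (openStrip 2⁻¹) := by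
    intro w hw
    simpa [mem_openStrip_iff, add_im, ofReal_im] using hw
  have hmaps₂ : Set.MapsTo (fun w : ℂ => w + s) (closedStrip 2⁻¹) (closedStrip 2⁻¹) := by
    intro w hw
    simpa [mem_closedStrip_iff, add_im, ofReal_im] using hw
  have hfd : DifferentiableOn ℂ f (openStrip 2⁻¹) :=
    (hGd.comp (differentiableOn_id.add_const _) hmaps₁).sub
      ((D.U.appReal (-s)).differentiable.comp_differentiableOn hGd)
  have hfc : ContinuousOn f (closedStrip 2⁻¹) :=
    (hGc.comp (continuousOn_id.add continuousOn_const) hmaps₂).sub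
      ((D.U.appReal (-s)).continuous.comp_continuousOn hGc)
  have hfb : ∀ w ∈ closedStrip 2⁻¹, ‖f w‖ ≤ C + C := by
    intro w hw
    refine (norm_sub_le _ _).trans (add_le_add (hC _ (hmaps₂ hw)) ?_)
    rw [norm_U_apply]
    exact hC w hw
  have hf0 : ∀ t : ℝ, f t = 0 := by
    intro t
    rw [hf]
    dsimp only
    rw [show (t : ℂ) + (s : ℂ) = ((t + s : ℝ) : ℂ) by push_cast; ring, hGt, hGt, sub_eq_zero,
      show -(t + s) = -s + -t by ring, UnitaryRep.appReal_add, mul_apply_eq_comp]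
  exact sub_eq_zero.1
    (eq_zero_of_eq_zero_on_real (by norm_num : (0 : ℝ) < 2⁻¹) hfd hfc hfb hf0 z hz)

/-- **Rieffel–van Daele's identity** (proof of their Thm. 3.8, adapted): for two modular data
`D₁ = (Δ₁^{it}, J₁)`, `D₂ = (Δ₂^{it}, J₂)` of the same standard subspace and `ξ, η ∈ V`,
`⟪J₁ Δ₁^{-it} ξ, Δ₂^{-it} η⟫ = ⟪J₁ ξ, η⟫` for all `t`. The function
`g(z) = ⟪J₁ Δ₁^{-i z̄} ξ, Δ₂^{-iz} η⟫` (built from the two `polar` continuations) is bounded and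
holomorphic on the strip `0 ≤ Im z ≤ 1/2`, real on the lower edge (`J₁V = V'` against `V`) and on
the upper edge (`⟪Δ₁^{-it} ξ, Δ₂^{-it} J₂ η⟫`, `V` against `V'`), hence constant.
[cite: RieffelVandaele1977, Thm. 3.8 (proof)] -/
theorem inner_J_U_apply_U_apply (D₁ D₂ : ModularData V) {ξ η : H} (hξ : ξ ∈ V.toClosedSubmodule)
    (hη : η ∈ V.toClosedSubmodule) (t : ℝ) :
    ⟪D₁.J (D₁.U.appReal (-t) ξ), D₂.U.appReal (-t) η⟫_ℂ = ⟪D₁.J ξ, η⟫_ℂ := by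
  obtain ⟨G₁, hc₁, hd₁, ⟨C₁, hb₁⟩, ht₁, hi₁⟩ := D₁.polar ⟨ξ, mem_tomitaDomain_of_mem V hξ⟩
  obtain ⟨G₂, hc₂, hd₂, ⟨C₂, hb₂⟩, ht₂, hi₂⟩ := D₂.polar ⟨η, mem_tomitaDomain_of_mem V hη⟩
  replace hi₁ : G₁ ((2⁻¹ : ℂ) * I) = D₁.J ξ := by
    convert hi₁ using 2; exact (tomitaOperator_apply_of_mem hξ).symm
  replace hi₂ : G₂ ((2⁻¹ : ℂ) * I) = D₂.J η := by
    convert hi₂ using 2; exact (tomitaOperator_apply_of_mem hη).symm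
  dsimp only at ht₁ ht₂
  -- the continuous BILINEAR form `(x, y) ↦ ⟪J₁ x, y⟫` (conjugate-linearity of `J₁` cancels that
  -- of the first slot) and the strip function `g(z) = ⟪J₁ G₁(z), G₂(z)⟫`
  set B : H →L[ℂ] H →L[ℂ] ℂ :=
    (innerSL ℂ (E := H)).comp D₁.J.toLinearIsometry.toContinuousLinearMap with hB
  have hBapply : ∀ x y : H, B x y = ⟪D₁.J x, y⟫_ℂ := fun x y => rfl
  set g : ℂ → ℂ := fun z => B (G₁ z) (G₂ z) with hg
  have hgd : DifferentiableOn ℂ g (openStrip 2⁻¹) :=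
    (B.differentiable.comp_differentiableOn hd₁).clm_apply hd₂
  have hgc : ContinuousOn g (closedStrip 2⁻¹) :=
    (B.continuous.comp_continuousOn hc₁).clm_apply hc₂
  have hgb : ∀ z ∈ closedStrip 2⁻¹, ‖g z‖ ≤ C₁ * C₂ := by
    intro z hz
    calc ‖g z‖ = ‖⟪D₁.J (G₁ z), G₂ z⟫_ℂ‖ := rfl
      _ ≤ ‖D₁.J (G₁ z)‖ * ‖G₂ z‖ := norm_inner_le_norm _ _
      _ = ‖G₁ z‖ * ‖G₂ z‖ := by rw [LinearIsometryEquiv.norm_map]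
      _ ≤ C₁ * C₂ :=
        mul_le_mul (hb₁ z hz) (hb₂ z hz) (norm_nonneg _) ((norm_nonneg _).trans (hb₁ z hz))
  -- lower edge: `⟪J₁ Δ₁^{-it} ξ, Δ₂^{-it} η⟫` is real (`V'` against `V`)
  have h₀ : ∀ z : ℂ, z.im = 0 → (g z).im = 0 := by
    intro z hz
    obtain ⟨s, rfl⟩ : ∃ s : ℝ, (s : ℂ) = z := ⟨z.re, Complex.ext (by simp) (by simp [hz])⟩
    simp only [hg, hBapply, ht₁, ht₂]
    exact im_inner_eq_zero_of_mem_symplComp_of_mem V (D₁.J_mem _ (D₁.U_mem (-s) ξ hξ))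
      (D₂.U_mem (-s) η hη)
  -- upper edge: `⟪J₁ Δ₁^{-it} J₁ ξ, Δ₂^{-it} J₂ η⟫ = ⟪Δ₁^{-it} ξ, Δ₂^{-it} J₂ η⟫` is real
  have h₁ : ∀ z : ℂ, z.im = 2⁻¹ → (g z).im = 0 := by
    intro z hz
    obtain ⟨s, rfl⟩ : ∃ s : ℝ, (2⁻¹ : ℂ) * I + s = z :=
      ⟨z.re, Complex.ext (by simp) (by rw [add_im, half_I_im, ofReal_im, add_zero, hz])⟩
    simp only [hg, hBapply]
    rw [D₁.polar_covariance hc₁ hd₁ ⟨C₁, hb₁⟩ ht₁ s half_I_mem_closedStrip,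
      D₂.polar_covariance hc₂ hd₂ ⟨C₂, hb₂⟩ ht₂ s half_I_mem_closedStrip, hi₁, hi₂, D₁.J_U,
      D₁.J_J]
    exact im_inner_eq_zero_of_mem_of_mem_symplComp V (D₁.U_mem (-s) ξ hξ)
      (D₂.U_mem_symplComp (-s) (D₂.J_mem η hη))
  have hconst := eq_apply_zero_of_im_eq_zero_on_edges (by norm_num : (0 : ℝ) < 2⁻¹) hgd hgc hgb
    h₀ h₁ t (by rw [mem_closedStrip_iff, ofReal_im]; norm_num)
  have e₀ : g 0 = ⟪D₁.J ξ, η⟫_ℂ := by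
    have e₁ := ht₁ 0
    have e₂ := ht₂ 0
    rw [ofReal_zero] at e₁ e₂
    rw [hg]
    dsimp only
    rw [hBapply, e₁, e₂, neg_zero, UnitaryRep.appReal_zero, UnitaryRep.appReal_zero,
      one_apply_eq_self, one_apply_eq_self]
  rw [← e₀, ← hconst, hg]
  dsimp only
  rw [hBapply, ht₁, ht₂]

/-- **Uniqueness of the modular unitary group** (Longo Prop. 2.1.7, converse half; Rieffel–van
Daele 1977 Thm. 3.8): two modular data of the same standard subspace have the same `Δ^{it}`.
From `inner_J_U_apply_U_apply`: `Δ₁^{it} Δ₂^{-it} η - η ⊥ J₁ V = V'` for `η ∈ V`, and `V' + iV'`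
is dense; then `V + iV` is dense. [cite: Longo2008LecturesConformalNets, Prop. 2.1.7]
[cite: RieffelVandaele1977, Thm. 3.8] -/
theorem U_apply_eq (D₁ D₂ : ModularData V) (t : ℝ) (x : H) :
    D₁.U.appReal t x = D₂.U.appReal t x := by
  -- Step 1: `Δ₁^{it} Δ₂^{-it} η = η` for `η ∈ V`.
  have hV : ∀ η ∈ V.toClosedSubmodule, D₁.U.appReal t (D₂.U.appReal (-t) η) = η := by
    intro η hη
    set w : H := D₁.U.appReal t (D₂.U.appReal (-t) η) - η with hw
    have hw' : ∀ y ∈ V.symplComp.toClosedSubmodule, ⟪y, w⟫_ℂ = 0 := by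
      intro y hy
      have hJy : D₁.J y ∈ V.toClosedSubmodule := D₁.J_mem_of_mem_symplComp y hy
      have key := inner_J_U_apply_U_apply D₁ D₂ hJy hη t
      rw [D₁.J_U, D₁.J_J, ← inner_appReal_right_eq] at key
      rw [hw, inner_sub_right, key, sub_self]
    have hw'' : ∀ d ∈ tomitaDomain V.symplComp, ⟪d, w⟫_ℂ = 0 := by
      rintro _ ⟨v, hv, u, hu, rfl⟩
      rw [inner_add_left, inner_smul_left, hw' v hv, hw' u hu, mul_zero, add_zero]
    have horth : w ∈ (tomitaDomain V.symplComp)ᗮ := (Submodule.mem_orthogonal _ _).2 hw''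
    rw [Submodule.topologicalClosure_eq_top_iff.1
      (Submodule.dense_iff_topologicalClosure_eq_top.1 (dense_tomitaDomain V.symplComp)),
      Submodule.mem_bot] at horth
    exact sub_eq_zero.1 horth
  -- Step 2: extend to `V + iV`, then to `H` by density.
  have hS : (tomitaDomain V : Set H) ⊆ {y | D₁.U.appReal t (D₂.U.appReal (-t) y) = y} := by
    rintro _ ⟨v, hv, u, hu, rfl⟩
    simp only [Set.mem_setOf_eq, map_add, map_smul, hV v hv, hV u hu]
  have hcl : IsClosed {y : H | D₁.U.appReal t (D₂.U.appReal (-t) y) = y} :=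
    isClosed_eq ((D₁.U.appReal t).continuous.comp (D₂.U.appReal (-t)).continuous) continuous_id
  have hall : ∀ y : H, D₁.U.appReal t (D₂.U.appReal (-t) y) = y := by
    intro y
    have hy : y ∈ closure (tomitaDomain V : Set H) := by
      rw [(dense_tomitaDomain V).closure_eq]; exact Set.mem_univ y
    exact closure_minimal hS hcl hy
  have := hall (D₂.U.appReal t x)
  rwa [D₂.U_neg_apply_U_apply] at this

/-- **Uniqueness of the modular conjugation** (Longo Prop. 2.1.9; here from `U_apply_eq` and the
polar decomposition axiom: `J₁ S x = Δ₁^{1/2} x = Δ₂^{1/2} x = J₂ S x`, the two continuations of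
the common orbit `t ↦ Δ^{-it} x` agreeing by `eq_zero_of_eq_zero_on_real`, and `S D(S) = D(S)` is
dense). [cite: Longo2008LecturesConformalNets, Prop. 2.1.9] -/
theorem J_apply_eq (D₁ D₂ : ModularData V) (x : H) : D₁.J x = D₂.J x := by
  have hD : ∀ y : tomitaDomain V, D₁.J (tomitaOperator V y) = D₂.J (tomitaOperator V y) := by
    intro y
    obtain ⟨G₁, hc₁, hd₁, ⟨C₁, hb₁⟩, ht₁, hi₁⟩ := D₁.polar y
    obtain ⟨G₂, hc₂, hd₂, ⟨C₂, hb₂⟩, ht₂, hi₂⟩ := D₂.polar y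
    rw [← hi₁, ← hi₂]
    have h := eq_zero_of_eq_zero_on_real (by norm_num : (0 : ℝ) < 2⁻¹) (hd₁.sub hd₂) (hc₁.sub hc₂)
      (M := C₁ + C₂) (fun z hz => (norm_sub_le _ _).trans (add_le_add (hb₁ z hz) (hb₂ z hz)))
      (fun s => by
        show G₁ s - G₂ s = 0
        rw [ht₁, ht₂, U_apply_eq D₁ D₂, sub_self])
      ((2⁻¹ : ℂ) * I) half_I_mem_closedStrip
    exact sub_eq_zero.1 h
  have hS : (tomitaDomain V : Set H) ⊆ {y | D₁.J y = D₂.J y} := by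
    intro y hy
    have h1 := hD ⟨tomitaOperator V ⟨y, hy⟩, tomitaOperator_mem_domain ⟨y, hy⟩⟩
    have h2 := tomitaOperator_tomitaOperator (V := V) ⟨y, hy⟩
    show D₁.J y = D₂.J y
    convert h1 using 2 <;> exact h2.symm
  have hcl : IsClosed {y : H | D₁.J y = D₂.J y} := isClosed_eq D₁.J.continuous D₂.J.continuous
  have hx : x ∈ closure (tomitaDomain V : Set H) := by
    rw [(dense_tomitaDomain V).closure_eq]; exact Set.mem_univ x
  exact closure_minimal hS hcl hx

end ModularData

/-- **Discharge of `subsingleton_modularData`**: the modular data of a standard subspace are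
unique (Longo Prop. 2.1.7, converse half, and Prop. 2.1.9). The printed proofs go through the
unbounded generator and the uniqueness of the polar decomposition; here we follow the bounded
argument of Rieffel–van Daele 1977, Thm. 3.8 (`ModularData.inner_J_U_apply_U_apply`,
`ModularData.U_apply_eq`), with the `polar` axiom of both data supplying the analytic
continuations that Rieffel–van Daele obtain from entire vectors, and then read off `J` from the
polar decomposition (`ModularData.J_apply_eq`).
[cite: Longo2008LecturesConformalNets, Prop. 2.1.7 and Prop. 2.1.9]
[cite: RieffelVandaele1977, Thm. 3.8] -/
theorem subsingleton_modularData_holds : subsingleton_modularData := by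
  intro H _ _ _ V
  refine ⟨fun D₁ D₂ => ?_⟩
  rcases D₁ with ⟨U₁, J₁, a₁, a₂, a₃, a₄, a₅, a₆, a₇, a₈⟩
  rcases D₂ with ⟨U₂, J₂, b₁, b₂, b₃, b₄, b₅, b₆, b₇, b₈⟩
  have hU : U₁ = U₂ := UnitaryRep.ext fun g => ContinuousLinearMap.ext fun x =>
    ModularData.U_apply_eq ⟨U₁, J₁, a₁, a₂, a₃, a₄, a₅, a₆, a₇, a₈⟩
      ⟨U₂, J₂, b₁, b₂, b₃, b₄, b₅, b₆, b₇, b₈⟩ (Multiplicative.toAdd g) x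
  have hJ : J₁ = J₂ := LinearIsometryEquiv.ext
    (ModularData.J_apply_eq ⟨U₁, J₁, a₁, a₂, a₃, a₄, a₅, a₆, a₇, a₈⟩
      ⟨U₂, J₂, b₁, b₂, b₃, b₄, b₅, b₆, b₇, b₈⟩)
  subst hU hJ
  rfl

end StandardSubspace

end Literature.MathematicalPhysics.AQFT


/-! ## Existence of the modular data (discharge of `exists_modularData`)

Bounded construction of `(Δ_V^{it}, J_V)` after Rieffel–van Daele 1977 (module docstring, bullet
DISCHARGED). Everything below is proved; the only functional calculus used is Mathlib's continuous
functional calculus of the bounded self-adjoint operators `R = P + Q` and `A = R (2 - R)`. -/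

open Filter Topology
open Literature.Analysis.UnboundedOperators

namespace Literature.MathematicalPhysics.AQFT

namespace StandardSubspace

/-! #### Scalar cut-off functions on the spectrum `[0, 2]` -/

/-- The piecewise-linear bump `min 1 (max 0 ((n+1) u - 1))`: vanishes for `u ≤ 1/(n+1)`,
equals `1` for `u ≥ 2/(n+1)`. [folklore] -/
private def bump (n : ℕ) (u : ℝ) : ℝ := min 1 (max 0 ((n + 1 : ℝ) * u - 1))

/-- The bump is continuous. [folklore] -/
@[fun_prop]
private theorem continuous_bump (n : ℕ) : Continuous (bump n) := by
  unfold bump; fun_prop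

/-- `0 ≤ bump n u`. [folklore] -/
private theorem bump_nonneg (n : ℕ) (u : ℝ) : 0 ≤ bump n u := le_min zero_le_one (le_max_left _ _)

/-- `bump n u ≤ 1`. [folklore] -/
private theorem bump_le_one (n : ℕ) (u : ℝ) : bump n u ≤ 1 := min_le_left _ _

/-- `|bump n u| ≤ 1`. [folklore] -/
private theorem abs_bump_le_one (n : ℕ) (u : ℝ) : |bump n u| ≤ 1 := by
  rw [abs_of_nonneg (bump_nonneg n u)]; exact bump_le_one n u

/-- `bump n` vanishes below the threshold `1/(n+1)`. [folklore] -/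
private theorem bump_eq_zero {n : ℕ} {u : ℝ} (h : u ≤ 1 / (n + 1 : ℝ)) : bump n u = 0 := by
  have hn : (0 : ℝ) < n + 1 := by positivity
  have h1 : (n + 1 : ℝ) * u - 1 ≤ 0 := by
    rw [le_div_iff₀ hn] at h; linarith
  unfold bump
  rw [max_eq_left h1, min_eq_right zero_le_one]

/-- `bump n = 1` above `2/(n+1)`. [folklore] -/
private theorem bump_eq_one {n : ℕ} {u : ℝ} (h : 2 / (n + 1 : ℝ) ≤ u) : bump n u = 1 := by
  have hn : (0 : ℝ) < n + 1 := by positivity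
  have h1 : 1 ≤ (n + 1 : ℝ) * u - 1 := by
    rw [div_le_iff₀ hn] at h; linarith
  unfold bump
  rw [min_eq_left]
  exact h1.trans (le_max_right _ _)

/-- Points where `bump n` is nonzero lie above `1/(n+1)`. [folklore] -/
private theorem lt_of_bump_ne_zero {n : ℕ} {u : ℝ} (h : bump n u ≠ 0) : 1 / (n + 1 : ℝ) < u :=
  lt_of_not_ge fun h' => h (bump_eq_zero h')

/-- `x (2 - x) ≤ 2 x` and `x (2 - x) ≤ 2 (2 - x)`. [folklore] -/
private theorem parab_le_two_mul (x : ℝ) : x * (2 - x) ≤ 2 * x := by nlinarith [sq_nonneg x]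

/-- `x (2 - x) ≤ 2 (2 - x)`. [folklore] -/
private theorem parab_le_two_mul' (x : ℝ) : x * (2 - x) ≤ 2 * (2 - x) :=
  by nlinarith [sq_nonneg (2 - x)]

/-- The spectral cut-off `cut n x = bump n (x (2 - x))`, supported where `x` and `2 - x` exceed
`1 / (2 (n + 1))`. [folklore] -/
private def cut (n : ℕ) (x : ℝ) : ℝ := bump n (x * (2 - x))

/-- The spectral cut-off is continuous. [folklore] -/
@[fun_prop]
private theorem continuous_cut (n : ℕ) : Continuous (cut n) :=
  (continuous_bump n).comp (by fun_prop)

/-- The cut-off is symmetric under `x ↦ 2 - x`. [folklore] -/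
private theorem cut_symm (n : ℕ) (x : ℝ) : cut n (2 - x) = cut n x := by
  unfold cut; ring_nf

/-- `|cut n x| ≤ 1`. [folklore] -/
private theorem abs_cut_le_one (n : ℕ) (x : ℝ) : |cut n x| ≤ 1 := abs_bump_le_one n _

/-- The lower threshold `1 / (2 (n + 1))` below which `cut n` vanishes. [folklore] -/
private def cthr (n : ℕ) : ℝ := 1 / (2 * (n + 1 : ℝ))

/-- The threshold is positive. [folklore] -/
private theorem cthr_pos (n : ℕ) : 0 < cthr n := by unfold cthr; positivity

/-- The threshold decreases with `n`. [folklore] -/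
private theorem cthr_anti {n N : ℕ} (h : n ≤ N) : cthr N ≤ cthr n := by
  unfold cthr
  gcongr

/-- On the support of `cut n` both `x` and `2 - x` exceed the threshold `cthr n`. [folklore] -/
private theorem lt_of_cut_ne_zero {n : ℕ} {x : ℝ} (h : cut n x ≠ 0) :
    cthr n < x ∧ cthr n < 2 - x := by
  have h1 := lt_of_bump_ne_zero h
  have hx := parab_le_two_mul x
  have hx' := parab_le_two_mul' x
  unfold cthr
  have hn : (0 : ℝ) < n + 1 := by positivity
  rw [div_lt_iff₀ hn] at h1
  constructor <;> [rw [div_lt_iff₀ (by positivity)]; rw [div_lt_iff₀ (by positivity)]] <;> nlinarith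

/-- On the support of `cut n`, `0 < x < 2`. [folklore] -/
private theorem pos_of_cut_ne_zero {n : ℕ} {x : ℝ} (h : cut n x ≠ 0) : 0 < x ∧ 0 < 2 - x :=
  ⟨(cthr_pos n).trans (lt_of_cut_ne_zero h).1, (cthr_pos n).trans (lt_of_cut_ne_zero h).2⟩

/-- The clamped logarithm `log (max x c_n) - log (max (2 - x) c_n)`, a bounded continuous
function equal to `log x - log (2 - x)` on the support of `cut n`. [folklore] -/
private def clog (n : ℕ) (x : ℝ) : ℝ := Real.log (max x (cthr n)) - Real.log (max (2 - x) (cthr n))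

/-- The clamped logarithm is continuous (its arguments stay above `cthr n > 0`). [folklore] -/
@[fun_prop]
private theorem continuous_clog (n : ℕ) : Continuous (clog n) := by
  unfold clog
  refine Continuous.sub ?_ ?_
  · exact (continuous_id.max continuous_const).log fun x =>
      (lt_max_of_lt_right (cthr_pos n)).ne'
  · exact ((continuous_const.sub continuous_id).max continuous_const).log fun x =>
      (lt_max_of_lt_right (cthr_pos n)).ne'

/-- The clamped logarithm is odd under `x ↦ 2 - x`. [folklore] -/
private theorem clog_symm (n : ℕ) (x : ℝ) : clog n (2 - x) = -clog n x := by
  unfold clog; rw [sub_sub_cancel]; ring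

/-- Above the thresholds the clamped logarithm is `log x - log (2 - x)`. [folklore] -/
private theorem clog_eq_of_lt {n : ℕ} {x : ℝ} (h1 : cthr n < x) (h2 : cthr n < 2 - x) :
    clog n x = Real.log x - Real.log (2 - x) := by
  unfold clog; rw [max_eq_left h1.le, max_eq_left h2.le]

/-- On the support of `cut n` the clamped logarithm is `log x - log (2 - x)`
(`= -log Δ` at `λ = x`). [folklore] -/
private theorem clog_eq_of_cut_ne_zero {n : ℕ} {x : ℝ} (h : cut n x ≠ 0) :
    clog n x = Real.log x - Real.log (2 - x) :=
  clog_eq_of_lt (lt_of_cut_ne_zero h).1 (lt_of_cut_ne_zero h).2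

/-- On the support of `cut n` all the clamped logarithms `clog N`, `N ≥ n`, agree. [folklore] -/
private theorem clog_eq_clog {n N : ℕ} (hN : n ≤ N) {x : ℝ} (h : cut n x ≠ 0) :
    clog N x = clog n x := by
  rw [clog_eq_of_cut_ne_zero h, clog_eq_of_lt ((cthr_anti hN).trans_lt (lt_of_cut_ne_zero h).1)
    ((cthr_anti hN).trans_lt (lt_of_cut_ne_zero h).2)]

/-- `exp (-clog n x / 2) = (2 - x) √(x (2 - x)) / (x (2 - x))` on the support of `cut n` (the
scalar identity behind `Δ^{1/2} = (2 - R) A^{1/2} A⁻¹` on the core). [folklore] -/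
private theorem exp_neg_half_clog {n : ℕ} {x : ℝ} (h : cut n x ≠ 0) :
    Real.exp (-(clog n x) / 2) = (2 - x) * Real.sqrt (x * (2 - x)) / (x * (2 - x)) := by
  obtain ⟨hx, hx'⟩ := pos_of_cut_ne_zero h
  have e2 : (2 - x) * Real.sqrt (x * (2 - x)) / (x * (2 - x)) = Real.sqrt (x * (2 - x)) / x := by
    field_simp
  rw [e2, clog_eq_of_cut_ne_zero h]
  have e1 : -(Real.log x - Real.log (2 - x)) / 2 = Real.log ((2 - x) / x) * (1 / 2) := by
    rw [Real.log_div hx'.ne' hx.ne']; ring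
  have e3 : (2 - x) / x = x * (2 - x) / x ^ 2 := by
    field_simp
  rw [e1, ← Real.rpow_def_of_pos (div_pos hx' hx), ← Real.sqrt_eq_rpow, e3,
    Real.sqrt_div' _ (sq_nonneg x), Real.sqrt_sq hx.le]

/-- The threshold `1 / (n + 1)` of `bump n`. [folklore] -/
private def thr (n : ℕ) : ℝ := 1 / (n + 1 : ℝ)

/-- The threshold `1/(n+1)` is positive. [folklore] -/
private theorem thr_pos (n : ℕ) : 0 < thr n := by unfold thr; positivity

/-- Points where `bump n` is nonzero lie above `thr n`. [folklore] -/
private theorem lt_thr_of_bump_ne_zero {n : ℕ} {u : ℝ} (h : bump n u ≠ 0) : thr n < u :=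
  lt_of_bump_ne_zero h

/-- `u ↦ bump n u / max u (thr n)`, continuous, with `u * (bump n u / max u thr) = bump n u`.
[folklore] -/
private def bumpDiv (n : ℕ) (u : ℝ) : ℝ := bump n u / max u (thr n)

/-- `bumpDiv n` is continuous (denominator `≥ thr n > 0`). [folklore] -/
@[fun_prop]
private theorem continuous_bumpDiv (n : ℕ) : Continuous (bumpDiv n) := by
  unfold bumpDiv
  exact (continuous_bump n).div (continuous_id.max continuous_const) fun u =>
    (lt_max_of_lt_right (thr_pos n)).ne'

/-- `u · bumpDiv n u = bump n u`. [folklore] -/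
private theorem mul_bumpDiv (n : ℕ) (u : ℝ) : u * bumpDiv n u = bump n u := by
  unfold bumpDiv
  by_cases h : bump n u = 0
  · rw [h, zero_div, mul_zero]
  · have hu := lt_thr_of_bump_ne_zero h
    rw [max_eq_left hu.le, mul_div_cancel₀ _ ((thr_pos n).trans hu).ne']

/-- `u ↦ bump n u / √(max u (thr n))`, continuous, with `√u * (bump n u / √(max u thr)) = bump n u`
for `u ≥ 0`. [folklore] -/
private def bumpDivSqrt (n : ℕ) (u : ℝ) : ℝ := bump n u / Real.sqrt (max u (thr n))

/-- `bumpDivSqrt n` is continuous (denominator `≥ √(thr n) > 0`). [folklore] -/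
@[fun_prop]
private theorem continuous_bumpDivSqrt (n : ℕ) : Continuous (bumpDivSqrt n) := by
  unfold bumpDivSqrt
  exact (continuous_bump n).div ((continuous_id.max continuous_const).sqrt) fun u =>
    (Real.sqrt_pos.2 (lt_max_of_lt_right (thr_pos n))).ne'

/-- `√u · bumpDivSqrt n u = bump n u`. [folklore] -/
private theorem sqrt_mul_bumpDivSqrt (n : ℕ) (u : ℝ) :
    Real.sqrt u * bumpDivSqrt n u = bump n u := by
  unfold bumpDivSqrt
  by_cases h : bump n u = 0
  · rw [h, zero_div, mul_zero]
  · have hu := lt_thr_of_bump_ne_zero h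
    rw [max_eq_left hu.le, mul_div_cancel₀ _ (Real.sqrt_pos.2 ((thr_pos n).trans hu)).ne']

/-- The scalar identity `(2 - x) √(x(2-x)) · bumpDiv n (x (2 - x)) = exp (-clog n x / 2) cut n x`
behind `J S xₙ = Δ^{1/2} xₙ` on the core. [folklore] -/
private theorem two_sub_mul_sqrt_mul_bumpDiv (n : ℕ) (x : ℝ) :
    (2 - x) * Real.sqrt (x * (2 - x)) * bumpDiv n (x * (2 - x)) =
      Real.exp (-(clog n x) / 2) * cut n x := by
  by_cases h : cut n x = 0
  · have h' : bump n (x * (2 - x)) = 0 := h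
    unfold bumpDiv
    rw [h, h', zero_div, mul_zero, mul_zero]
  · rw [exp_neg_half_clog h]
    have hthr : thr n < x * (2 - x) := lt_thr_of_bump_ne_zero h
    obtain ⟨hx, hx'⟩ := pos_of_cut_ne_zero h
    unfold bumpDiv cut
    rw [max_eq_left hthr.le]
    field_simp

/-- `exp (-2 s ℓ) ≤ 1 + exp (-ℓ)` for `0 ≤ s ≤ 1/2` (log-convexity bound behind
`‖Δ^{s} x‖² ≤ ‖x‖² + ‖Δ^{1/2} x‖²`). [folklore] -/
private theorem exp_neg_two_mul_le {s : ℝ} (hs0 : 0 ≤ s) (hs1 : s ≤ 1 / 2) (ℓ : ℝ) :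
    Real.exp (-(2 * s * ℓ)) ≤ 1 + Real.exp (-ℓ) := by
  rcases le_or_gt 0 ℓ with hℓ | hℓ
  · have : Real.exp (-(2 * s * ℓ)) ≤ 1 := by
      rw [Real.exp_le_one_iff]; nlinarith
    linarith [Real.exp_pos (-ℓ)]
  · have : Real.exp (-(2 * s * ℓ)) ≤ Real.exp (-ℓ) := by
      rw [Real.exp_le_exp]; nlinarith
    linarith

/-- The auxiliary nonnegative weight `1 + e^{-ℓ} - e^{-2sℓ}`. [folklore] -/
private theorem weight_nonneg {s : ℝ} (hs0 : 0 ≤ s) (hs1 : s ≤ 1 / 2) (ℓ : ℝ) :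
    0 ≤ 1 + Real.exp (-ℓ) - Real.exp (-(2 * s * ℓ)) := by
  linarith [exp_neg_two_mul_le hs0 hs1 ℓ]

/-! #### The complexified functions fed to the functional calculus of `R` -/

/-- `μ ↦ cut n (re μ)`. [folklore] -/
private def cutC (n : ℕ) (μ : ℂ) : ℂ := (cut n μ.re : ℂ)

/-- The core multiplier `μ ↦ exp (w · clog n (re μ)) · cut n (re μ)` (`w = -it`: the unitary
group `Δ^{it}` on the core; `w = iz`: its analytic continuation; `w = -1/2`: `Δ^{1/2}`).
[folklore] -/
private def coreFn (n : ℕ) (w : ℂ) (μ : ℂ) : ℂ :=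
  Complex.exp (w * (clog n μ.re : ℂ)) * (cut n μ.re : ℂ)

/-- `cutC n` is continuous. [folklore] -/
@[fun_prop]
private theorem continuous_cutC (n : ℕ) : Continuous (cutC n) := by
  unfold cutC; exact continuous_ofReal.comp ((continuous_cut n).comp continuous_re)

/-- The core multiplier is continuous on `ℂ`. [folklore] -/
@[fun_prop]
private theorem continuous_coreFn (n : ℕ) (w : ℂ) : Continuous (coreFn n w) := by
  unfold coreFn
  refine Continuous.mul (Complex.continuous_exp.comp (continuous_const.mul
    (continuous_ofReal.comp ((continuous_clog n).comp continuous_re)))) ?_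
  exact continuous_ofReal.comp ((continuous_cut n).comp continuous_re)

/-- `coreFn n 0 = cutC n`. [folklore] -/
private theorem coreFn_zero (n : ℕ) : coreFn n 0 = cutC n := by
  ext μ; simp [coreFn, cutC]

/-- On the support of `cut n` one may replace `clog n` by `clog N`, `N ≥ n`. [folklore] -/
private theorem coreFn_eq_of_le {n N : ℕ} (hN : n ≤ N) (w μ : ℂ) :
    coreFn n w μ = Complex.exp (w * (clog N μ.re : ℂ)) * (cut n μ.re : ℂ) := by
  unfold coreFn
  by_cases h : cut n μ.re = 0
  · rw [h, Complex.ofReal_zero, mul_zero, mul_zero]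
  · rw [clog_eq_clog hN h]

/-- Product rule `e^{wℓ} cut · e^{w'ℓ} cut = e^{(w+w')ℓ} cut²`. [folklore] -/
private theorem coreFn_mul_coreFn (n : ℕ) (w w' : ℂ) (μ : ℂ) :
    coreFn n w μ * coreFn n w' μ =
      Complex.exp ((w + w') * (clog n μ.re : ℂ)) * (cut n μ.re : ℂ) ^ 2 := by
  unfold coreFn
  rw [add_mul, Complex.exp_add]; ring

/-- `|exp (i t ℓ)| = 1`: the core multipliers of the unitary group are unimodular. [folklore] -/
private theorem norm_coreFn_I_mul (n : ℕ) (t : ℝ) (μ : ℂ) : ‖coreFn n (I * t) μ‖ = ‖cutC n μ‖ := by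
  unfold coreFn cutC
  rw [norm_mul, show I * (t : ℂ) * (clog n μ.re : ℂ) = ((t * clog n μ.re : ℝ) : ℂ) * I by
    push_cast; ring, Complex.norm_exp_ofReal_mul_I, one_mul]

/-- `|exp (i z ℓ)|² = exp (-2 (Im z) ℓ)`. [folklore] -/
private theorem norm_sq_exp_I_mul (z : ℂ) (ℓ : ℝ) :
    ‖Complex.exp (I * z * (ℓ : ℂ))‖ ^ 2 = Real.exp (-(2 * z.im * ℓ)) := by
  rw [Complex.norm_exp, ← Real.exp_nat_mul]
  congr 1
  simp only [mul_re, I_re, I_im, ofReal_re, ofReal_im, zero_mul, one_mul, zero_sub, mul_zero,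
    sub_zero, Nat.cast_ofNat]
  ring

/-- The pointwise identity behind the strip bound
`‖Δ^{-iz} xₙ‖² ≤ ‖xₙ‖² + ‖Δ^{1/2} xₙ‖²` for `0 ≤ Im z ≤ 1/2`. [folklore] -/
private theorem norm_sq_exp_add {z : ℂ} (hz0 : 0 ≤ z.im) (hz1 : z.im ≤ 1 / 2) (ℓ q : ℝ) :
    ‖Complex.exp (I * z * (ℓ : ℂ)) * (q : ℂ)‖ ^ 2 +
      ‖((q * Real.sqrt (1 + Real.exp (-ℓ) - Real.exp (-(2 * z.im * ℓ))) : ℝ) : ℂ)‖ ^ 2 =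
    ‖(q : ℂ)‖ ^ 2 + ‖Complex.exp ((-(1 / 2 : ℂ)) * (ℓ : ℂ)) * (q : ℂ)‖ ^ 2 := by
  have hw := weight_nonneg hz0 hz1 ℓ
  have h1 : ‖Complex.exp (I * z * (ℓ : ℂ)) * (q : ℂ)‖ ^ 2 = Real.exp (-(2 * z.im * ℓ)) * q ^ 2 := by
    rw [norm_mul, mul_pow, norm_sq_exp_I_mul, Complex.norm_real, Real.norm_eq_abs, sq_abs]
  have h2 : ‖((q * Real.sqrt (1 + Real.exp (-ℓ) - Real.exp (-(2 * z.im * ℓ))) : ℝ) : ℂ)‖ ^ 2 =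
      q ^ 2 * (1 + Real.exp (-ℓ) - Real.exp (-(2 * z.im * ℓ))) := by
    rw [Complex.norm_real, Real.norm_eq_abs, sq_abs, mul_pow, Real.sq_sqrt hw]
  have h3 : ‖(q : ℂ)‖ ^ 2 = q ^ 2 := by rw [Complex.norm_real, Real.norm_eq_abs, sq_abs]
  have h4 : ‖Complex.exp (-(1 / 2 : ℂ) * (ℓ : ℂ)) * (q : ℂ)‖ ^ 2 = Real.exp (-ℓ) * q ^ 2 := by
    rw [norm_mul, mul_pow, show -(1 / 2 : ℂ) * (ℓ : ℂ) = ((-ℓ / 2 : ℝ) : ℂ) by push_cast; ring,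
      Complex.norm_exp_ofReal, ← Real.exp_nat_mul, Complex.norm_real, Real.norm_eq_abs, sq_abs]
    congr 1; push_cast; ring
  rw [h1, h2, h3, h4]; ring


/-! #### Strong limits of sequences of bounded (semi)linear maps -/

section StrongLimit

variable {E : Type*} [NormedAddCommGroup E] [CompleteSpace E] {S : Type*} [NormedField S]
  [NormedSpace S E] {σ : S →+* S}

/-- The strong (pointwise) limit of a sequence of bounded semilinear maps `F n` of a Hilbert
space which is pointwise Cauchy and pointwise bounded by `‖x‖`; a bounded semilinear map.
[folklore] -/
private def strongLim (F : ℕ → E →SL[σ] E) (hF : ∀ x, CauchySeq fun n => F n x)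
    (hb : ∀ n x, ‖F n x‖ ≤ ‖x‖) : E →SL[σ] E :=
  LinearMap.mkContinuous
    { toFun := fun x => limUnder atTop fun n => F n x
      map_add' := fun x y => by
        refine tendsto_nhds_unique (hF (x + y)).tendsto_limUnder ?_
        simp only [map_add]
        exact (hF x).tendsto_limUnder.add (hF y).tendsto_limUnder
      map_smul' := fun c x => by
        refine tendsto_nhds_unique (hF (c • x)).tendsto_limUnder ?_
        simp only [map_smulₛₗ]
        exact (hF x).tendsto_limUnder.const_smul (σ c) }
    1 fun x => by
      rw [one_mul]
      exact le_of_tendsto' (hF x).tendsto_limUnder.norm fun n => hb n x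

/-- The strong limit is the pointwise limit. [folklore] -/
private theorem tendsto_strongLim (F : ℕ → E →SL[σ] E) (hF : ∀ x, CauchySeq fun n => F n x)
    (hb : ∀ n x, ‖F n x‖ ≤ ‖x‖) (x : E) :
    Tendsto (fun n => F n x) atTop (𝓝 (strongLim F hF hb x)) :=
  (hF x).tendsto_limUnder

end StrongLimit

variable {H : Type*} [NormedAddCommGroup H] [InnerProductSpace ℂ H]

/-- A continuous real-linear map of a complex Hilbert space commuting with multiplication by `i`
is complex-linear. [folklore] -/
private def clmOfCommuteI (F : H →L[ℝ] H) (hF : ∀ x, F (I • x) = I • F x) : H →L[ℂ] H where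
  toFun := F
  map_add' := F.map_add
  map_smul' c x := by
    calc F (c • x) = F ((c.re : ℂ) • x + (c.im : ℂ) • (I • x)) := by
          rw [← mul_smul, ← add_smul, re_add_im]
      _ = F ((c.re : ℝ) • x + (c.im : ℝ) • (I • x)) := by rw [Complex.coe_smul, Complex.coe_smul]
      _ = (c.re : ℝ) • F x + (c.im : ℝ) • F (I • x) := by rw [map_add, map_smul, map_smul]
      _ = (c.re : ℂ) • F x + (c.im : ℂ) • (I • F x) := by
          rw [hF, ← Complex.coe_smul c.re (F x), ← Complex.coe_smul c.im (I • F x)]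
      _ = c • F x := by rw [← mul_smul, ← add_smul, re_add_im]
  cont := F.continuous

/-- Unfolding `clmOfCommuteI`. [folklore] -/
@[simp]
private theorem clmOfCommuteI_apply (F : H →L[ℝ] H) (hF : ∀ x, F (I • x) = I • F x) (x : H) :
    clmOfCommuteI F hF x = F x := rfl


/-- `i • i • x = -x`. [folklore] -/
private theorem I_smul_I_smul (x : H) : I • I • x = -x := by
  rw [smul_smul, I_mul_I, neg_one_smul]


/-! #### Real-linear intertwiners pass through the real continuous functional calculus -/

/-- A bounded real-linear map `L` with `L A₁ = A₂ L` (for bounded self-adjoint `A₁, A₂`)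
satisfies `L p(A₁) = p(A₂) L` for every real polynomial `p`. [folklore] -/
private theorem map_aeval_of_map_eq {A₁ A₂ : H →L[ℂ] H} (L : H →L[ℝ] H)
    (hL : ∀ x, L (A₁ x) = A₂ (L x)) (p : Polynomial ℝ) (x : H) :
    L (Polynomial.aeval A₁ p x) = Polynomial.aeval A₂ p (L x) := by
  induction p using Polynomial.induction_on generalizing x with
  | C a =>
    simp only [Polynomial.aeval_C, Algebra.algebraMap_eq_smul_one, smul_apply, one_apply_eq_self]
    rw [← Complex.coe_smul, ← Complex.coe_smul, ]
    exact L.map_smul a x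
  | add p q hp hq =>
    simp only [map_add, add_apply, hp, hq]
  | monomial n a h =>
    rw [pow_succ, ← mul_assoc, map_mul (Polynomial.aeval A₁), map_mul (Polynomial.aeval A₂),
      Polynomial.aeval_X, Polynomial.aeval_X, mul_apply_eq_comp, mul_apply_eq_comp, h, hL]


variable [CompleteSpace H]



/-- **Real-linear intertwiners pass through the functional calculus.** If a bounded real-linear
map `L` of a complex Hilbert space intertwines two bounded self-adjoint operators,
`L A₁ = A₂ L`, then `L f(A₁) = f(A₂) L` for every continuous `f : ℝ → ℝ` (Weierstrass
approximation of `f` by polynomials on an interval containing both spectra, and continuity of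
the functional calculus). Used below with `L` conjugate-linear. [folklore] -/
private theorem map_cfc_of_map_eq {A₁ A₂ : H →L[ℂ] H} (hA₁ : IsSelfAdjoint A₁)
    (hA₂ : IsSelfAdjoint A₂)
    (L : H →L[ℝ] H) (hL : ∀ x, L (A₁ x) = A₂ (L x)) (f : ℝ → ℝ) (hf : Continuous f) (x : H) :
    L (cfc f A₁ x) = cfc f A₂ (L x) := by
  set M : ℝ := max (‖A₁‖ * ‖(1 : H →L[ℂ] H)‖) (‖A₂‖ * ‖(1 : H →L[ℂ] H)‖) with hM
  have hsp₁ : spectrum ℝ A₁ ⊆ Set.Icc (-M) M := fun k hk => by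
    have h := spectrum.norm_le_norm_mul_of_mem hk
    rw [Real.norm_eq_abs, abs_le] at h
    exact ⟨by linarith [le_max_left (‖A₁‖ * ‖(1 : H →L[ℂ] H)‖) (‖A₂‖ * ‖(1 : H →L[ℂ] H)‖), h.1],
      h.2.trans (le_max_left _ _)⟩
  have hsp₂ : spectrum ℝ A₂ ⊆ Set.Icc (-M) M := fun k hk => by
    have h := spectrum.norm_le_norm_mul_of_mem hk
    rw [Real.norm_eq_abs, abs_le] at h
    exact ⟨by linarith [le_max_right (‖A₁‖ * ‖(1 : H →L[ℂ] H)‖) (‖A₂‖ * ‖(1 : H →L[ℂ] H)‖), h.1],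
      h.2.trans (le_max_right _ _)⟩
  -- it suffices to prove `‖L f(A₁) x - f(A₂) L x‖ ≤ ε (‖L‖ ‖x‖ + ‖L x‖)` for every `ε > 0`
  set K : ℝ := ‖L‖ * ‖x‖ + ‖L x‖ with hK
  have hK0 : 0 ≤ K := by positivity
  suffices key : ∀ ε : ℝ, 0 < ε → ‖L (cfc f A₁ x) - cfc f A₂ (L x)‖ ≤ ε * K by
    rw [← sub_eq_zero, ← norm_le_zero_iff]
    refine le_of_forall_pos_lt_add fun ε hε => ?_
    have h := key (ε / (K + 1)) (div_pos hε (by linarith))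
    calc ‖L (cfc f A₁ x) - cfc f A₂ (L x)‖ ≤ ε / (K + 1) * K := h
      _ < ε := by
          rw [div_mul_eq_mul_div, div_lt_iff₀ (by linarith)]
          nlinarith
      _ = 0 + ε := (zero_add ε).symm
  intro ε hε
  obtain ⟨p, hp⟩ := exists_polynomial_near_of_continuousOn (-M) M f hf.continuousOn ε hε
  -- `‖f(Aᵢ) - p(Aᵢ)‖ ≤ ε`
  have hnorm : ∀ {A : H →L[ℂ] H}, IsSelfAdjoint A → spectrum ℝ A ⊆ Set.Icc (-M) M →
      ‖cfc f A - Polynomial.aeval A p‖ ≤ ε := by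
    intro A hA hsp
    rw [← cfc_polynomial p A hA, ← cfc_sub f (fun x => p.eval x) A hf.continuousOn
      (Polynomial.continuous _).continuousOn]
    refine norm_cfc_le hε.le fun k hk => ?_
    rw [Real.norm_eq_abs, abs_sub_comm]
    exact (hp k (hsp hk)).le
  have h₁ := hnorm hA₁ hsp₁
  have h₂ := hnorm hA₂ hsp₂
  have hpoly := map_aeval_of_map_eq L hL p x
  calc ‖L (cfc f A₁ x) - cfc f A₂ (L x)‖
      = ‖L ((cfc f A₁ - Polynomial.aeval A₁ p) x) -
          (cfc f A₂ - Polynomial.aeval A₂ p) (L x)‖ := by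
        rw [sub_apply, sub_apply, map_sub, hpoly]
        abel_nf
    _ ≤ ‖L ((cfc f A₁ - Polynomial.aeval A₁ p) x)‖ +
          ‖(cfc f A₂ - Polynomial.aeval A₂ p) (L x)‖ := norm_sub_le _ _
    _ ≤ ‖L‖ * (ε * ‖x‖) + ε * ‖L x‖ := by
        have e1 : ‖(cfc f A₁ - Polynomial.aeval A₁ p) x‖ ≤ ε * ‖x‖ :=
          (ContinuousLinearMap.le_opNorm _ _).trans (mul_le_mul_of_nonneg_right h₁ (norm_nonneg _))
        have e2 : ‖(cfc f A₂ - Polynomial.aeval A₂ p) (L x)‖ ≤ ε * ‖L x‖ :=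
          (ContinuousLinearMap.le_opNorm _ _).trans (mul_le_mul_of_nonneg_right h₂ (norm_nonneg _))
        have e3 : ‖L ((cfc f A₁ - Polynomial.aeval A₁ p) x)‖ ≤ ‖L‖ * (ε * ‖x‖) :=
          (L.le_opNorm _).trans (mul_le_mul_of_nonneg_left e1 (norm_nonneg _))
        linarith
    _ = ε * K := by rw [hK]; ring


/-! #### Norms of vectors under the complex functional calculus -/

section CfcNorm

variable {R : H →L[ℂ] H}

/-- `⟪g(R) x, g(R) x⟫ = ⟪(ḡ g)(R) x, x⟫`. [folklore] -/
private theorem inner_cfc_apply_self (g : ℂ → ℂ) (hg : ContinuousOn g (spectrum ℂ R))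
    (_hR : IsStarNormal R) (x : H) :
    ⟪cfc g R x, cfc g R x⟫_ℂ = ⟪cfc (fun μ => star (g μ) * g μ) R x, x⟫_ℂ := by
  rw [← ContinuousLinearMap.adjoint_inner_left, ← ContinuousLinearMap.star_eq_adjoint,
    ← cfc_star, ← mul_apply_eq_comp, ← cfc_mul (fun μ => star (g μ)) g R (hg.star) hg]

/-- `‖g(R) x‖² = ⟪|g|²(R) x, x⟫`. [folklore] -/
private theorem norm_sq_cfc_apply (g : ℂ → ℂ) (hg : ContinuousOn g (spectrum ℂ R))
    (hR : IsStarNormal R) (x : H) :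
    ‖cfc g R x‖ ^ 2 = (⟪cfc (fun μ => ((‖g μ‖ ^ 2 : ℝ) : ℂ)) R x, x⟫_ℂ).re := by
  rw [← inner_self_eq_norm_sq (𝕜 := ℂ), RCLike.re_to_complex, inner_cfc_apply_self g hg hR]
  congr 3
  refine cfc_congr fun μ _ => ?_
  rw [Complex.star_def, Complex.conj_mul', Complex.ofReal_pow]

/-- If `|g₁| = |g₂|` on the spectrum then `‖g₁(R) x‖ = ‖g₂(R) x‖`. [folklore] -/
private theorem norm_cfc_apply_congr {g₁ g₂ : ℂ → ℂ} (hg₁ : ContinuousOn g₁ (spectrum ℂ R))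
    (hg₂ : ContinuousOn g₂ (spectrum ℂ R)) (hR : IsStarNormal R)
    (h : ∀ μ ∈ spectrum ℂ R, ‖g₁ μ‖ = ‖g₂ μ‖) (x : H) : ‖cfc g₁ R x‖ = ‖cfc g₂ R x‖ := by
  have h1 := norm_sq_cfc_apply g₁ hg₁ hR x
  have h2 := norm_sq_cfc_apply g₂ hg₂ hR x
  have e : cfc (fun μ => ((‖g₁ μ‖ ^ 2 : ℝ) : ℂ)) R = cfc (fun μ => ((‖g₂ μ‖ ^ 2 : ℝ) : ℂ)) R :=
    cfc_congr fun μ hμ => by rw [h μ hμ]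
  rw [e, ← h2] at h1
  exact (sq_eq_sq₀ (norm_nonneg _) (norm_nonneg _)).1 h1

/-- If `|g|² + |k|² = |g₁|² + |g₂|²` on the spectrum then `‖g(R) x‖² ≤ ‖g₁(R) x‖² + ‖g₂(R) x‖²`
(the missing term is `‖k(R) x‖² ≥ 0`). [folklore] -/
private theorem norm_sq_cfc_apply_le {g k g₁ g₂ : ℂ → ℂ} (hg : ContinuousOn g (spectrum ℂ R))
    (hk : ContinuousOn k (spectrum ℂ R)) (hg₁ : ContinuousOn g₁ (spectrum ℂ R))
    (hg₂ : ContinuousOn g₂ (spectrum ℂ R)) (hR : IsStarNormal R)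
    (h : ∀ μ ∈ spectrum ℂ R, ‖g μ‖ ^ 2 + ‖k μ‖ ^ 2 = ‖g₁ μ‖ ^ 2 + ‖g₂ μ‖ ^ 2) (x : H) :
    ‖cfc g R x‖ ^ 2 ≤ ‖cfc g₁ R x‖ ^ 2 + ‖cfc g₂ R x‖ ^ 2 := by
  have hc : ∀ {f : ℂ → ℂ}, ContinuousOn f (spectrum ℂ R) →
      ContinuousOn (fun μ => ((‖f μ‖ ^ 2 : ℝ) : ℂ)) (spectrum ℂ R) := fun hf =>
    Complex.continuous_ofReal.comp_continuousOn ((hf.norm).pow 2)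
  have e : cfc (fun μ => ((‖g μ‖ ^ 2 : ℝ) : ℂ)) R + cfc (fun μ => ((‖k μ‖ ^ 2 : ℝ) : ℂ)) R =
      cfc (fun μ => ((‖g₁ μ‖ ^ 2 : ℝ) : ℂ)) R + cfc (fun μ => ((‖g₂ μ‖ ^ 2 : ℝ) : ℂ)) R := by
    rw [← cfc_add (a := R) _ _ (hc hg) (hc hk), ← cfc_add (a := R) _ _ (hc hg₁) (hc hg₂)]
    refine cfc_congr fun μ hμ => ?_
    simp only [← Complex.ofReal_add, h μ hμ]
  have := congrArg (fun T : H →L[ℂ] H => (⟪T x, x⟫_ℂ).re) e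
  simp only [add_apply, inner_add_left, add_re, ← norm_sq_cfc_apply _ hg hR,
    ← norm_sq_cfc_apply _ hk hR, ← norm_sq_cfc_apply _ hg₁ hR, ← norm_sq_cfc_apply _ hg₂ hR] at this
  nlinarith [sq_nonneg ‖cfc k R x‖]

end CfcNorm





/-- A bounded complex-linear operator which is symmetric for the real part of the inner product
is self-adjoint. [folklore] -/
private theorem isSelfAdjoint_of_re_inner_symm (F : H →L[ℂ] H)
    (h : ∀ x y : H, (⟪F x, y⟫_ℂ).re = (⟪x, F y⟫_ℂ).re) : IsSelfAdjoint F := by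
  rw [ContinuousLinearMap.isSelfAdjoint_iff_isSymmetric]
  intro x y
  simp only [ContinuousLinearMap.coe_coe]
  apply Complex.ext
  · exact h x y
  · have h1 := h x (I • y)
    rw [inner_smul_right, map_smul, inner_smul_right] at h1
    simp only [mul_re, I_re, I_im, zero_mul, one_mul, zero_sub, neg_inj] at h1
    exact h1

variable (V : StandardSubspace H)

/-! #### The real orthogonal projections `P` (onto `V`) and `Q` (onto `iV`) -/

/-- The real-orthogonal projection `P` onto `V` (Rieffel–van Daele 1977, §2).
[cite: RieffelVandaele1977, Def. 2.1] -/
private def projP : H →L[ℝ] H := V.toClosedSubmodule.toSubmodule.starProjection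

/-- The real-orthogonal projection `Q` onto `iV` (Rieffel–van Daele 1977, §2).
[cite: RieffelVandaele1977, Def. 2.1] -/
private def projQ : H →L[ℝ] H := V.toClosedSubmodule.mulI.toSubmodule.starProjection

/-- `P x ∈ V`. [folklore] -/
private theorem projP_mem (x : H) : (projP V) x ∈ V.toClosedSubmodule :=
  Submodule.starProjection_apply_mem _ x

/-- `Q x ∈ iV`. [folklore] -/
private theorem projQ_mem (x : H) : (projQ V) x ∈ V.toClosedSubmodule.mulI :=
  Submodule.starProjection_apply_mem _ x

/-- `i Q x ∈ V`. [folklore] -/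
private theorem I_smul_projQ_mem (x : H) : I • (projQ V) x ∈ V.toClosedSubmodule :=
  (mem_mulI_iff _).1 (projQ_mem V x)

/-- `P x = x` for `x ∈ V`. [folklore] -/
private theorem projP_eq_self {x : H} (hx : x ∈ V.toClosedSubmodule) : (projP V) x = x :=
  Submodule.starProjection_eq_self_iff.2 hx

/-- `Q x = x` for `x ∈ iV`. [folklore] -/
private theorem projQ_eq_self {x : H} (hx : x ∈ V.toClosedSubmodule.mulI) : (projQ V) x = x :=
  Submodule.starProjection_eq_self_iff.2 hx

/-- `P x = x ↔ x ∈ V`. [folklore] -/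
private theorem projP_eq_self_iff {x : H} : (projP V) x = x ↔ x ∈ V.toClosedSubmodule :=
  Submodule.starProjection_eq_self_iff

/-- `Q x = x ↔ x ∈ iV`. [folklore] -/
private theorem projQ_eq_self_iff {x : H} : (projQ V) x = x ↔ x ∈ V.toClosedSubmodule.mulI :=
  Submodule.starProjection_eq_self_iff

/-- `P² = P`. [folklore] -/
@[simp]
private theorem projP_projP (x : H) : (projP V) ((projP V) x) = (projP V) x :=
  projP_eq_self V (projP_mem V x)

/-- `Q² = Q`. [folklore] -/
@[simp]
private theorem projQ_projQ (x : H) : (projQ V) ((projQ V) x) = (projQ V) x :=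
  projQ_eq_self V (projQ_mem V x)

/-- `x - P x ⊥ V` for the real part of the inner product. [folklore] -/
private theorem re_inner_sub_projP {x w : H} (hw : w ∈ V.toClosedSubmodule) :
    (⟪x - (projP V) x, w⟫_ℂ).re = 0 :=
  Submodule.starProjection_inner_eq_zero x w hw

/-- `x - Q x ⊥ iV` for the real part of the inner product. [folklore] -/
private theorem re_inner_sub_projQ {x u : H} (hu : u ∈ V.toClosedSubmodule.mulI) :
    (⟪x - (projQ V) x, u⟫_ℂ).re = 0 :=
  Submodule.starProjection_inner_eq_zero x u hu

/-- `P` is symmetric for the real part of the inner product. [folklore] -/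
private theorem re_inner_projP_symm (x y : H) : (⟪(projP V) x, y⟫_ℂ).re = (⟪x, (projP V) y⟫_ℂ).re :=
  Submodule.inner_starProjection_left_eq_right (K := (V.toClosedSubmodule).toSubmodule) x y

/-- `Q` is symmetric for the real part of the inner product. [folklore] -/
private theorem re_inner_projQ_symm (x y : H) : (⟪(projQ V) x, y⟫_ℂ).re = (⟪x, (projQ V) y⟫_ℂ).re :=
  Submodule.inner_starProjection_left_eq_right (K := (V.toClosedSubmodule).mulI.toSubmodule) x y

/-- `Q = i P i⁻¹`: the projection onto `iV` is conjugate to the projection onto `V` (Rieffel–van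
Daele 1977, §2: `Q = iPi⁻¹`). [cite: RieffelVandaele1977, Prop. 3.1 (proof: iP = Qi)] -/
private theorem projQ_eq (x : H) : (projQ V) x = I • (projP V) (-(I • x)) := by
  apply Submodule.eq_starProjection_of_mem_of_inner_eq_zero
  · show I • (projP V) (-(I • x)) ∈ V.toClosedSubmodule.mulI
    rw [mem_mulI_iff, I_smul_I_smul]
    simpa using SMulMemClass.smul_mem (-1 : ℝ) (projP_mem V (-(I • x)))
  · intro u hu
    have hu' : I • u ∈ V.toClosedSubmodule := (mem_mulI_iff _).1 hu
    have h0 := re_inner_sub_projP V (x := -(I • x)) hu'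
    -- `x - I • P(-(I x)) = I • (-(I • x) - P (-(I • x)))`
    have e : x - I • (projP V) (-(I • x)) = I • (-(I • x) - (projP V) (-(I • x))) := by
      rw [smul_sub, smul_neg, I_smul_I_smul, neg_neg]
    show (⟪x - I • (projP V) (-(I • x)), u⟫_ℂ).re = 0
    rw [e, inner_smul_left, conj_I]
    rw [inner_smul_right] at h0
    simp only [mul_re, I_re, I_im, zero_mul, one_mul, zero_sub, neg_re, neg_mul,
      neg_neg] at h0 ⊢
    -- h0 : -(im ⟪a, u⟫) = 0 ; goal : im ⟪a, u⟫ = 0  (up to shape)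
    linarith

/-- `Q (i x) = i P x`. [cite: RieffelVandaele1977, Prop. 3.1 (proof: iP = Qi)] -/
private theorem projQ_I_smul (x : H) : (projQ V) (I • x) = I • (projP V) x := by
  rw [projQ_eq, I_smul_I_smul, neg_neg]

/-- `P (i x) = i Q x`. [cite: RieffelVandaele1977, Prop. 3.1 (proof: iP = Qi)] -/
private theorem projP_I_smul (x : H) : (projP V) (I • x) = I • (projQ V) x := by
  rw [projQ_eq, I_smul_I_smul, map_neg, neg_neg]

/-! #### `R = P + Q`, `B = P - Q`, `A = B² = R (2 - R)` -/

/-- `R = P + Q`, a bounded COMPLEX-linear operator with `0 ≤ R ≤ 2` (Rieffel–van Daele 1977, §2).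
[cite: RieffelVandaele1977, Def. 2.1 and Prop. 2.2 (1)] -/
private def opR : H →L[ℂ] H :=
  clmOfCommuteI ((projP V) + (projQ V)) fun x => by
    change (projP V) (I • x) + (projQ V) (I • x) = I • ((projP V) x + (projQ V) x)
    rw [projP_I_smul, projQ_I_smul, smul_add, add_comm]

/-- `R x = P x + Q x`. [cite: RieffelVandaele1977, Def. 2.1] -/
@[simp]
private theorem opR_apply (x : H) : (opR V) x = (projP V) x + (projQ V) x := rfl

/-- `B = P - Q`, a bounded CONJUGATE-linear (here: real-linear) operator with `B² = R(2 - R)`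
(Rieffel–van Daele 1977, §2: the polar decomposition `P - Q = JT`).
[cite: RieffelVandaele1977, Def. 2.1 (JT = P - Q)] -/
private def opB : H →L[ℝ] H := (projP V) - (projQ V)

/-- `B x = P x - Q x`. [cite: RieffelVandaele1977, Def. 2.1] -/
@[simp]
private theorem opB_apply (x : H) : (opB V) x = (projP V) x - (projQ V) x := rfl

/-- `B` is conjugate-linear: `B (i x) = -i B x`. [cite: RieffelVandaele1977, Prop. 3.1 (P - Q
conjugate linear)] -/
private theorem opB_I_smul (x : H) : (opB V) (I • x) = -(I • (opB V) x) := by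
  simp only [opB_apply, projP_I_smul, projQ_I_smul, smul_sub]
  abel

/-- `A = B²`, complex-linear. [cite: RieffelVandaele1977, Prop. 2.2 (2) (T² = R(2 - R))] -/
private def opA : H →L[ℂ] H :=
  clmOfCommuteI ((opB V).comp (opB V)) fun x => by
    simp only [ContinuousLinearMap.coe_comp, Function.comp_apply]
    rw [opB_I_smul, map_neg, opB_I_smul, neg_neg]

/-- `A x = B (B x)`. [cite: RieffelVandaele1977, Prop. 2.2 (2)] -/
@[simp]
private theorem opA_apply (x : H) : (opA V) x = (opB V) ((opB V) x) := rfl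

/-- `B P = (1 - Q) B`. [cite: RieffelVandaele1977, Prop. 2.2 (5) (proof)] -/
private theorem opB_projP (x : H) : (opB V) ((projP V) x) = (opB V) x - (projQ V) ((opB V) x) := by
  simp only [opB_apply, map_sub, projP_projP, projQ_projQ]
  abel

/-- `B Q = (1 - P) B`. [cite: RieffelVandaele1977, Prop. 2.2 (5) (proof)] -/
private theorem opB_projQ (x : H) : (opB V) ((projQ V) x) = (opB V) x - (projP V) ((opB V) x) := by
  simp only [opB_apply, map_sub, projP_projP, projQ_projQ]
  abel

/-- `B R = (2 - R) B`. [cite: RieffelVandaele1977, Prop. 2.2 (5) (proof)] -/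
private theorem opB_opR (x : H) :
    (opB V) ((opR V) x) = (2 : ℂ) • (opB V) x - (opR V) ((opB V) x) := by
  rw [opR_apply, map_add, opB_projP, opB_projQ, opR_apply, two_smul]
  abel

/-- `A = R (2 - R)` pointwise. [cite: RieffelVandaele1977, Prop. 2.2 (2)] -/
private theorem opA_eq_opR (x : H) : (opA V) x = (opR V) ((2 : ℂ) • x - (opR V) x) := by
  simp only [opA_apply, opB_apply, opR_apply, map_sub, map_add, projP_projP,
    projQ_projQ, two_smul]
  abel

/-- `P A = A P`. [cite: RieffelVandaele1977, Prop. 2.2 (4) (proof: P commutes with T²)] -/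
private theorem projP_opA (x : H) : (projP V) ((opA V) x) = (opA V) ((projP V) x) := by
  simp only [opA_apply, opB_apply, map_sub, projP_projP, projQ_projQ]
  abel

/-- `B` is symmetric for the real part of the inner product. [folklore] -/
private theorem re_inner_opB_symm (x y : H) : (⟪(opB V) x, y⟫_ℂ).re = (⟪x, (opB V) y⟫_ℂ).re := by
  simp only [opB_apply, inner_sub_left, inner_sub_right, sub_re, re_inner_projP_symm,
    re_inner_projQ_symm]

/-- `re ⟪A x, x⟫ = ‖B x‖²`. [folklore] -/
private theorem re_inner_opA_self (x : H) : (⟪(opA V) x, x⟫_ℂ).re = ‖(opB V) x‖ ^ 2 := by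
  rw [opA_apply, re_inner_opB_symm, ← inner_self_eq_norm_sq (𝕜 := ℂ)]
  rfl

/-- `R` is self-adjoint. [cite: RieffelVandaele1977, Prop. 3.1] -/
private theorem isSelfAdjoint_opR : IsSelfAdjoint (opR V) :=
  isSelfAdjoint_of_re_inner_symm _ fun x y => by
    simp only [opR_apply, inner_add_left, inner_add_right, add_re, re_inner_projP_symm,
      re_inner_projQ_symm]

/-- `A = B²` is self-adjoint. [folklore] -/
private theorem isSelfAdjoint_opA : IsSelfAdjoint (opA V) :=
  isSelfAdjoint_of_re_inner_symm _ fun x y => by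
    simp only [opA_apply]
    rw [re_inner_opB_symm, re_inner_opB_symm]

/-- `re ⟪R x, x⟫ = ‖P x‖² + ‖Q x‖²` (so `0 ≤ R`). [cite: RieffelVandaele1977, Prop. 2.2 (1) (proof)]
-/
private theorem re_inner_opR_self (x : H) :
    (⟪(opR V) x, x⟫_ℂ).re = ‖(projP V) x‖ ^ 2 + ‖(projQ V) x‖ ^ 2 := by
  have hP : (⟪(projP V) x, x⟫_ℂ).re = ‖(projP V) x‖ ^ 2 := by
    have := re_inner_sub_projP V (x := x) (projP_mem V x)
    rw [inner_sub_left, sub_re, sub_eq_zero] at this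
    rw [re_inner_projP_symm, this, ← inner_self_eq_norm_sq (𝕜 := ℂ)]
    rfl
  have hQ : (⟪(projQ V) x, x⟫_ℂ).re = ‖(projQ V) x‖ ^ 2 := by
    have := re_inner_sub_projQ V (x := x) (projQ_mem V x)
    rw [inner_sub_left, sub_re, sub_eq_zero] at this
    rw [re_inner_projQ_symm, this, ← inner_self_eq_norm_sq (𝕜 := ℂ)]
    rfl
  rw [opR_apply, inner_add_left, add_re, hP, hQ]

/-- `re ⟪(2 - R) x, x⟫ = ‖x - P x‖² + ‖x - Q x‖²` (so `R ≤ 2`). [cite: RieffelVandaele1977, Prop.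
2.2 (1) (proof)] -/
private theorem re_inner_two_sub_opR_self (x : H) :
    (⟪(2 : ℂ) • x - (opR V) x, x⟫_ℂ).re = ‖x - (projP V) x‖ ^ 2 + ‖x - (projQ V) x‖ ^ 2 := by
  have hP : (⟪x - (projP V) x, x⟫_ℂ).re = ‖x - (projP V) x‖ ^ 2 := by
    have h1 := re_inner_sub_projP V (x := x) (projP_mem V x)
    have : (⟪x - (projP V) x, x⟫_ℂ).re = (⟪x - (projP V) x, x - (projP V) x⟫_ℂ).re := by
      rw [inner_sub_right (x - (projP V) x) x, sub_re, h1, sub_zero]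
    rw [this, ← inner_self_eq_norm_sq (𝕜 := ℂ)]
    rfl
  have hQ : (⟪x - (projQ V) x, x⟫_ℂ).re = ‖x - (projQ V) x‖ ^ 2 := by
    have h1 := re_inner_sub_projQ V (x := x) (projQ_mem V x)
    have : (⟪x - (projQ V) x, x⟫_ℂ).re = (⟪x - (projQ V) x, x - (projQ V) x⟫_ℂ).re := by
      rw [inner_sub_right (x - (projQ V) x) x, sub_re, h1, sub_zero]
    rw [this, ← inner_self_eq_norm_sq (𝕜 := ℂ)]
    rfl
  have e : (2 : ℂ) • x - (opR V) x = (x - (projP V) x) + (x - (projQ V) x) := by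
    rw [two_smul, opR_apply]; abel
  rw [e, inner_add_left, add_re, hP, hQ]

/-- Vectors complex-orthogonal to `V` vanish (`V + iV` is dense). [folklore] -/
private theorem eq_zero_of_forall_inner_eq_zero {x : H}
    (h : ∀ w ∈ V.toClosedSubmodule, ⟪w, x⟫_ℂ = 0) :
    x = 0 := by
  have h' : ∀ d ∈ tomitaDomain V, ⟪d, x⟫_ℂ = 0 := by
    rintro _ ⟨v, hv, w, hw, rfl⟩
    rw [inner_add_left, inner_smul_left, h v hv, h w hw, mul_zero, add_zero]
  have horth : x ∈ (tomitaDomain V)ᗮ := (Submodule.mem_orthogonal _ _).2 h'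
  rwa [Submodule.topologicalClosure_eq_top_iff.1
    (Submodule.dense_iff_topologicalClosure_eq_top.1 (dense_tomitaDomain V)),
    Submodule.mem_bot] at horth

/-- `P x = 0` and `Q x = 0` force `x = 0`. [cite: RieffelVandaele1977, Prop. 2.2 (1) (proof)] -/
private theorem eq_zero_of_projP_eq_zero_of_projQ_eq_zero {x : H} (hP : (projP V) x = 0)
    (hQ : (projQ V) x = 0) : x = 0 := by
  apply eq_zero_of_forall_inner_eq_zero V
  intro w hw
  have h1 : (⟪x, w⟫_ℂ).re = 0 := by
    have := re_inner_sub_projP V (x := x) hw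
    rwa [hP, sub_zero] at this
  have h2 : (⟪x, w⟫_ℂ).im = 0 := by
    have := re_inner_sub_projQ V (x := x) ((I_smul_mem_mulI_iff _).2 hw)
    rw [hQ, sub_zero, inner_smul_right] at this
    simpa [mul_re] using this
  have h3 : ⟪x, w⟫_ℂ = 0 := Complex.ext (by simpa using h1) (by simpa using h2)
  rw [← inner_conj_symm, h3, map_zero]

/-- `Ker A = 0`. [cite: RieffelVandaele1977, Prop. 2.2 (1),(2)] -/
private theorem opA_injective : Function.Injective (opA V) := by
  rw [injective_iff_map_eq_zero]
  intro x hx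
  have hB : (opB V) x = 0 := by
    have h := re_inner_opA_self V x
    rw [hx, inner_zero_left, zero_re] at h
    have : ‖(opB V) x‖ = 0 := by nlinarith [norm_nonneg ((opB V) x)]
    exact norm_eq_zero.1 this
  have hPQ : (projP V) x = (projQ V) x := sub_eq_zero.1 (by simpa using hB)
  have hP0 : (projP V) x = 0 :=
    eq_zero_of_mem_of_I_smul_mem V (projP_mem V x) (hPQ ▸ I_smul_projQ_mem V x)
  exact eq_zero_of_projP_eq_zero_of_projQ_eq_zero V hP0 (hPQ ▸ hP0)

/-- `Range A` is dense. [cite: RieffelVandaele1977, Prop. 2.2 (2)] -/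
private theorem denseRange_opA : DenseRange (opA V) := by
  have hker : LinearMap.ker ((opA V : H →L[ℂ] H) : H →ₗ[ℂ] H) = ⊥ :=
    LinearMap.ker_eq_bot.2 (opA_injective V)
  have h1 : (LinearMap.range ((opA V : H →L[ℂ] H) : H →ₗ[ℂ] H)).topologicalClosure = ⊤ := by
    rw [Submodule.topologicalClosure_eq_top_iff,
      ContinuousLinearMap.IsStarNormal.orthogonal_range (isSelfAdjoint_opA V).isStarNormal, hker]
  have h2 : Dense ((LinearMap.range ((opA V : H →L[ℂ] H) : H →ₗ[ℂ] H) : Submodule ℂ H) : Set H) :=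
    Submodule.dense_iff_topologicalClosure_eq_top.2 h1
  simpa [DenseRange, LinearMap.coe_range] using h2

/-- `0 ≤ R`. [cite: RieffelVandaele1977, Prop. 2.2 (1)] -/
private theorem opR_nonneg : 0 ≤ (opR V) := by
  rw [ContinuousLinearMap.nonneg_iff_isPositive, ContinuousLinearMap.isPositive_def']
  refine ⟨isSelfAdjoint_opR V, fun x => ?_⟩
  rw [ContinuousLinearMap.reApplyInnerSelf_apply, RCLike.re_to_complex, re_inner_opR_self]
  positivity

/-- `0 ≤ A`. [folklore] -/
private theorem opA_nonneg : 0 ≤ (opA V) := by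
  rw [ContinuousLinearMap.nonneg_iff_isPositive, ContinuousLinearMap.isPositive_def']
  refine ⟨isSelfAdjoint_opA V, fun x => ?_⟩
  rw [ContinuousLinearMap.reApplyInnerSelf_apply, RCLike.re_to_complex, re_inner_opA_self]
  positivity

/-- `R ≤ 2`, i.e. `0 ≤ 2 - R`. [cite: RieffelVandaele1977, Prop. 2.2 (1)] -/
private theorem two_sub_opR_nonneg : 0 ≤ (algebraMap ℝ (H →L[ℂ] H) 2) - (opR V) := by
  rw [ContinuousLinearMap.nonneg_iff_isPositive, ContinuousLinearMap.isPositive_def']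
  refine ⟨(IsSelfAdjoint.algebraMap _ (by simp)).sub (isSelfAdjoint_opR V), fun x => ?_⟩
  rw [ContinuousLinearMap.reApplyInnerSelf_apply, RCLike.re_to_complex]
  have e : ((algebraMap ℝ (H →L[ℂ] H) 2) - (opR V)) x = (2 : ℂ) • x - (opR V) x := by
    rw [Algebra.algebraMap_eq_smul_one, sub_apply, smul_apply, one_apply_eq_self,
      ← Complex.coe_smul, Complex.ofReal_ofNat]
  rw [e, re_inner_two_sub_opR_self]
  positivity

/-- The spectrum of `R` lies in `[0, 2]`. [cite: RieffelVandaele1977, Prop. 2.2 (1)] -/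
private theorem spectrum_opR_subset : spectrum ℝ (opR V) ⊆ Set.Icc 0 2 := by
  intro x hx
  refine ⟨spectrum_nonneg_of_nonneg (opR_nonneg V) hx, ?_⟩
  have h2 : (2 : ℝ) - x ∈ spectrum ℝ ((algebraMap ℝ (H →L[ℂ] H) 2) - (opR V)) := by
    rw [← spectrum.singleton_sub_eq]
    exact Set.sub_mem_sub (Set.mem_singleton 2) hx
  have := spectrum_nonneg_of_nonneg (two_sub_opR_nonneg V) h2
  linarith

/-- The complex spectrum of `R` consists of real numbers in `[0, 2]`.
[cite: RieffelVandaele1977, Prop. 2.2 (1)] -/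
private theorem spectrum_opR_subset' :
    spectrum ℂ (opR V) ⊆ (fun r : ℝ => (r : ℂ)) '' Set.Icc 0 2 := by
  intro z hz
  have hz' := (isSelfAdjoint_opR V).spectrumRestricts
  rw [SpectrumRestricts.real_iff] at hz'
  have hre : z = (z.re : ℂ) := hz' z hz
  refine ⟨z.re, spectrum_opR_subset V ?_, hre.symm⟩
  rw [hre] at hz
  exact (spectrum.algebraMap_mem_iff ℂ).1 hz


/-! #### Functional calculus of `R`: the approximate identity `Eₙ`, `T = A^{1/2}`, cores -/

/-- `R` is normal. [folklore] -/
private theorem isStarNormal_opR : IsStarNormal (opR V) := (isSelfAdjoint_opR V).isStarNormal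

/-- Points of the complex spectrum of `R` are real numbers in `[0, 2]`. [folklore] -/
private theorem exists_of_mem_spectrum_opR {μ : ℂ} (hμ : μ ∈ spectrum ℂ (opR V)) :
    ∃ x : ℝ, x ∈ Set.Icc (0 : ℝ) 2 ∧ μ = x := by
  obtain ⟨x, hx, rfl⟩ := spectrum_opR_subset' V hμ
  exact ⟨x, hx, rfl⟩

/-- Points of the complex spectrum of `R` are real. [folklore] -/
private theorem re_mem_of_mem_spectrum_opR {μ : ℂ} (hμ : μ ∈ spectrum ℂ (opR V)) :
    μ = (μ.re : ℂ) := by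
  obtain ⟨x, -, rfl⟩ := exists_of_mem_spectrum_opR V hμ
  simp

/-- The spectrum of `A` is nonnegative. [folklore] -/
private theorem spectrum_opA_nonneg {u : ℝ} (hu : u ∈ spectrum ℝ (opA V)) : 0 ≤ u :=
  spectrum_nonneg_of_nonneg (opA_nonneg V) hu

/-- `(2 - R) x = 2 x - R x` for the algebra element `2 - R`. [folklore] -/
private theorem two_sub_opR_apply (x : H) :
    ((algebraMap ℝ (H →L[ℂ] H) 2) - opR V) x = (2 : ℂ) • x - opR V x := by
  rw [Algebra.algebraMap_eq_smul_one, sub_apply, smul_apply, one_apply_eq_self,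
    ← Complex.coe_smul, Complex.ofReal_ofNat]

/-- `cfc (2 - ·) R = 2 - R`. [folklore] -/
private theorem cfc_two_sub :
    cfc (fun x : ℝ => 2 - x) (opR V) = (algebraMap ℝ (H →L[ℂ] H) 2) - opR V := by
  rw [cfc_sub (fun _ : ℝ => (2 : ℝ)) (fun x => x) (opR V) (by fun_prop) (by fun_prop),
    cfc_const 2 (opR V) (isSelfAdjoint_opR V), cfc_id' ℝ (opR V) (isSelfAdjoint_opR V)]

/-- `A = R (2 - R)` in the functional calculus of `R`. [folklore] -/
private theorem cfc_parab_opR : cfc (fun x : ℝ => x * (2 - x)) (opR V) = opA V := by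
  rw [cfc_mul (fun x : ℝ => x) (fun x => 2 - x) (opR V) (by fun_prop) (by fun_prop),
    cfc_id' ℝ (opR V) (isSelfAdjoint_opR V), cfc_two_sub]
  ext x
  rw [mul_apply_eq_comp, two_sub_opR_apply, opA_eq_opR]

/-- Functions of `A` are functions of `R`. [folklore] -/
private theorem cfc_opA (f : ℝ → ℝ) (hf : Continuous f) :
    cfc f (opA V) = cfc (fun x => f (x * (2 - x))) (opR V) := by
  rw [← cfc_parab_opR, ← cfc_comp' f (fun x : ℝ => x * (2 - x)) (opR V) hf.continuousOn
    (by fun_prop) (isSelfAdjoint_opR V)]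

/-- Real functions of `R` in the complex functional calculus. [folklore] -/
private theorem cfc_real_opR (f : ℝ → ℝ) :
    cfc f (opR V) = cfc (fun μ : ℂ => (f μ.re : ℂ)) (opR V) :=
  cfc_real_eq_complex f (isSelfAdjoint_opR V)

/-- `R` commutes with `A`. [folklore] -/
private theorem commute_opR_opA : Commute (opR V) (opA V) := by
  have h := ((Commute.refl (opR V)).cfc_real (fun x : ℝ => x * (2 - x))).symm
  rwa [cfc_parab_opR] at h

/-- The **approximate identity** `Eₙ = bump n (A)` (`0 ≤ Eₙ ≤ 1`, `Eₙ → 1` strongly, `Eₙ` a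
function of `A` hence commuting with `P` and `Q`). [folklore] -/
private def opE (n : ℕ) : H →L[ℂ] H := cfc (bump n) (opA V)

/-- `Eₙ = cut n (R)` in the real functional calculus of `R`. [folklore] -/
private theorem opE_eq_cfc_cut (n : ℕ) : opE V n = cfc (cut n) (opR V) :=
  cfc_opA V (bump n) (continuous_bump n)

/-- `Eₙ = cutC n (R)` in the complex functional calculus of `R`. [folklore] -/
private theorem opE_eq_cfc_cutC (n : ℕ) : opE V n = cfc (cutC n) (opR V) := by
  rw [opE_eq_cfc_cut, cfc_real_opR]; rfl

/-- `P Eₙ = Eₙ P`. [folklore] -/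
private theorem projP_opE (n : ℕ) (x : H) : projP V (opE V n x) = opE V n (projP V x) :=
  map_cfc_of_map_eq (isSelfAdjoint_opA V) (isSelfAdjoint_opA V) (projP V) (projP_opA V)
    (bump n) (continuous_bump n) x

/-- `Eₙ V ⊆ V`. [folklore] -/
private theorem opE_mem (n : ℕ) {x : H} (hx : x ∈ V.toClosedSubmodule) :
    opE V n x ∈ V.toClosedSubmodule := by
  rw [← projP_eq_self_iff, projP_opE, projP_eq_self V hx]

/-- `B Eₙ = Eₙ B`. [folklore] -/
private theorem opB_opE (n : ℕ) (x : H) : opB V (opE V n x) = opE V n (opB V x) :=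
  map_cfc_of_map_eq (isSelfAdjoint_opA V) (isSelfAdjoint_opA V) (opB V) (fun _ => rfl)
    (bump n) (continuous_bump n) x

/-- `‖Eₙ‖ ≤ 1`. [folklore] -/
private theorem norm_opE_le (n : ℕ) : ‖opE V n‖ ≤ 1 :=
  norm_cfc_le zero_le_one fun u _ => by rw [Real.norm_eq_abs]; exact abs_bump_le_one n u

/-- `‖Eₙ x‖ ≤ ‖x‖`. [folklore] -/
private theorem norm_opE_apply_le (n : ℕ) (x : H) : ‖opE V n x‖ ≤ ‖x‖ :=
  (ContinuousLinearMap.le_opNorm _ _).trans (by nlinarith [norm_opE_le V n, norm_nonneg x])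

/-- `‖Eₙ A y - A y‖ ≤ 2/(n+1) ‖y‖`. [folklore] -/
private theorem norm_opE_opA_sub_le (n : ℕ) (y : H) :
    ‖opE V n (opA V y) - opA V y‖ ≤ 2 / (n + 1 : ℝ) * ‖y‖ := by
  have e : opE V n * opA V - opA V = cfc (fun u => bump n u * u - u) (opA V) := by
    rw [cfc_sub (fun u => bump n u * u) (fun u => u) (opA V)
      ((continuous_bump n).mul continuous_id).continuousOn (by fun_prop),
      cfc_mul (bump n) (fun u => u) (opA V) (continuous_bump n).continuousOn (by fun_prop),
      cfc_id' ℝ (opA V) (isSelfAdjoint_opA V)]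
    rfl
  have hn : (0 : ℝ) < n + 1 := by positivity
  have hnorm : ‖opE V n * opA V - opA V‖ ≤ 2 / (n + 1 : ℝ) := by
    rw [e]
    refine norm_cfc_le (by positivity) fun u hu => ?_
    have hu0 := spectrum_opA_nonneg V hu
    have hb1 := bump_le_one n u
    have hb0 := bump_nonneg n u
    rw [Real.norm_eq_abs, show bump n u * u - u = -(u * (1 - bump n u)) by ring, abs_neg,
      abs_of_nonneg (by nlinarith)]
    by_cases h2 : 2 / (n + 1 : ℝ) ≤ u
    · rw [bump_eq_one h2]; simp; positivity
    · have h2' := lt_of_not_ge h2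
      nlinarith
  calc ‖opE V n (opA V y) - opA V y‖ = ‖(opE V n * opA V - opA V) y‖ := by
        rw [sub_apply, mul_apply_eq_comp]
    _ ≤ ‖opE V n * opA V - opA V‖ * ‖y‖ := ContinuousLinearMap.le_opNorm _ _
    _ ≤ 2 / (n + 1 : ℝ) * ‖y‖ := by gcongr

/-- **`Eₙ → 1` strongly.** [folklore] -/
private theorem tendsto_opE (x : H) : Tendsto (fun n => opE V n x) atTop (𝓝 x) := by
  rw [Metric.tendsto_atTop]
  intro ε hε
  obtain ⟨y, hy⟩ := Metric.denseRange_iff.1 (denseRange_opA V) x (ε / 3) (by positivity)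
  obtain ⟨N, hN⟩ := exists_nat_gt (2 * ‖y‖ / (ε / 3))
  refine ⟨N, fun n hn => ?_⟩
  rw [dist_eq_norm]
  have hn' : (N : ℝ) ≤ n := by exact_mod_cast hn
  have h1 : ‖opE V n (x - opA V y)‖ ≤ ‖x - opA V y‖ := norm_opE_apply_le V n _
  have h2 := norm_opE_opA_sub_le V n y
  have h3 : dist x (opA V y) < ε / 3 := hy
  rw [dist_eq_norm] at h3
  have h4 : 2 / (n + 1 : ℝ) * ‖y‖ < ε / 3 := by
    rw [div_mul_eq_mul_div, div_lt_iff₀ (by positivity)]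
    have := (div_lt_iff₀ (show (0 : ℝ) < ε / 3 by positivity)).1 hN
    nlinarith [norm_nonneg y]
  calc ‖opE V n x - x‖
      = ‖opE V n (x - opA V y) + (opE V n (opA V y) - opA V y) + (opA V y - x)‖ := by
        rw [map_sub]; abel_nf
    _ ≤ ‖opE V n (x - opA V y)‖ + ‖opE V n (opA V y) - opA V y‖ + ‖opA V y - x‖ :=
        norm_add₃_le
    _ < ε / 3 + ε / 3 + ε / 3 := by
        gcongr
        · exact lt_of_le_of_lt h1 h3
        · exact lt_of_le_of_lt h2 h4
        · rwa [norm_sub_rev]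
    _ = ε := by ring

/-- `Eₙ Eₙ x → x`. [folklore] -/
private theorem tendsto_opE_opE (x : H) : Tendsto (fun n => opE V n (opE V n x)) atTop (𝓝 x) := by
  have h1 : Tendsto (fun n => opE V n (opE V n x) - opE V n x) atTop (𝓝 0) := by
    rw [tendsto_zero_iff_norm_tendsto_zero]
    have h2 : Tendsto (fun n => ‖opE V n x - x‖) atTop (𝓝 0) := by
      rw [← tendsto_zero_iff_norm_tendsto_zero (f := fun n => opE V n x - x)]
      simpa using (tendsto_opE V x).sub_const x
    refine squeeze_zero (fun n => norm_nonneg _) (fun n => ?_) h2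
    rw [← map_sub]
    exact norm_opE_apply_le V n _
  simpa using h1.add (tendsto_opE V x)

/-- **`T = A^{1/2}`** (Rieffel–van Daele: `T = |P - Q|`). [cite: RieffelVandaele1977, Prop. 2.2 (2)]
-/
private def opT : H →L[ℂ] H := cfc Real.sqrt (opA V)

/-- `T` is self-adjoint. [folklore] -/
private theorem isSelfAdjoint_opT : IsSelfAdjoint (opT V) := IsSelfAdjoint.cfc

/-- `T² = A`. [cite: RieffelVandaele1977, Prop. 2.2 (2)] -/
private theorem opT_mul_opT : opT V * opT V = opA V := by
  rw [opT, ← cfc_mul Real.sqrt Real.sqrt (opA V)]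
  conv_rhs => rw [← cfc_id' ℝ (opA V) (isSelfAdjoint_opA V)]
  exact cfc_congr fun u hu => Real.mul_self_sqrt (spectrum_opA_nonneg V hu)

/-- `T (T x) = A x`. [cite: RieffelVandaele1977, Prop. 2.2 (2)] -/
private theorem opT_opT (x : H) : opT V (opT V x) = opA V x := by
  rw [← mul_apply_eq_comp, opT_mul_opT]

/-- **`‖T y‖ = ‖B y‖`**: the isometry behind the polar decomposition `B = J T`.
[cite: RieffelVandaele1977, Def. 2.1 (polar decomposition of P - Q)] -/
private theorem norm_opT_apply (y : H) : ‖opT V y‖ = ‖opB V y‖ := by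
  have h : ‖opT V y‖ ^ 2 = ‖opB V y‖ ^ 2 := by
    rw [← re_inner_opA_self, ← inner_self_eq_norm_sq (𝕜 := ℂ), RCLike.re_to_complex,
      ← ContinuousLinearMap.adjoint_inner_left, (isSelfAdjoint_opT V).adjoint_eq, opT_opT]
  exact (sq_eq_sq₀ (norm_nonneg _) (norm_nonneg _)).1 h

/-- `Ker T = 0`. [cite: RieffelVandaele1977, Prop. 2.2 (2)] -/
private theorem opT_injective : Function.Injective (opT V) := by
  rw [injective_iff_map_eq_zero]
  intro x hx
  apply opA_injective V
  rw [← opT_opT, hx, map_zero, map_zero]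

/-- `Range T` is dense. [cite: RieffelVandaele1977, Prop. 2.2 (2)] -/
private theorem denseRange_opT : DenseRange (opT V) := by
  have hker : LinearMap.ker ((opT V : H →L[ℂ] H) : H →ₗ[ℂ] H) = ⊥ :=
    LinearMap.ker_eq_bot.2 (opT_injective V)
  have h1 : (LinearMap.range ((opT V : H →L[ℂ] H) : H →ₗ[ℂ] H)).topologicalClosure = ⊤ := by
    rw [Submodule.topologicalClosure_eq_top_iff,
      ContinuousLinearMap.IsStarNormal.orthogonal_range (isSelfAdjoint_opT V).isStarNormal, hker]
  have h2 : Dense ((LinearMap.range ((opT V : H →L[ℂ] H) : H →ₗ[ℂ] H) : Submodule ℂ H) : Set H) :=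
    Submodule.dense_iff_topologicalClosure_eq_top.2 h1
  simpa [DenseRange, LinearMap.coe_range] using h2

/-- `B T = T B`. [cite: RieffelVandaele1977, Prop. 2.2 (4)] -/
private theorem opB_opT (x : H) : opB V (opT V x) = opT V (opB V x) :=
  map_cfc_of_map_eq (isSelfAdjoint_opA V) (isSelfAdjoint_opA V) (opB V) (fun _ => rfl)
    Real.sqrt Real.continuous_sqrt x

/-- `P T = T P`. [cite: RieffelVandaele1977, Prop. 2.2 (4)] -/
private theorem projP_opT (x : H) : projP V (opT V x) = opT V (projP V x) :=
  map_cfc_of_map_eq (isSelfAdjoint_opA V) (isSelfAdjoint_opA V) (projP V) (projP_opA V)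
    Real.sqrt Real.continuous_sqrt x

/-- `R T = T R`. [cite: RieffelVandaele1977, Prop. 2.2 (4)] -/
private theorem commute_opR_opT : Commute (opR V) (opT V) :=
  ((commute_opR_opA V).symm.cfc_real Real.sqrt).symm

/-- `Q T = T Q`. [cite: RieffelVandaele1977, Prop. 2.2 (4)] -/
private theorem projQ_opT (x : H) : projQ V (opT V x) = opT V (projQ V x) := by
  have h1 : opR V (opT V x) = opT V (opR V x) := by
    rw [← mul_apply_eq_comp, (commute_opR_opT V).eq, mul_apply_eq_comp]
  rw [opR_apply, opR_apply, map_add, projP_opT] at h1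
  exact add_left_cancel h1

/-- `re ⟪T x, x⟫ ≥ 0`. [cite: RieffelVandaele1977, Prop. 3.1 (T positive)] -/
private theorem re_inner_opT_nonneg (x : H) : 0 ≤ (⟪opT V x, x⟫_ℂ).re := by
  have h : 0 ≤ opT V := cfc_nonneg fun u _ => Real.sqrt_nonneg u
  rw [ContinuousLinearMap.nonneg_iff_isPositive] at h
  exact h.re_inner_nonneg_left x

/-- `Sₙ = bump n (A) · A^{-1/2}` (bounded), with `T Sₙ = Eₙ`. [folklore] -/
private def opS (n : ℕ) : H →L[ℂ] H := cfc (bumpDivSqrt n) (opA V)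

/-- `T Sₙ = Eₙ`. [folklore] -/
private theorem opT_mul_opS (n : ℕ) : opT V * opS V n = opE V n := by
  rw [opT, opS, opE, ← cfc_mul Real.sqrt (bumpDivSqrt n) (opA V) (by fun_prop)
    (continuous_bumpDivSqrt n).continuousOn]
  exact cfc_congr fun u _ => sqrt_mul_bumpDivSqrt n u

/-- `Sₙ T = Eₙ`. [folklore] -/
private theorem opS_mul_opT (n : ℕ) : opS V n * opT V = opE V n := by
  rw [← opT_mul_opS]
  exact ((Commute.refl (opA V)).cfc_real _ |>.symm.cfc_real _).eq

/-- `T (Sₙ x) = Eₙ x`. [folklore] -/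
private theorem opT_opS (n : ℕ) (x : H) : opT V (opS V n x) = opE V n x := by
  rw [← mul_apply_eq_comp, opT_mul_opS]

/-- `Sₙ (T x) = Eₙ x`. [folklore] -/
private theorem opS_opT (n : ℕ) (x : H) : opS V n (opT V x) = opE V n x := by
  rw [← mul_apply_eq_comp, opS_mul_opT]

/-- `Aₙ⁻¹`-type operator `bumpDiv n (A)` with `A · bumpDiv n (A) = Eₙ`. [folklore] -/
private def opD (n : ℕ) : H →L[ℂ] H := cfc (bumpDiv n) (opA V)

/-- `A Dₙ = Eₙ`. [folklore] -/
private theorem opA_mul_opD (n : ℕ) : opA V * opD V n = opE V n := by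
  have h : cfc (fun u : ℝ => u) (opA V) * cfc (bumpDiv n) (opA V) = cfc (bump n) (opA V) := by
    rw [← cfc_mul (fun u : ℝ => u) (bumpDiv n) (opA V) (by fun_prop)
      (continuous_bumpDiv n).continuousOn]
    exact cfc_congr fun u _ => mul_bumpDiv n u
  rwa [cfc_id' ℝ (opA V) (isSelfAdjoint_opA V)] at h

/-- `A (Dₙ x) = Eₙ x`. [folklore] -/
private theorem opA_opD (n : ℕ) (x : H) : opA V (opD V n x) = opE V n x := by
  rw [← mul_apply_eq_comp, opA_mul_opD]

/-! #### The core operators `X_N(q, w) = exp (w · clog N (R)) q(R)` -/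

/-- The two-parameter core family `cfc (μ ↦ exp (w · clog N (re μ)) · q (re μ)) R`. [folklore] -/
private def opX (N : ℕ) (q : ℝ → ℝ) (w : ℂ) : H →L[ℂ] H :=
  cfc (fun μ : ℂ => Complex.exp (w * (clog N μ.re : ℂ)) * (q μ.re : ℂ)) (opR V)

omit [CompleteSpace H] in
/-- The functions defining the core family are continuous. [folklore] -/
private theorem continuous_opX_fn (N : ℕ) {q : ℝ → ℝ} (hq : Continuous q) (w : ℂ) :
    Continuous fun μ : ℂ => Complex.exp (w * (clog N μ.re : ℂ)) * (q μ.re : ℂ) :=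
  (Complex.continuous_exp.comp (continuous_const.mul
    (continuous_ofReal.comp ((continuous_clog N).comp continuous_re)))).mul
    (continuous_ofReal.comp (hq.comp continuous_re))

/-- The core operators `Wₙ(w) = X_n(cut n, w)`. [folklore] -/
private def opW (n : ℕ) (w : ℂ) : H →L[ℂ] H := opX V n (cut n) w

/-- `Wₙ(w) = coreFn n w (R)`. [folklore] -/
private theorem opW_eq_cfc_coreFn (n : ℕ) (w : ℂ) : opW V n w = cfc (coreFn n w) (opR V) := rfl

/-- `Wₙ(w) = X_N(cut n, w)` for `N ≥ n`. [folklore] -/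
private theorem opW_eq_opX {n N : ℕ} (h : n ≤ N) (w : ℂ) : opW V n w = opX V N (cut n) w :=
  cfc_congr fun μ _ => coreFn_eq_of_le h w μ

/-- `Wₙ(0) = Eₙ`. [folklore] -/
private theorem opW_zero (n : ℕ) : opW V n 0 = opE V n := by
  rw [opW_eq_cfc_coreFn, coreFn_zero, opE_eq_cfc_cutC]

/-- `X_N(q, 0) = q(R)`. [folklore] -/
private theorem opX_zero (N : ℕ) (q : ℝ → ℝ) :
    opX V N q 0 = cfc (fun μ : ℂ => (q μ.re : ℂ)) (opR V) := by
  unfold opX; congr 1; ext μ; simp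

/-- `X_N(q₁, w) - X_N(q₂, w) = X_N(q₁ - q₂, w)`. [folklore] -/
private theorem opX_sub (N : ℕ) {q₁ q₂ : ℝ → ℝ} (hq₁ : Continuous q₁) (hq₂ : Continuous q₂)
    (w : ℂ) :
    opX V N q₁ w - opX V N q₂ w = opX V N (fun x => q₁ x - q₂ x) w := by
  unfold opX
  rw [← cfc_sub _ _ (opR V) (continuous_opX_fn N hq₁ w).continuousOn
    (continuous_opX_fn N hq₂ w).continuousOn]
  congr 1; ext μ; push_cast; ring

/-- Unimodularity: `‖X_N(q, it) x‖ = ‖q(R) x‖`. [folklore] -/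
private theorem norm_opX_I_mul (N : ℕ) {q : ℝ → ℝ} (hq : Continuous q) (t : ℝ) (x : H) :
    ‖opX V N q (I * t) x‖ = ‖opX V N q 0 x‖ := by
  refine norm_cfc_apply_congr (continuous_opX_fn N hq _).continuousOn
    (continuous_opX_fn N hq _).continuousOn (isStarNormal_opR V) (fun μ _ => ?_) x
  rw [norm_mul, norm_mul, zero_mul, Complex.exp_zero, norm_one,
    show I * (t : ℂ) * (clog N μ.re : ℂ) = ((t * clog N μ.re : ℝ) : ℂ) * I by push_cast; ring,
    Complex.norm_exp_ofReal_mul_I]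

/-- **Strip bound**: `‖X_N(q, iz) x‖² ≤ ‖X_N(q, 0) x‖² + ‖X_N(q, -1/2) x‖²` for `0 ≤ Im z ≤ 1/2`.
[folklore] -/
private theorem norm_sq_opX_le (N : ℕ) {q : ℝ → ℝ} (hq : Continuous q) {z : ℂ} (hz0 : 0 ≤ z.im)
    (hz1 : z.im ≤ 1 / 2) (x : H) :
    ‖opX V N q (I * z) x‖ ^ 2 ≤ ‖opX V N q 0 x‖ ^ 2 + ‖opX V N q (-(1 / 2 : ℂ)) x‖ ^ 2 := by
  have hk : Continuous fun μ : ℂ => (((q μ.re * Real.sqrt (1 + Real.exp (-clog N μ.re) -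
      Real.exp (-(2 * z.im * clog N μ.re))) : ℝ) : ℂ)) := by
    refine continuous_ofReal.comp ((hq.comp continuous_re).mul (Real.continuous_sqrt.comp ?_))
    have hc := (continuous_clog N).comp continuous_re
    fun_prop
  rw [opX_zero]
  refine norm_sq_cfc_apply_le (continuous_opX_fn N hq _).continuousOn hk.continuousOn
    (by fun_prop) (continuous_opX_fn N hq _).continuousOn (isStarNormal_opR V) (fun μ _ => ?_) x
  exact norm_sq_exp_add hz0 hz1 (clog N μ.re) (q μ.re)

/-- `Wₙ(w) - Wₘ(w) = X_N(cut n - cut m, w)` with `N = max n m`. [folklore] -/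
private theorem opW_sub_opW (n m : ℕ) (w : ℂ) :
    opW V n w - opW V m w = opX V (max n m) (fun x => cut n x - cut m x) w := by
  rw [opW_eq_opX V (le_max_left n m), opW_eq_opX V (le_max_right n m),
    opX_sub V _ (continuous_cut n) (continuous_cut m)]

/-- `‖Wₙ(it) x - Wₘ(it) x‖ = ‖Eₙ x - Eₘ x‖`. [folklore] -/
private theorem norm_opW_sub_opW_I_mul (n m : ℕ) (t : ℝ) (x : H) :
    ‖opW V n (I * t) x - opW V m (I * t) x‖ = ‖opE V n x - opE V m x‖ := by
  rw [← sub_apply, opW_sub_opW,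
    norm_opX_I_mul V _ (q := fun x => cut n x - cut m x)
      ((continuous_cut n).sub (continuous_cut m)),
    ← opX_sub V _ (continuous_cut n) (continuous_cut m), ← opW_eq_opX V (le_max_left n m),
    ← opW_eq_opX V (le_max_right n m), opW_zero, opW_zero, sub_apply]

/-- `‖Wₙ(it) x‖ = ‖Eₙ x‖`. [folklore] -/
private theorem norm_opW_I_mul (n : ℕ) (t : ℝ) (x : H) : ‖opW V n (I * t) x‖ = ‖opE V n x‖ := by
  rw [opW, norm_opX_I_mul V _ (continuous_cut n), ← opW, opW_zero]

/-- `Wₙ(w) Eₘ = Wₘ(w) Eₙ` for `m ≤ n`. [folklore] -/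
private theorem opW_mul_opE {m n : ℕ} (h : m ≤ n) (w : ℂ) :
    opW V n w * opE V m = opW V m w * opE V n := by
  rw [opE_eq_cfc_cutC, opE_eq_cfc_cutC, opW_eq_cfc_coreFn, opW_eq_cfc_coreFn,
    ← cfc_mul _ _ (opR V) (continuous_coreFn n w).continuousOn (continuous_cutC m).continuousOn,
    ← cfc_mul _ _ (opR V) (continuous_coreFn m w).continuousOn (continuous_cutC n).continuousOn]
  refine cfc_congr fun μ _ => ?_
  rw [coreFn_eq_of_le h w μ]
  unfold coreFn cutC
  ring

/-- `Wₙ(w) Wₙ(w') = Wₙ(w + w') Eₙ`. [folklore] -/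
private theorem opW_mul_opW (n : ℕ) (w w' : ℂ) :
    opW V n w * opW V n w' = opW V n (w + w') * opE V n := by
  rw [opE_eq_cfc_cutC, opW_eq_cfc_coreFn, opW_eq_cfc_coreFn, opW_eq_cfc_coreFn,
    ← cfc_mul _ _ (opR V) (continuous_coreFn n w).continuousOn
      (continuous_coreFn n w').continuousOn,
    ← cfc_mul _ _ (opR V) (continuous_coreFn n _).continuousOn (continuous_cutC n).continuousOn]
  refine cfc_congr fun μ _ => ?_
  rw [coreFn_mul_coreFn]
  unfold coreFn cutC
  ring

/-- All the operators built from `R` by the functional calculus commute; the instances we need.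
[folklore] -/
private theorem opW_comm_cfc (n : ℕ) (w : ℂ) (g : ℂ → ℂ) (hg : Continuous g) :
    opW V n w * cfc g (opR V) = cfc g (opR V) * opW V n w := by
  rw [opW_eq_cfc_coreFn, ← cfc_mul _ _ (opR V) (continuous_coreFn n w).continuousOn hg.continuousOn,
    ← cfc_mul _ _ (opR V) hg.continuousOn (continuous_coreFn n w).continuousOn]
  exact cfc_congr fun μ _ => mul_comm _ _

/-- `Wₙ(w) Eₘ = Eₘ Wₙ(w)`. [folklore] -/
private theorem opW_opE_comm (n m : ℕ) (w : ℂ) (x : H) :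
    opW V n w (opE V m x) = opE V m (opW V n w x) := by
  rw [← mul_apply_eq_comp, ← mul_apply_eq_comp, opE_eq_cfc_cutC,
    opW_comm_cfc V n w _ (continuous_cutC m)]

/-- `T` in the complex functional calculus of `R`. [folklore] -/
private theorem opT_eq_cfcC :
    opT V = cfc (fun μ : ℂ => (Real.sqrt (μ.re * (2 - μ.re)) : ℂ)) (opR V) := by
  rw [opT, cfc_opA V _ Real.continuous_sqrt, cfc_real_opR]

/-- `Wₙ(w) T = T Wₙ(w)`. [folklore] -/
private theorem opW_opT_comm (n : ℕ) (w : ℂ) (x : H) :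
    opW V n w (opT V x) = opT V (opW V n w x) := by
  rw [← mul_apply_eq_comp, ← mul_apply_eq_comp, opT_eq_cfcC, opW_comm_cfc V n w _]
  exact continuous_ofReal.comp (Real.continuous_sqrt.comp (by fun_prop))

/-- `Wₙ(w) R = R Wₙ(w)`. [folklore] -/
private theorem opW_opR_comm (n : ℕ) (w : ℂ) (x : H) :
    opW V n w (opR V x) = opR V (opW V n w x) := by
  have h := opW_comm_cfc V n w (fun μ => μ) continuous_id
  rw [cfc_id' ℂ (opR V) (isStarNormal_opR V)] at h
  rw [← mul_apply_eq_comp, ← mul_apply_eq_comp, h]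

/-! #### `B` and the complex functional calculus of `R`: `B g(R) = g♯(R) B` -/

/-- Decomposition of `g(R)` into the real functional calculi of `re g` and `im g`. [folklore] -/
private theorem cfc_eq_re_add_im (g : ℂ → ℂ) (hg : Continuous g) :
    cfc g (opR V) =
      cfc (fun x : ℝ => (g x).re) (opR V) + I • cfc (fun x : ℝ => (g x).im) (opR V) := by
  rw [cfc_real_opR, cfc_real_opR,
    ← cfc_const_mul I (fun μ : ℂ => (((g (μ.re : ℂ)).im : ℝ) : ℂ)) (opR V) (by fun_prop),
    ← cfc_add (a := opR V) _ _ (by fun_prop) (by fun_prop)]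
  refine cfc_congr fun μ hμ => ?_
  obtain ⟨x, -, rfl⟩ := exists_of_mem_spectrum_opR V hμ
  simp only [Complex.ofReal_re]
  rw [mul_comm, Complex.re_add_im]

omit [CompleteSpace H] in
/-- The reflected-conjugated function `g♯ μ = conj (g (2 - conj μ))`. [folklore] -/
private def reflFn (g : ℂ → ℂ) (μ : ℂ) : ℂ := conj (g (2 - conj μ))

omit [CompleteSpace H] in
/-- `g♯` is continuous when `g` is. [folklore] -/
private theorem continuous_reflFn {g : ℂ → ℂ} (hg : Continuous g) : Continuous (reflFn g) := by
  unfold reflFn; fun_prop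

omit [CompleteSpace H] in
/-- `g♯` on real points: `g♯ x = conj (g (2 - x))`. [folklore] -/
private theorem reflFn_ofReal (g : ℂ → ℂ) (x : ℝ) : reflFn g x = conj (g ((2 - x : ℝ) : ℂ)) := by
  unfold reflFn
  rw [Complex.conj_ofReal]
  push_cast
  rfl

/-- **`B g(R) = g♯(R) B`** for continuous `g : ℂ → ℂ`: the conjugate-linear `B` intertwines
`R` with `2 - R` (`B R = (2 - R) B`), hence real functions of `R` with the reflected functions,
and conjugates the scalars of the imaginary parts. [folklore] -/
private theorem opB_map_cfc (g : ℂ → ℂ) (hg : Continuous g) (x : H) :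
    opB V (cfc g (opR V) x) = cfc (reflFn g) (opR V) (opB V x) := by
  have hA₂ : IsSelfAdjoint ((algebraMap ℝ (H →L[ℂ] H) 2) - opR V) :=
    (IsSelfAdjoint.algebraMap _ (by simp)).sub (isSelfAdjoint_opR V)
  have hL : ∀ y, opB V (opR V y) = ((algebraMap ℝ (H →L[ℂ] H) 2) - opR V) (opB V y) := by
    intro y; rw [two_sub_opR_apply, opB_opR]
  have key : ∀ f : ℝ → ℝ, Continuous f → ∀ y,
      opB V (cfc f (opR V) y) = cfc (fun x => f (2 - x)) (opR V) (opB V y) := by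
    intro f hf y
    rw [map_cfc_of_map_eq (isSelfAdjoint_opR V) hA₂ (opB V) hL f hf y, ← cfc_two_sub,
      ← cfc_comp' f (fun x : ℝ => 2 - x) (opR V) hf.continuousOn (by fun_prop)
        (isSelfAdjoint_opR V)]
  have e1 : (fun x : ℝ => (reflFn g x).re) = fun x => (g ((2 - x : ℝ) : ℂ)).re := by
    funext x; rw [reflFn_ofReal, Complex.conj_re]
  have e2 : (fun x : ℝ => (reflFn g x).im) = fun x => -(g ((2 - x : ℝ) : ℂ)).im := by
    funext x; rw [reflFn_ofReal, Complex.conj_im]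
  rw [cfc_eq_re_add_im V g hg, cfc_eq_re_add_im V (reflFn g) (continuous_reflFn hg), add_apply,
    add_apply, map_add, smul_apply, smul_apply, opB_I_smul,
    key (fun x : ℝ => (g x).re) (by fun_prop) x,
    key (fun x : ℝ => (g x).im) (by fun_prop) x, e1, e2,
    cfc_neg (fun x : ℝ => (g ((2 - x : ℝ) : ℂ)).im) (opR V), neg_apply, smul_neg]

omit [CompleteSpace H] in
/-- The unitary core multipliers are `♯`-invariant. [folklore] -/
private theorem reflFn_coreFn_I_mul (n : ℕ) (t : ℝ) :
    reflFn (coreFn n (I * t)) = coreFn n (I * t) := by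
  funext μ
  unfold reflFn coreFn
  have hre : ((2 : ℂ) - conj μ).re = 2 - μ.re := by simp
  rw [hre, clog_symm, cut_symm, map_mul, Complex.conj_ofReal, ← Complex.exp_conj]
  congr 2
  simp only [map_mul, Complex.conj_I, Complex.conj_ofReal]
  push_cast
  ring

/-- `B Wₙ(it) = Wₙ(it) B`. [folklore] -/
private theorem opB_opW_I_mul (n : ℕ) (t : ℝ) (x : H) :
    opB V (opW V n (I * t) x) = opW V n (I * t) (opB V x) := by
  rw [opW_eq_cfc_coreFn, opB_map_cfc V _ (continuous_coreFn n _), reflFn_coreFn_I_mul]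

/-! #### The core operators as exponentials: holomorphy -/

/-- `Lₙ = clog n (R)`, a bounded self-adjoint "cut-off logarithm of `Δ⁻¹`". [folklore] -/
private def opL (n : ℕ) : H →L[ℂ] H := cfc (fun μ : ℂ => (clog n μ.re : ℂ)) (opR V)

/-- `Wₙ(w) = exp (w Lₙ) Eₙ`. [folklore] -/
private theorem opW_eq_exp (n : ℕ) (w : ℂ) :
    opW V n w = NormedSpace.exp (w • opL V n) * cfc (cutC n) (opR V) := by
  rw [opW_eq_cfc_coreFn]
  unfold coreFn cutC
  rw [cfc_mul (fun μ : ℂ => Complex.exp (w * (clog n μ.re : ℂ))) (fun μ => (cut n μ.re : ℂ)) (opR V)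
    (by fun_prop) (by fun_prop)]
  congr 1
  rw [cfc_comp' Complex.exp (fun μ : ℂ => w * (clog n μ.re : ℂ)) (opR V)
    Complex.continuous_exp.continuousOn (by fun_prop) (isStarNormal_opR V),
    cfc_const_mul w (fun μ : ℂ => (clog n μ.re : ℂ)) (opR V) (by fun_prop),
    CFC.complex_exp_eq_normedSpace_exp]
  rfl

/-- `z ↦ Wₙ(iz) x` is entire. [folklore] -/
private theorem differentiable_opW_apply (n : ℕ) (x : H) :
    Differentiable ℂ fun z : ℂ => opW V n (I * z) x := by
  have hd : Differentiable ℂ fun u : ℂ => NormedSpace.exp (u • opL V n) := fun u =>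
    (hasDerivAt_exp_smul_const (opL V n) u).differentiableAt
  have h : Differentiable ℂ fun z : ℂ =>
      NormedSpace.exp ((I * z) • opL V n) (cfc (cutC n) (opR V) x) :=
    (hd.comp (differentiable_id.const_mul I)).clm_apply (differentiable_const _)
  have e : (fun z : ℂ => opW V n (I * z) x) =
      fun z => NormedSpace.exp ((I * z) • opL V n) (cfc (cutC n) (opR V) x) := by
    funext z; rw [opW_eq_exp, mul_apply_eq_comp]
  rw [e]; exact h

/-- `z ↦ Wₙ(iz) x` is continuous. [folklore] -/
private theorem continuous_opW_apply (n : ℕ) (x : H) : Continuous fun z : ℂ => opW V n (I * z) x :=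
  (differentiable_opW_apply V n x).continuous

/-- `s ↦ Wₙ(is) x` is continuous on `ℝ`. [folklore] -/
private theorem continuous_opW_apply_real (n : ℕ) (x : H) : Continuous fun s :
    ℝ => opW V n (I * s) x :=
  (continuous_opW_apply V n x).comp continuous_ofReal

/-! #### Cauchy sequences controlled by the approximate identity -/

omit [InnerProductSpace ℂ H] [CompleteSpace H] in
/-- A sequence dominated in increments by a Cauchy sequence is Cauchy. [folklore] -/
private theorem cauchySeq_of_norm_sub_le {F : ℕ → H} {e : ℕ → H}
    (h : ∀ n m, ‖F n - F m‖ ≤ ‖e n - e m‖) (he : CauchySeq e) : CauchySeq F := by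
  rw [Metric.cauchySeq_iff] at he ⊢
  intro ε hε
  obtain ⟨N, hN⟩ := he ε hε
  refine ⟨N, fun n hn m hm => ?_⟩
  rw [dist_eq_norm]
  exact (h n m).trans_lt (by rw [← dist_eq_norm]; exact hN n hn m hm)

/-! #### The modular conjugation `J`: `J T = B` -/

/-- The approximants `B Sₙ` of `J`. [folklore] -/
private def seqJ (n : ℕ) : H →L[ℝ] H := (opB V).comp ((opS V n).restrictScalars ℝ)

/-- `seqJ n x = B (Sₙ x)`. [folklore] -/
private theorem seqJ_apply (n : ℕ) (x : H) : seqJ V n x = opB V (opS V n x) := rfl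

/-- `‖B Sₙ x - B Sₘ x‖ = ‖Eₙ x - Eₘ x‖` (through `‖B y‖ = ‖T y‖`). [folklore] -/
private theorem norm_seqJ_sub (n m : ℕ) (x : H) :
    ‖seqJ V n x - seqJ V m x‖ = ‖opE V n x - opE V m x‖ := by
  rw [seqJ_apply, seqJ_apply, ← map_sub, ← norm_opT_apply, map_sub, opT_opS, opT_opS]

/-- `‖B Sₙ x‖ = ‖Eₙ x‖`. [folklore] -/
private theorem norm_seqJ (n : ℕ) (x : H) : ‖seqJ V n x‖ = ‖opE V n x‖ := by
  rw [seqJ_apply, ← norm_opT_apply, opT_opS]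

/-- `(B Sₙ x)ₙ` is Cauchy. [folklore] -/
private theorem cauchySeq_seqJ (x : H) : CauchySeq fun n => seqJ V n x :=
  cauchySeq_of_norm_sub_le (fun n m => (norm_seqJ_sub V n m x).le) (tendsto_opE V x).cauchySeq

/-- The modular conjugation as a real-linear isometry `J₀ = s-lim B Sₙ` (`J₀ T = B`).
[cite: RieffelVandaele1977, Def. 2.1 (JT = P - Q)] -/
private def opJ₀ : H →L[ℝ] H :=
  strongLim (seqJ V) (cauchySeq_seqJ V) fun n x =>
    (norm_seqJ V n x).le.trans (norm_opE_apply_le V n x)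

/-- `B Sₙ x → J x`. [folklore] -/
private theorem tendsto_opJ₀ (x : H) : Tendsto (fun n => opB V (opS V n x)) atTop (𝓝 (opJ₀ V x)) :=
  tendsto_strongLim (seqJ V) (cauchySeq_seqJ V) _ x

/-- **`J T = B`** (the polar decomposition `P - Q = J T` of Rieffel–van Daele).
[cite: RieffelVandaele1977, Def. 2.1 (JT = P - Q)] -/
private theorem opJ₀_opT (y : H) : opJ₀ V (opT V y) = opB V y := by
  refine tendsto_nhds_unique (tendsto_opJ₀ V (opT V y)) ?_
  simp only [opS_opT]
  exact ((opB V).continuous.tendsto _).comp (tendsto_opE V y)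

/-- `J` is isometric. [cite: RieffelVandaele1977, Prop. 3.1 (J isometry)] -/
private theorem norm_opJ₀ (x : H) : ‖opJ₀ V x‖ = ‖x‖ := by
  refine tendsto_nhds_unique (tendsto_opJ₀ V x).norm ?_
  have : (fun n => ‖opB V (opS V n x)‖) = fun n => ‖opE V n x‖ := funext fun n => norm_seqJ V n x
  rw [this]
  exact (tendsto_opE V x).norm

/-- `J` is conjugate-linear. [cite: RieffelVandaele1977, Prop. 3.1 (J conjugate linear)] -/
private theorem opJ₀_I_smul (x : H) : opJ₀ V (I • x) = -(I • opJ₀ V x) := by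
  refine tendsto_nhds_unique (tendsto_opJ₀ V (I • x)) ?_
  have : (fun n => opB V (opS V n (I • x))) = fun n => -(I • opB V (opS V n x)) := by
    funext n; rw [map_smul, opB_I_smul]
  rw [this]
  exact ((tendsto_opJ₀ V x).const_smul I).neg

/-- Two continuous maps agreeing on the range of `A` agree. [folklore] -/
private theorem eq_of_eq_on_range_opA {f g : H → H} (hf : Continuous f) (hg : Continuous g)
    (h : ∀ y, f (opA V y) = g (opA V y)) : f = g :=
  Continuous.ext_on (denseRange_opA V) hf hg fun _ ⟨y, hy⟩ => hy ▸ h y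

/-- Two continuous maps agreeing on the range of `T` agree. [folklore] -/
private theorem eq_of_eq_on_range_opT {f g : H → H} (hf : Continuous f) (hg : Continuous g)
    (h : ∀ y, f (opT V y) = g (opT V y)) : f = g :=
  Continuous.ext_on (denseRange_opT V) hf hg fun _ ⟨y, hy⟩ => hy ▸ h y

/-- **`J² = 1`.** On `A y = T T y`: `J J T T y = J B T y = J T B y = B B y = A y`.
[cite: RieffelVandaele1977, Prop. 2.2 (3)] -/
private theorem opJ₀_opJ₀ (x : H) : opJ₀ V (opJ₀ V x) = x := by
  have h := eq_of_eq_on_range_opA V ((opJ₀ V).continuous.comp (opJ₀ V).continuous) continuous_id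
    fun y => by
      show opJ₀ V (opJ₀ V (opA V y)) = opA V y
      rw [← opT_opT, opJ₀_opT, opB_opT, opJ₀_opT, opT_opT, opA_apply]
  exact congrFun h x

/-- `J R = (2 - R) J`. [cite: RieffelVandaele1977, Prop. 2.2 (5)] -/
private theorem opJ₀_opR (x : H) : opJ₀ V (opR V x) = (2 : ℂ) • opJ₀ V x - opR V (opJ₀ V x) := by
  have h := eq_of_eq_on_range_opT V ((opJ₀ V).continuous.comp (opR V).continuous)
    ((continuous_const.smul (opJ₀ V).continuous).sub ((opR V).continuous.comp (opJ₀ V).continuous))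
    fun y => by
      show opJ₀ V (opR V (opT V y)) = (2 : ℂ) • opJ₀ V (opT V y) - opR V (opJ₀ V (opT V y))
      rw [← mul_apply_eq_comp, (commute_opR_opT V).eq, mul_apply_eq_comp, opJ₀_opT, opB_opR,
        opJ₀_opT]
  exact congrFun h x

/-- `J P = (1 - Q) J`. [cite: RieffelVandaele1977, Prop. 2.2 (5)] -/
private theorem opJ₀_projP (x : H) : opJ₀ V (projP V x) = opJ₀ V x - projQ V (opJ₀ V x) := by
  have h := eq_of_eq_on_range_opT V ((opJ₀ V).continuous.comp (projP V).continuous)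
    ((opJ₀ V).continuous.sub ((projQ V).continuous.comp (opJ₀ V).continuous))
    fun y => by
      show opJ₀ V (projP V (opT V y)) = opJ₀ V (opT V y) - projQ V (opJ₀ V (opT V y))
      rw [projP_opT, opJ₀_opT, opB_projP, opJ₀_opT]
  exact congrFun h x

/-- `J Q = (1 - P) J`. [cite: RieffelVandaele1977, Prop. 2.2 (5)] -/
private theorem opJ₀_projQ (x : H) : opJ₀ V (projQ V x) = opJ₀ V x - projP V (opJ₀ V x) := by
  have h := eq_of_eq_on_range_opT V ((opJ₀ V).continuous.comp (projQ V).continuous)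
    ((opJ₀ V).continuous.sub ((projP V).continuous.comp (opJ₀ V).continuous))
    fun y => by
      show opJ₀ V (projQ V (opT V y)) = opJ₀ V (opT V y) - projP V (opJ₀ V (opT V y))
      rw [projQ_opT, opJ₀_opT, opB_projQ, opJ₀_opT]
  exact congrFun h x

/-- `J B = T` (from `J T = B` and `J² = 1`). [cite: RieffelVandaele1977, Prop. 2.2 (3),(4)] -/
private theorem opJ₀_opB (y : H) : opJ₀ V (opB V y) = opT V y := by
  rw [← opJ₀_opT, opJ₀_opJ₀]

/-- **The modular conjugation `J_V`** as an antiunitary (conjugate-linear isometric involution).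
[cite: RieffelVandaele1977, Prop. 3.1 (J conjugate-linear isometry) and Prop. 2.2 (3)] -/
private def opJ : H ≃ₗᵢ⋆[ℂ] H :=
  { toFun := opJ₀ V
    map_add' := map_add _
    map_smul' := fun c x => by
      calc opJ₀ V (c • x) = opJ₀ V ((c.re : ℂ) • x + (c.im : ℂ) • (I • x)) := by
            rw [← mul_smul, ← add_smul, re_add_im]
        _ = opJ₀ V ((c.re : ℝ) • x + (c.im : ℝ) • (I • x)) := by
            rw [Complex.coe_smul, Complex.coe_smul]
        _ = (c.re : ℝ) • opJ₀ V x + (c.im : ℝ) • opJ₀ V (I • x) := by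
            rw [map_add, map_smul, map_smul]
        _ = (c.re : ℂ) • opJ₀ V x - (c.im : ℂ) • (I • opJ₀ V x) := by
            rw [opJ₀_I_smul, smul_neg, ← sub_eq_add_neg, ← Complex.coe_smul c.re (opJ₀ V x),
              ← Complex.coe_smul c.im (I • opJ₀ V x)]
        _ = (starRingEnd ℂ c) • opJ₀ V x := by
            rw [← mul_smul, ← sub_smul, starRingEnd_apply, star_def, ← Complex.re_add_im (conj c),
              conj_re, conj_im]
            push_cast
            ring_nf
    invFun := opJ₀ V
    left_inv := opJ₀_opJ₀ V
    right_inv := opJ₀_opJ₀ V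
    norm_map' := norm_opJ₀ V }

/-- Unfolding `opJ`. [folklore] -/
@[simp]
private theorem opJ_apply (x : H) : opJ V x = opJ₀ V x := rfl

/-! #### The modular unitary group `𝒰 s = Δ_V^{-is} = s-lim Wₙ(is)` -/

/-- `(Wₙ(is) x)ₙ` is Cauchy. [folklore] -/
private theorem cauchySeq_opW (s : ℝ) (x : H) : CauchySeq fun n => opW V n (I * s) x :=
  cauchySeq_of_norm_sub_le (fun n m => (norm_opW_sub_opW_I_mul V n m s x).le)
    (tendsto_opE V x).cauchySeq

/-- **`𝒰 s = Δ_V^{-is}`**, the strong limit of the core unitaries `Wₙ(is) = e^{is Lₙ} Eₙ`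
(Rieffel–van Daele: `Δ^{it} = (2 - R)^{it} R^{-it}`; here `Δ^{-is}` acts on `Range Eₙ` as `cfc (λ ↦
(λ/(2-λ))^{is} cutₙ(λ)) R`). [cite: RieffelVandaele1977, Def. 3.2 (Δ^{it} = (2 - R)^{it} R^{-it})]
-/
private def opU (s : ℝ) : H →L[ℂ] H :=
  strongLim (fun n => opW V n (I * s)) (cauchySeq_opW V s) fun n x =>
    (norm_opW_I_mul V n s x).le.trans (norm_opE_apply_le V n x)

/-- `Wₙ(is) x → 𝒰 s x`. [folklore] -/
private theorem tendsto_opU (s : ℝ) (x : H) :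
    Tendsto (fun n => opW V n (I * s) x) atTop (𝓝 (opU V s x)) :=
  tendsto_strongLim _ _ _ x

/-- **`𝒰 s Eₘ = Wₘ(is)`**: on the core the modular group is the core unitary. [folklore] -/
private theorem opU_opE (s : ℝ) (m : ℕ) (y : H) : opU V s (opE V m y) = opW V m (I * s) y := by
  refine tendsto_nhds_unique (tendsto_opU V s (opE V m y)) ?_
  have h : (fun n => opW V m (I * s) (opE V n y)) =ᶠ[atTop]
      fun n => opW V n (I * s) (opE V m y) := by
    filter_upwards [eventually_ge_atTop m] with n hn
    rw [← mul_apply_eq_comp, ← mul_apply_eq_comp, opW_mul_opE V hn]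
  exact Tendsto.congr' h (((opW V m (I * s)).continuous.tendsto _).comp (tendsto_opE V y))

/-- `𝒰 s` is isometric. [cite: RieffelVandaele1977, Def. 3.2] -/
private theorem norm_opU (s : ℝ) (x : H) : ‖opU V s x‖ = ‖x‖ := by
  refine tendsto_nhds_unique (tendsto_opU V s x).norm ?_
  have : (fun n => ‖opW V n (I * s) x‖) = fun n => ‖opE V n x‖ :=
    funext fun n => norm_opW_I_mul V n s x
  rw [this]
  exact (tendsto_opE V x).norm

/-- `𝒰 0 x = x`. [folklore] -/
private theorem opU_zero_apply (x : H) : opU V 0 x = x := by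
  refine tendsto_nhds_unique (tendsto_opU V 0 x) ?_
  have : (fun n => opW V n (I * ((0 : ℝ) : ℂ)) x) = fun n => opE V n x := by
    funext n; rw [Complex.ofReal_zero, mul_zero, opW_zero]
  rw [this]
  exact tendsto_opE V x

/-- `𝒰 0 = 1`. [folklore] -/
private theorem opU_zero : opU V 0 = 1 := ContinuousLinearMap.ext (opU_zero_apply V)

/-- Two bounded operators agreeing on all `Eₘ Eₘ y` agree. [folklore] -/
private theorem clm_eq_of_eq_on_opE_opE {F G : H →L[ℂ] H}
    (h : ∀ m y, F (opE V m (opE V m y)) = G (opE V m (opE V m y))) : F = G := by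
  ext y
  have hF := (F.continuous.tendsto y).comp (tendsto_opE_opE V y)
  have hG := (G.continuous.tendsto y).comp (tendsto_opE_opE V y)
  have e : (F ∘ fun n => opE V n (opE V n y)) = (G ∘ fun n => opE V n (opE V n y)) := by
    funext n; exact h n y
  rw [e] at hF
  exact tendsto_nhds_unique hF hG

/-- **Group law** `𝒰 (s + t) = 𝒰 s 𝒰 t`. [cite: RieffelVandaele1977, Def. 3.2 (one-parameter group)]
-/
private theorem opU_add (s t : ℝ) : opU V (s + t) = opU V s * opU V t := by
  refine clm_eq_of_eq_on_opE_opE V fun m y => ?_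
  have hL : opU V (s + t) (opE V m (opE V m y)) = opW V m (I * (s + t : ℝ)) (opE V m y) :=
    opU_opE V _ m _
  have hR : (opU V s * opU V t) (opE V m (opE V m y)) = opW V m (I * (s + t : ℝ)) (opE V m y) := by
    rw [mul_apply_eq_comp, opU_opE, opW_opE_comm, opU_opE,
      show opW V m (I * s) (opW V m (I * t) y) = (opW V m (I * s) * opW V m (I * t)) y from rfl,
      opW_mul_opW, mul_apply_eq_comp]
    congr 2; push_cast; ring
  rw [hL, hR]

/-- `𝒰 s 𝒰 (-s) = 1`. [folklore] -/
private theorem opU_mul_opU_neg (s : ℝ) : opU V s * opU V (-s) = 1 := by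
  rw [← opU_add, add_neg_cancel, opU_zero]

/-- **Strong continuity** of `s ↦ 𝒰 s`. [cite: RieffelVandaele1977, Lemma 3.6 (strong continuity)]
-/
private theorem continuous_opU_apply (x : H) : Continuous fun s : ℝ => opU V s x := by
  apply continuous_of_uniform_approx_of_continuous
  intro u hu
  obtain ⟨ε, hε, hεu⟩ := Metric.mem_uniformity_dist.1 hu
  obtain ⟨m, hm⟩ := Metric.tendsto_atTop.1 (tendsto_opE V x) ε hε
  refine ⟨fun s => opU V s (opE V m x), ?_, fun s => hεu ?_⟩
  · simp only [opU_opE]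
    exact continuous_opW_apply_real V m x
  · rw [dist_eq_norm, ← map_sub, norm_opU, ← dist_eq_norm, dist_comm]
    exact hm m le_rfl

/-- `(𝒰 s)* 𝒰 s = 1`. [folklore] -/
private theorem star_opU_mul_self (s : ℝ) : star (opU V s) * opU V s = 1 := by
  rw [ContinuousLinearMap.star_eq_adjoint]
  exact (ContinuousLinearMap.norm_map_iff_adjoint_comp_self _).1 (norm_opU V s)

/-- `𝒰 s` is unitary. [cite: RieffelVandaele1977, Def. 3.2] -/
private theorem opU_mem_unitary (s : ℝ) : opU V s ∈ unitary (H →L[ℂ] H) := by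
  refine ⟨star_opU_mul_self V s, ?_⟩
  have h1 := star_opU_mul_self V s
  have h2 := opU_mul_opU_neg V s
  calc opU V s * star (opU V s) = opU V s * (star (opU V s) * (opU V s * opU V (-s))) := by
        rw [h2, mul_one]
    _ = opU V s * opU V (-s) := by rw [← mul_assoc (star (opU V s)), h1, one_mul]
    _ = 1 := h2

/-- `𝒰 s` commutes with `T`, `R`, `Eₘ`, `B` (all limits of the corresponding core relations).
[folklore] -/
private theorem opU_opT (s : ℝ) (x : H) : opU V s (opT V x) = opT V (opU V s x) := by
  refine tendsto_nhds_unique (tendsto_opU V s (opT V x)) ?_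
  simp only [opW_opT_comm]
  exact ((opT V).continuous.tendsto _).comp (tendsto_opU V s x)

/-- `𝒰 s R = R 𝒰 s`. [folklore] -/
private theorem opU_opR (s : ℝ) (x : H) : opU V s (opR V x) = opR V (opU V s x) := by
  refine tendsto_nhds_unique (tendsto_opU V s (opR V x)) ?_
  simp only [opW_opR_comm]
  exact ((opR V).continuous.tendsto _).comp (tendsto_opU V s x)

/-- `B 𝒰 s = 𝒰 s B`. [folklore] -/
private theorem opB_opU (s : ℝ) (x : H) : opB V (opU V s x) = opU V s (opB V x) := by
  refine tendsto_nhds_unique (((opB V).continuous.tendsto _).comp (tendsto_opU V s x)) ?_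
  have : ((opB V) ∘ fun n => opW V n (I * s) x) = fun n => opW V n (I * s) (opB V x) := by
    funext n; exact opB_opW_I_mul V n s x
  rw [this]
  exact tendsto_opU V s (opB V x)

/-- `P 𝒰 s = 𝒰 s P` (from `2P = R + B`). [cite: RieffelVandaele1977, Prop. 3.3 (proof: Δ^{it}
commutes with R and TJ)] -/
private theorem projP_opU (s : ℝ) (x : H) : projP V (opU V s x) = opU V s (projP V x) := by
  have h : ∀ z : H, opR V z + opB V z = (2 : ℝ) • projP V z := fun z => by
    rw [opR_apply, opB_apply, two_smul]; abel
  have h2 : (2 : ℝ) • projP V (opU V s x) = (2 : ℝ) • opU V s (projP V x) := by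
    rw [← h, ← opU_opR, opB_opU, ← map_add, h, ← Complex.coe_smul, map_smul, Complex.coe_smul]
  exact smul_right_injective H (two_ne_zero) h2

/-- **`𝒰 s V ⊆ V`.** [cite: RieffelVandaele1977, Prop. 3.3 (Δ^{it} K = K)] -/
private theorem opU_mem (s : ℝ) {x : H} (hx : x ∈ V.toClosedSubmodule) :
    opU V s x ∈ V.toClosedSubmodule := by
  rw [← projP_eq_self_iff, projP_opU, projP_eq_self V hx]

/-- **`J 𝒰 s = 𝒰 s J`.** [cite: RieffelVandaele1977, Prop. 3.3 (J Δ^{it} = Δ^{it} J)] -/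
private theorem opJ₀_opU (s : ℝ) (x : H) : opJ₀ V (opU V s x) = opU V s (opJ₀ V x) := by
  have h := eq_of_eq_on_range_opT V ((opJ₀ V).continuous.comp (opU V s).continuous)
    ((opU V s).continuous.comp (opJ₀ V).continuous) fun y => by
      show opJ₀ V (opU V s (opT V y)) = opU V s (opJ₀ V (opT V y))
      rw [opU_opT, opJ₀_opT, opJ₀_opT, opB_opU]
  exact congrFun h x

/-- **The modular unitary group `t ↦ Δ_V^{it} = 𝒰 (-t)`** as a strongly continuous one-parameter
unitary group. [cite: RieffelVandaele1977, Def. 3.2] -/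
private def modGroup : OneParameterUnitaryGroup H where
  toMonoidHom :=
    { toFun := fun g => opU V (-Multiplicative.toAdd g)
      map_one' := by rw [toAdd_one, neg_zero, opU_zero]
      map_mul' := fun g h => by
        show opU V (-Multiplicative.toAdd (g * h)) =
          opU V (-Multiplicative.toAdd g) * opU V (-Multiplicative.toAdd h)
        rw [toAdd_mul, neg_add, opU_add] }
  strongly_continuous x :=
    (continuous_opU_apply V x).comp (continuous_neg.comp continuous_toAdd)
  mem_unitary g := opU_mem_unitary V _

/-- `Δ^{it} = 𝒰 (-t)`. [folklore] -/
private theorem modGroup_appReal (t : ℝ) (x : H) : (modGroup V).appReal t x = opU V (-t) x := rfl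

/-- `Δ^{-it} = 𝒰 t`. [folklore] -/
private theorem modGroup_appReal_neg (t : ℝ) (x : H) : (modGroup V).appReal (-t) x = opU V t x := by
  rw [modGroup_appReal, neg_neg]

/-! #### `J V = V'`, positivity -/

/-- `Q z = 0 → z ∈ V'`. [folklore] -/
private theorem mem_symplComp_of_projQ_eq_zero {z : H} (h : projQ V z = 0) :
    z ∈ V.symplComp.toClosedSubmodule := by
  rw [mem_symplComp_iff']
  intro y hy
  have h1 := re_inner_sub_projQ V (x := z) ((I_smul_mem_mulI_iff _).2 hy)
  rw [h, sub_zero, inner_smul_right] at h1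
  simp only [mul_re, I_re, I_im, zero_mul, one_mul, zero_sub, neg_eq_zero] at h1
  rw [← inner_conj_symm, conj_im, h1, neg_zero]

/-- `z ∈ V' → Q z = 0`. [folklore] -/
private theorem projQ_eq_zero_of_mem_symplComp {z : H} (hz : z ∈ V.symplComp.toClosedSubmodule) :
    projQ V z = 0 := by
  apply Submodule.eq_starProjection_of_mem_of_inner_eq_zero (Submodule.zero_mem _)
  intro w hw
  rw [sub_zero]
  have hw' : I • w ∈ V.toClosedSubmodule := (mem_mulI_iff _).1 hw
  have h1 := (mem_symplComp_iff' V).1 hz (I • w) hw'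
  rw [inner_smul_left, conj_I] at h1
  simp only [neg_mul, neg_im, mul_im, I_re, I_im, zero_mul, one_mul, zero_add, neg_eq_zero] at h1
  show (⟪z, w⟫_ℂ).re = 0
  rw [← inner_conj_symm, conj_re, h1]

/-- `Q J x = 0` for `x ∈ V`. [cite: RieffelVandaele1977, Prop. 2.3 (1)] -/
private theorem projQ_opJ₀_eq_zero {x : H} (hx : x ∈ V.toClosedSubmodule) :
    projQ V (opJ₀ V x) = 0 := by
  have h := opJ₀_projP V x
  rw [projP_eq_self V hx] at h
  exact sub_eq_self.1 h.symm

/-- **`J V ⊆ V'`.** [cite: RieffelVandaele1977, Prop. 2.3 (1) (JK ⊆ L^⊥)] -/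
private theorem opJ₀_mem_symplComp {x : H} (hx : x ∈ V.toClosedSubmodule) :
    opJ₀ V x ∈ V.symplComp.toClosedSubmodule :=
  mem_symplComp_of_projQ_eq_zero V (projQ_opJ₀_eq_zero V hx)

/-- **`J V' ⊆ V`.** [cite: RieffelVandaele1977, Prop. 2.3 (1)] -/
private theorem opJ₀_mem_of_mem_symplComp {x : H} (hx : x ∈ V.symplComp.toClosedSubmodule) :
    opJ₀ V x ∈ V.toClosedSubmodule := by
  have h := opJ₀_projQ V x
  rw [projQ_eq_zero_of_mem_symplComp V hx, map_zero] at h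
  rw [← projP_eq_self_iff]
  exact (sub_eq_zero.1 h.symm).symm

/-- **Positivity `re ⟪x, J x⟫ = re ⟪T x, x⟫ ≥ 0` on `V`.** [cite: RieffelVandaele1977, Prop. 2.3
(2)] -/
private theorem re_inner_opJ₀_nonneg {x : H} (hx : x ∈ V.toClosedSubmodule) :
    0 ≤ (⟪x, opJ₀ V x⟫_ℂ).re := by
  have hQ := projQ_opJ₀_eq_zero V hx
  have e : ⟪x, opJ₀ V x⟫_ℂ = ⟪opB V x + projQ V x, opJ₀ V x⟫_ℂ := by
    congr 1
    rw [opB_apply, projP_eq_self V hx]; abel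
  have h1 : (⟪projQ V x, opJ₀ V x⟫_ℂ).re = 0 := by
    rw [re_inner_projQ_symm, hQ, inner_zero_right, Complex.zero_re]
  have h2 : ⟪opB V x, opJ₀ V x⟫_ℂ = ⟪x, opT V x⟫_ℂ := by
    rw [← opJ₀_opT]
    exact inner_antiunitary (opJ V) (opT V x) x
  rw [e, inner_add_left, add_re, h1, add_zero, h2, ← inner_conj_symm, conj_re]
  exact re_inner_opT_nonneg V x

/-! #### The Tomita operator on the core -/

/-- `A y ∈ D(S)`. [folklore] -/
private theorem opA_mem_tomitaDomain (y : H) : opA V y ∈ tomitaDomain V :=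
  ⟨projP V (opB V y), projP_mem V _, I • projQ V (opB V y), I_smul_projQ_mem V _, by
    rw [I_smul_I_smul, ← sub_eq_add_neg]; rfl⟩

/-- **`S A = R B`**: `S (A y) = R (B y)`. [cite: RieffelVandaele1977, Appendix, Proposition (2) ((2
- R) S = J T on D(S))] -/
private theorem tomitaOperator_of_eq_opA (z : tomitaDomain V) {y : H} (hz : (z : H) = opA V y) :
    tomitaOperator V z = opR V (opB V y) := by
  rw [tomitaOperator_apply_eq z (projP_mem V (opB V y)) (I_smul_projQ_mem V (opB V y))
    (by rw [hz, I_smul_I_smul, ← sub_eq_add_neg]; rfl), I_smul_I_smul, sub_neg_eq_add]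
  rfl

/-- `Eₙ` preserves `D(S)`. [folklore] -/
private theorem opE_mem_tomitaDomain (n : ℕ) (z : tomitaDomain V) : opE V n z ∈ tomitaDomain V := by
  obtain ⟨v, hv, w, hw, h⟩ := exists_decomp z
  exact ⟨opE V n v, opE_mem V n hv, opE V n w, opE_mem V n hw, by rw [← h, map_add, map_smul]⟩

/-- `S Eₙ = Eₙ S` on `D(S)`. [folklore] -/
private theorem tomitaOperator_opE (n : ℕ) (z : tomitaDomain V) :
    tomitaOperator V ⟨opE V n z, opE_mem_tomitaDomain V n z⟩ = opE V n (tomitaOperator V z) := by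
  obtain ⟨v, hv, w, hw, h⟩ := exists_decomp z
  rw [tomitaOperator_apply_eq z hv hw h, tomitaOperator_apply_eq _ (opE_mem V n hv) (opE_mem V n hw)
    (by simp only [← h, map_add, map_smul]), map_sub, map_smul]

/-- The operator identity `Wₙ(-1/2) = (2 - R) T Dₙ` (`Δ^{1/2}` on the core).
[cite: RieffelVandaele1977, Appendix, Proposition (3) (Δ = (2 - R) R⁻¹)] -/
private theorem opW_neg_half (n : ℕ) :
    opW V n (-(1 / 2 : ℂ)) = ((algebraMap ℝ (H →L[ℂ] H) 2) - opR V) * opT V * opD V n := by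
  rw [← cfc_two_sub, cfc_real_opR, opT_eq_cfcC, opD, cfc_opA V _ (continuous_bumpDiv n),
    cfc_real_opR, opW_eq_cfc_coreFn,
    ← cfc_mul (fun μ : ℂ => (((fun x : ℝ => 2 - x) μ.re : ℝ) : ℂ))
      (fun μ : ℂ => (Real.sqrt (μ.re * (2 - μ.re)) : ℂ)) (opR V) (by fun_prop) (by fun_prop),
    ← cfc_mul _ (fun μ : ℂ => (((fun x : ℝ => bumpDiv n (x * (2 - x))) μ.re : ℝ) : ℂ)) (opR V)
      (by fun_prop) (by fun_prop)]
  refine cfc_congr fun μ hμ => ?_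
  obtain ⟨x, -, rfl⟩ := exists_of_mem_spectrum_opR V hμ
  simp only [coreFn, Complex.ofReal_re]
  rw [show (-(1 / 2 : ℂ)) * (clog n x : ℂ) = ((-(clog n x) / 2 : ℝ) : ℂ) by push_cast; ring,
    ← Complex.ofReal_exp, ← Complex.ofReal_mul, ← two_sub_mul_sqrt_mul_bumpDiv n x]
  push_cast
  ring

/-- **`J S xₙ = Wₙ(-1/2) x`** (`= Δ^{1/2} xₙ`), `xₙ = Eₙ x`. [cite: RieffelVandaele1977, Appendix,
Proposition (2),(3)] -/
private theorem opJ₀_tomitaOperator_opE (n : ℕ) (z : tomitaDomain V) :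
    opJ₀ V (tomitaOperator V ⟨opE V n z, opE_mem_tomitaDomain V n z⟩) =
      opW V n (-(1 / 2 : ℂ)) z := by
  rw [tomitaOperator_of_eq_opA V _ (y := opD V n z) (by simp only [opA_opD]), opJ₀_opR, opJ₀_opB,
    opW_neg_half, mul_apply_eq_comp, mul_apply_eq_comp, two_sub_opR_apply]

/-! #### The polar decomposition: analytic continuation of `t ↦ Δ^{-it} x` on `D(S)` -/

/-- `‖Wₙ(iζ) x‖² ≤ ‖Eₙ x‖² + ‖Eₙ S x‖²` for `0 ≤ Im ζ ≤ 1/2`. [folklore] -/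
private theorem polar_core_bound (n : ℕ) (z : tomitaDomain V) {ζ : ℂ} (h0 : 0 ≤ ζ.im)
    (h1 : ζ.im ≤ 1 / 2) :
    ‖opW V n (I * ζ) z‖ ^ 2 ≤ ‖opE V n z‖ ^ 2 + ‖opE V n (tomitaOperator V z)‖ ^ 2 := by
  have h := norm_sq_opX_le V n (continuous_cut n) h0 h1 (z : H)
  calc ‖opW V n (I * ζ) z‖ ^ 2 ≤ ‖opW V n 0 z‖ ^ 2 + ‖opW V n (-(1 / 2 : ℂ)) z‖ ^ 2 := h
    _ = ‖opE V n z‖ ^ 2 + ‖opE V n (tomitaOperator V z)‖ ^ 2 := by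
        rw [opW_zero, ← opJ₀_tomitaOperator_opE, norm_opJ₀, tomitaOperator_opE]

/-- `‖Wₙ(iζ) x - Wₘ(iζ) x‖² ≤ ‖Eₙ x - Eₘ x‖² + ‖Eₙ S x - Eₘ S x‖²` for `0 ≤ Im ζ ≤ 1/2`.
[folklore] -/
private theorem polar_core_diff_bound (n m : ℕ) (z : tomitaDomain V) {ζ : ℂ} (h0 : 0 ≤ ζ.im)
    (h1 : ζ.im ≤ 1 / 2) :
    ‖opW V n (I * ζ) z - opW V m (I * ζ) z‖ ^ 2 ≤
      ‖opE V n z - opE V m z‖ ^ 2 +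
        ‖opE V n (tomitaOperator V z) - opE V m (tomitaOperator V z)‖ ^ 2 := by
  have h := norm_sq_opX_le V (max n m) (q := fun x => cut n x - cut m x)
    ((continuous_cut n).sub (continuous_cut m)) h0 h1 (z : H)
  rw [← opW_sub_opW, ← opW_sub_opW, ← opW_sub_opW, sub_apply, sub_apply, sub_apply, opW_zero,
    opW_zero, ← opJ₀_tomitaOperator_opE, ← opJ₀_tomitaOperator_opE, ← map_sub, norm_opJ₀,
    tomitaOperator_opE, tomitaOperator_opE] at h
  exact h

/-- **The analytic continuation** `G(ζ) = lim Wₙ(iζ) x` (`= Δ^{-iζ} x`) of `t ↦ Δ^{-it} x`. [cite: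
RieffelVandaele1977, Lemma 3.6 (proof: cut off the spectrum, entire functions, uniform limits)] -/
private def polarFn (z : tomitaDomain V) (ζ : ℂ) : H := limUnder atTop fun n => opW V n (I * ζ) z

/-- The core continuations `ζ ↦ Wₙ(iζ) x` are uniformly Cauchy on the closed strip
`0 ≤ Im ζ ≤ 1/2`. [folklore] -/
private theorem uniformCauchySeqOn_polar (z : tomitaDomain V) :
    UniformCauchySeqOn (fun n ζ => opW V n (I * ζ) (z : H)) atTop (closedStrip 2⁻¹) := by
  rw [Metric.uniformCauchySeqOn_iff]
  intro ε hε
  obtain ⟨N₁, hN₁⟩ :=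
    Metric.cauchySeq_iff.1 (tendsto_opE V (z : H)).cauchySeq (ε / 2) (by positivity)
  obtain ⟨N₂, hN₂⟩ :=
    Metric.cauchySeq_iff.1 (tendsto_opE V (tomitaOperator V z)).cauchySeq (ε / 2) (by positivity)
  refine ⟨max N₁ N₂, fun m hm n hn ζ hζ => ?_⟩
  have hb := polar_core_diff_bound V m n z hζ.1 (by simpa using hζ.2)
  have d1 := hN₁ m (le_of_max_le_left hm) n (le_of_max_le_left hn)
  have d2 := hN₂ m (le_of_max_le_right hm) n (le_of_max_le_right hn)
  rw [dist_eq_norm] at d1 d2 ⊢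
  have e1 := pow_lt_pow_left₀ d1 (norm_nonneg _) two_ne_zero
  have e2 := pow_lt_pow_left₀ d2 (norm_nonneg _) two_ne_zero
  refine lt_of_pow_lt_pow_left₀ 2 hε.le ?_
  nlinarith

/-- `Wₙ(iζ) x → G(ζ)` on the closed strip. [folklore] -/
private theorem tendsto_polarFn (z : tomitaDomain V) {ζ : ℂ} (hζ : ζ ∈ closedStrip 2⁻¹) :
    Tendsto (fun n => opW V n (I * ζ) (z : H)) atTop (𝓝 (polarFn V z ζ)) :=
  ((uniformCauchySeqOn_polar V z).cauchySeq hζ).tendsto_limUnder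

/-- `Wₙ(i·) x → G` uniformly on the closed strip. [folklore] -/
private theorem tendstoUniformlyOn_polarFn (z : tomitaDomain V) :
    TendstoUniformlyOn (fun n ζ => opW V n (I * ζ) (z : H)) (polarFn V z) atTop (closedStrip 2⁻¹) :=
  (uniformCauchySeqOn_polar V z).tendstoUniformlyOn_of_tendsto fun _ hζ => tendsto_polarFn V z hζ

/-- `G` is continuous on the closed strip (uniform limit of continuous functions). [cite:
RieffelVandaele1977, Lemma 3.6] -/
private theorem continuousOn_polarFn (z : tomitaDomain V) :
    ContinuousOn (polarFn V z) (closedStrip 2⁻¹) :=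
  (tendstoUniformlyOn_polarFn V z).continuousOn
    (Eventually.of_forall fun n => (continuous_opW_apply V n z).continuousOn).frequently

/-- `G` is holomorphic on the open strip (locally uniform limit of entire functions). [cite:
RieffelVandaele1977, Lemma 3.6] -/
private theorem differentiableOn_polarFn (z : tomitaDomain V) :
    DifferentiableOn ℂ (polarFn V z) (openStrip 2⁻¹) :=
  ((tendstoUniformlyOn_polarFn V z).mono (openStrip_subset_closedStrip _)).tendstoLocallyUniformlyOn
    |>.differentiableOn
      (Eventually.of_forall fun n => (differentiable_opW_apply V n z).differentiableOn)
    (isOpen_openStrip _)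

/-- `‖G(ζ)‖ ≤ ‖x‖ + ‖S x‖` on the closed strip. [cite: RieffelVandaele1977, Lemma 3.6 (uniformly
bounded on strips)] -/
private theorem norm_polarFn_le (z : tomitaDomain V) {ζ : ℂ} (hζ : ζ ∈ closedStrip 2⁻¹) :
    ‖polarFn V z ζ‖ ≤ ‖(z : H)‖ + ‖tomitaOperator V z‖ := by
  refine le_of_tendsto (tendsto_polarFn V z hζ).norm (Eventually.of_forall fun n => ?_)
  have h := polar_core_bound V n z hζ.1 (by simpa using hζ.2)
  have h1 := norm_opE_apply_le V n (z : H)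
  have h2 := norm_opE_apply_le V n (tomitaOperator V z)
  refine le_of_pow_le_pow_left₀ two_ne_zero (by positivity) ?_
  nlinarith [norm_nonneg (opE V n (z : H)), norm_nonneg (opE V n (tomitaOperator V z)),
    norm_nonneg (z : H), norm_nonneg (tomitaOperator V z)]

/-- Real points lie in the closed strip. [folklore] -/
private theorem ofReal_mem_closedStrip (t : ℝ) : (t : ℂ) ∈ closedStrip 2⁻¹ := by
  rw [mem_closedStrip_iff, ofReal_im]; norm_num

/-- `G(t) = Δ^{-it} x = 𝒰 t x`. [cite: RieffelVandaele1977, Lemma 3.6] -/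
private theorem polarFn_ofReal (z : tomitaDomain V) (t : ℝ) : polarFn V z t = opU V t z :=
  tendsto_nhds_unique (tendsto_polarFn V z (ofReal_mem_closedStrip t)) (tendsto_opU V t z)

/-- **`G(i/2) = J S x`**: the polar decomposition `Δ^{1/2} = J S`.
[cite: RieffelVandaele1977, Appendix, Proposition (2),(3) (S = J Δ^{1/2})] -/
private theorem polarFn_half_I (z : tomitaDomain V) :
    polarFn V z ((2⁻¹ : ℂ) * I) = opJ₀ V (tomitaOperator V z) := by
  refine tendsto_nhds_unique (tendsto_polarFn V z half_I_mem_closedStrip) ?_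
  have e : (fun n => opW V n (I * ((2⁻¹ : ℂ) * I)) (z : H)) =
      fun n => opJ₀ V (opE V n (tomitaOperator V z)) := by
    funext n
    rw [show I * ((2⁻¹ : ℂ) * I) = -(1 / 2 : ℂ) by rw [mul_left_comm, I_mul_I]; norm_num,
      ← opJ₀_tomitaOperator_opE, tomitaOperator_opE]
  rw [e]
  exact ((opJ₀ V).continuous.tendsto _).comp (tendsto_opE V _)

/-- Covariance `G(ζ + s) = 𝒰 s G(ζ)` on the closed strip. [cite: RieffelVandaele1977, Thm. 3.8
(proof: h(t + is) = U_t h(is))] -/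
private theorem polarFn_add_ofReal (z : tomitaDomain V) (s : ℝ) {ζ : ℂ} (hζ : ζ ∈ closedStrip 2⁻¹) :
    polarFn V z (ζ + s) = opU V s (polarFn V z ζ) := by
  set G := polarFn V z with hG
  set f : ℂ → H := fun w => G (w + s) - opU V s (G w) with hf
  have hmaps₁ : Set.MapsTo (fun w : ℂ => w + s) (openStrip 2⁻¹) (openStrip 2⁻¹) := by
    intro w hw
    simpa [mem_openStrip_iff, add_im, ofReal_im] using hw
  have hmaps₂ : Set.MapsTo (fun w : ℂ => w + s) (closedStrip 2⁻¹) (closedStrip 2⁻¹) := by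
    intro w hw
    simpa [mem_closedStrip_iff, add_im, ofReal_im] using hw
  have hfd : DifferentiableOn ℂ f (openStrip 2⁻¹) :=
    ((differentiableOn_polarFn V z).comp (differentiableOn_id.add_const _) hmaps₁).sub
      ((opU V s).differentiable.comp_differentiableOn (differentiableOn_polarFn V z))
  have hfc : ContinuousOn f (closedStrip 2⁻¹) :=
    ((continuousOn_polarFn V z).comp (continuousOn_id.add continuousOn_const) hmaps₂).sub
      ((opU V s).continuous.comp_continuousOn (continuousOn_polarFn V z))
  set C := ‖(z : H)‖ + ‖tomitaOperator V z‖ with hC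
  have hfb : ∀ w ∈ closedStrip 2⁻¹, ‖f w‖ ≤ C + C := by
    intro w hw
    refine (norm_sub_le _ _).trans (add_le_add (norm_polarFn_le V z (hmaps₂ hw)) ?_)
    rw [norm_opU]
    exact norm_polarFn_le V z hw
  have hf0 : ∀ t : ℝ, f t = 0 := by
    intro t
    rw [hf]
    dsimp only
    rw [show (t : ℂ) + (s : ℂ) = ((t + s : ℝ) : ℂ) by push_cast; ring, hG, polarFn_ofReal,
      polarFn_ofReal, sub_eq_zero, add_comm, opU_add, mul_apply_eq_comp]
  exact sub_eq_zero.1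
    (eq_zero_of_eq_zero_on_real (by norm_num : (0 : ℝ) < 2⁻¹) hfd hfc hfb hf0 ζ hζ)

/-! #### The KMS condition from the polar decomposition -/

omit [CompleteSpace H] in
/-- If `g` is complex-differentiable at `conj z` then `w ↦ J (g (conj w))` is complex-differentiable
at `z` for an antiunitary `J` (conjugate-linearity of `J` cancels the anti-holomorphy).
[folklore] -/
private theorem hasDerivAt_antiunitary_conj (J : H ≃ₗᵢ⋆[ℂ] H) {g : ℂ → H} {g' : H} {z : ℂ}
    (hg : HasDerivAt g g' (conj z)) : HasDerivAt (fun w => J (g (conj w))) (J g') z := by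
  rw [hasDerivAt_iff_tendsto] at hg ⊢
  have hc : Tendsto (fun w : ℂ => conj w) (𝓝 z) (𝓝 (conj z)) := Complex.continuous_conj.tendsto z
  refine (hg.comp hc).congr fun w => ?_
  simp only [Function.comp_apply]
  have e : J (g (conj w) - g (conj z) - (conj w - conj z) • g') =
      J (g (conj w)) - J (g (conj z)) - (w - z) • J g' := by
    rw [map_sub, map_sub, LinearIsometryEquiv.map_smulₛₗ, ← map_sub (starRingEnd ℂ) w z,
      starRingEnd_self_apply]
  rw [← e, LinearIsometryEquiv.norm_map, ← map_sub (starRingEnd ℂ) w z, Complex.norm_conj]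

/-- `(𝒰 s)* = 𝒰 (-s)`. [folklore] -/
private theorem star_opU (s : ℝ) : star (opU V s) = opU V (-s) := by
  calc star (opU V s) = star (opU V s) * (opU V s * opU V (-s)) := by rw [opU_mul_opU_neg, mul_one]
    _ = opU V (-s) := by rw [← mul_assoc, star_opU_mul_self, one_mul]

/-- `⟪𝒰 s x, y⟫ = ⟪x, 𝒰 (-s) y⟫`. [folklore] -/
private theorem inner_opU_left (s : ℝ) (x y : H) : ⟪opU V s x, y⟫_ℂ = ⟪x, opU V (-s) y⟫_ℂ := by
  rw [← ContinuousLinearMap.adjoint_inner_right, ← ContinuousLinearMap.star_eq_adjoint, star_opU]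

/-- `Im (-z̄/2) = Im z / 2`. [folklore] -/
private theorem half_neg_im (ζ : ℂ) : (-(starRingEnd ℂ) ζ / 2).im = ζ.im / 2 := by
  simp [Complex.div_ofNat_im]

/-- `Im (z/2) = Im z / 2`. [folklore] -/
private theorem half_im (ζ : ℂ) : (ζ / 2).im = ζ.im / 2 := by simp [Complex.div_ofNat_im]

/-- **The KMS condition** at inverse temperature `1` for `t ↦ Δ^{-it}` on `V`, from the polar
decomposition: `F(z) = ⟪G_η(-z̄/2), G_ξ(z/2)⟫`. [cite: RieffelVandaele1977, Def. 3.4 and Prop. 3.7]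
-/
private theorem kms_polarFn {ξ η : H} (hξ : ξ ∈ V.toClosedSubmodule)
    (hη : η ∈ V.toClosedSubmodule) :
    ∃ F : ℂ → ℂ, ContinuousOn F (closedStrip 1) ∧ DifferentiableOn ℂ F (openStrip 1) ∧
      (∃ C : ℝ, ∀ z ∈ closedStrip 1, ‖F z‖ ≤ C) ∧
      (∀ t : ℝ, F t = ⟪η, (modGroup V).appReal (-t) ξ⟫_ℂ) ∧
      (∀ t : ℝ, F (t + I) = ⟪(modGroup V).appReal (-t) ξ, η⟫_ℂ) := by
  set Gξ := polarFn V ⟨ξ, mem_tomitaDomain_of_mem V hξ⟩ with hGξ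
  set Gη := polarFn V ⟨η, mem_tomitaDomain_of_mem V hη⟩ with hGη
  have hSξ : tomitaOperator V (⟨ξ, mem_tomitaDomain_of_mem V hξ⟩ : tomitaDomain V) = ξ :=
    tomitaOperator_apply_of_mem hξ
  have hSη : tomitaOperator V (⟨η, mem_tomitaDomain_of_mem V hη⟩ : tomitaDomain V) = η :=
    tomitaOperator_apply_of_mem hη
  -- the two half-speed reparametrisations map the strip of width 1 into the strip of width 1/2
  have m₁ : Set.MapsTo (fun ζ : ℂ => ζ / 2) (closedStrip 1) (closedStrip 2⁻¹) := fun ζ hζ => by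
    rw [mem_closedStrip_iff, half_im]; rw [mem_closedStrip_iff] at hζ
    constructor <;> linarith [hζ.1, hζ.2]
  have m₁' : Set.MapsTo (fun ζ : ℂ => ζ / 2) (openStrip 1) (openStrip 2⁻¹) := fun ζ hζ => by
    rw [mem_openStrip_iff, half_im]; rw [mem_openStrip_iff] at hζ
    constructor <;> linarith [hζ.1, hζ.2]
  have m₂ : Set.MapsTo (fun ζ : ℂ => -(starRingEnd ℂ) ζ / 2) (closedStrip 1) (closedStrip 2⁻¹) :=
    fun ζ hζ => by
      rw [mem_closedStrip_iff, half_neg_im]; rw [mem_closedStrip_iff] at hζ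
      constructor <;> linarith [hζ.1, hζ.2]
  have m₂' : Set.MapsTo (fun ζ : ℂ => -(starRingEnd ℂ) ζ / 2) (openStrip 1) (openStrip 2⁻¹) :=
    fun ζ hζ => by
      rw [mem_openStrip_iff, half_neg_im]; rw [mem_openStrip_iff] at hζ
      constructor <;> linarith [hζ.1, hζ.2]
  refine ⟨fun ζ => ⟪Gη (-(starRingEnd ℂ) ζ / 2), Gξ (ζ / 2)⟫_ℂ, ?_, ?_, ?_, ?_, ?_⟩
  · -- continuity
    refine ContinuousOn.inner ?_ ?_
    · exact (continuousOn_polarFn V _).comp (by fun_prop) m₂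
    · exact (continuousOn_polarFn V _).comp (by fun_prop) m₁
  · -- holomorphy: `⟪Gη(-z̄/2), Gξ(z/2)⟫ = B (Gξ (z/2)) (J Gη(-z̄/2))`, `B (a, b) = ⟪J a, b⟫`
    set B : H →L[ℂ] H →L[ℂ] ℂ :=
      (innerSL ℂ (E := H)).comp (opJ V).toLinearIsometry.toContinuousLinearMap with hB
    have hBapply : ∀ a b : H, B a b = ⟪opJ V a, b⟫_ℂ := fun a b => rfl
    have hd₁ : DifferentiableOn ℂ (fun ζ => Gξ (ζ / 2)) (openStrip 1) :=
      (differentiableOn_polarFn V _).comp (differentiableOn_id.div_const 2) m₁'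
    have hd₂ : DifferentiableOn ℂ (fun ζ => opJ V (Gη (-(starRingEnd ℂ) ζ / 2))) (openStrip 1) := by
      intro ζ hζ
      have hmem : -(starRingEnd ℂ) ζ / 2 ∈ openStrip 2⁻¹ := m₂' hζ
      have hGd : DifferentiableAt ℂ Gη (-(starRingEnd ℂ) ζ / 2) :=
        (differentiableOn_polarFn V _).differentiableAt ((isOpen_openStrip _).mem_nhds hmem)
      have h1 : HasDerivAt (fun w : ℂ => -w / 2) (-1 / 2) (starRingEnd ℂ ζ) := by
        simpa using ((hasDerivAt_id (starRingEnd ℂ ζ)).neg.div_const 2)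
      have hg := hGd.hasDerivAt.scomp (starRingEnd ℂ ζ) h1
      have h := hasDerivAt_antiunitary_conj (opJ V) hg
      exact h.differentiableAt.differentiableWithinAt
    have hd := (B.differentiable.comp_differentiableOn hd₁).clm_apply hd₂
    refine hd.congr fun ζ _ => ?_
    simp only [Function.comp_apply, hBapply]
    exact (inner_antiunitary (opJ V) _ _).symm
  · -- boundedness
    refine ⟨(‖η‖ + ‖η‖) * (‖ξ‖ + ‖ξ‖), fun ζ hζ => ?_⟩
    refine (norm_inner_le_norm _ _).trans (mul_le_mul ?_ ?_ (norm_nonneg _) (by positivity))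
    · have := norm_polarFn_le V (⟨η, mem_tomitaDomain_of_mem V hη⟩ : tomitaDomain V) (m₂ hζ)
      rwa [hSη] at this
    · have := norm_polarFn_le V (⟨ξ, mem_tomitaDomain_of_mem V hξ⟩ : tomitaDomain V) (m₁ hζ)
      rwa [hSξ] at this
  · -- lower edge
    intro t
    dsimp only
    rw [show -(starRingEnd ℂ) (t : ℂ) / 2 = ((-(t / 2) : ℝ) : ℂ) by
        rw [Complex.conj_ofReal]; push_cast; ring,
      show (t : ℂ) / 2 = ((t / 2 : ℝ) : ℂ) by push_cast; ring, hGη, hGξ, polarFn_ofReal,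
      polarFn_ofReal, inner_opU_left, neg_neg, ← mul_apply_eq_comp, ← opU_add, add_halves,
      modGroup_appReal_neg]
  · -- upper edge
    intro t
    dsimp only
    rw [show -(starRingEnd ℂ) ((t : ℂ) + I) / 2 = (2⁻¹ : ℂ) * I + ((-(t / 2) : ℝ) : ℂ) by
        rw [map_add, Complex.conj_ofReal, Complex.conj_I]; push_cast; ring,
      show ((t : ℂ) + I) / 2 = (2⁻¹ : ℂ) * I + ((t / 2 : ℝ) : ℂ) by push_cast; ring, hGη, hGξ,
      polarFn_add_ofReal V _ _ half_I_mem_closedStrip,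
      polarFn_add_ofReal V _ _ half_I_mem_closedStrip, polarFn_half_I, polarFn_half_I, hSξ, hSη,
      inner_opU_left, neg_neg, ← mul_apply_eq_comp, ← opU_add, add_halves, ← opJ₀_opU,
      modGroup_appReal_neg]
    exact inner_antiunitary (opJ V) η (opU V t ξ)

/-! #### The modular data of a standard subspace and the discharge of `exists_modularData` -/

/-- **The modular data `(Δ_V^{it}, J_V)` of a standard subspace**, CONSTRUCTED (bounded approach of
Rieffel–van Daele 1977): `Δ^{it} = 𝒰(-t)`, `J = opJ`. [cite: RieffelVandaele1977, Def. 2.1, Prop.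
2.2, Prop. 2.3, Def. 3.2, Prop. 3.3, Prop. 3.7, Appendix] -/
def modularData : ModularData V where
  U := modGroup V
  J := opJ V
  J_J := opJ₀_opJ₀ V
  J_U t x := opJ₀_opU V (-t) x
  U_mem t x hx := opU_mem V (-t) hx
  J_mem x hx := opJ₀_mem_symplComp V hx
  J_mem_of_mem_symplComp x hx := opJ₀_mem_of_mem_symplComp V hx
  re_inner_J_nonneg x hx := re_inner_opJ₀_nonneg V hx
  polar x := ⟨polarFn V x, continuousOn_polarFn V x, differentiableOn_polarFn V x,
    ⟨_, fun ζ hζ => norm_polarFn_le V x hζ⟩, fun t => by rw [polarFn_ofReal, modGroup_appReal_neg],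
    polarFn_half_I V x⟩
  kms ξ hξ η hη := kms_polarFn V hξ hη

end StandardSubspace

/-- **Discharge of `exists_modularData`**: every standard subspace of a complex Hilbert space
carries modular data (Longo Prop. 2.1.3, Thm. 2.1.4, Prop. 2.1.7, Prop. 2.1.9). The proof is the
BOUNDED approach of Rieffel–van Daele 1977 (§§2–4): with `P, Q` the real-orthogonal projections onto
`V, iV`, `R = P + Q` (complex-linear, `0 ≤ R ≤ 2`, `Ker R = Ker (2 - R) = 0`), `B = P - Q`
(conjugate-linear, `B² = A = R(2 - R)`, `B R = (2 - R) B`), one has `J = B A^{-1/2}` (an antiunitary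
involution with `J P = (1 - Q) J`) and `Δ^{it} = (2 - R)^{it} R^{-it}`; here every function of `R`
is
taken through Mathlib's CONTINUOUS functional calculus on the core `⋃ₙ Range bumpₙ(A)` and extended
by strong limits (no Borel calculus), the analytic continuation `Δ^{-iz} x` being the locally
uniform limit of the entire functions `z ↦ e^{iz Lₙ} Eₙ x`, `Lₙ` a bounded cut-off of `log Δ⁻¹`,
and the KMS function being `F(z) = ⟪Δ^{i z̄/2} η, Δ^{-iz/2} ξ⟫`.
[cite: RieffelVandaele1977, §§2–4 (P, Q, R = P + Q, JT = P - Q, Δ^{it} = (2 - R)^{it} R^{-it})]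
[cite: Longo2008LecturesConformalNets, Prop. 2.1.3, Thm. 2.1.4, Prop. 2.1.7, Prop. 2.1.9] -/
theorem StandardSubspace.exists_modularData_holds : StandardSubspace.exists_modularData :=
  fun _ _ _ _ V => ⟨StandardSubspace.modularData V⟩

end Literature.MathematicalPhysics.AQFT
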